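import Literature.NumberTheory.Sieve.AsymptoticSieveForPrimesTheorem2Counting
import HarnessLib

/-!
# Friedlander–Iwaniec, Proposition 2.1 in consumed form: arithmetic lemmas for the reduction `ã_n = μ²(n) a_n` (ASP §9)

Trunk T-SIEVE, family `parity`; first companion ("Lemmas") file of
`Literature.NumberTheory.Sieve.FriedlanderIwaniecPrimesProp21`. Source: J. Friedlander, H. Iwaniec,
*Asymptotic sieve for primes*, Ann. of Math. (2) 148 (1998), 1041–1065 [FriedlanderIwaniecASP1998]
(= arXiv:math/9811186), §9 "A generalization", pp. 1058–1063: the proof of Theorem 2 (Theorem 1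
for sequences not supported on squarefree numbers) by the reduction (9.4) `ã_n = μ²(n) a_n`,
(9.5) `g̃(p) = (g(p) - g(p²))/(1 - g(p²))`, (9.8) `G = ∏_p (1 - g(p²))`, (9.9)
`g̃(d) G = ∑_ν μ(ν) g([ν², d])`, and the estimates (9.10)–(9.12).

This file collects the purely arithmetic inputs of that proof, for an arbitrary multiplicative
`g : ArithmeticFunction ℝ` and arbitrary nonnegative sequences (no analysis):

* `sum_moebius_filter_sq_dvd` — detecting squarefree numbers, `∑_{ν² ∣ n} μ(ν) = μ²(n)`
  ("Detecting squarefree numbers by the Möbius formula", p. 1061);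
* `lcm_sq_eq_mul_div_gcd` and its companions — for squarefree `ν, d`:
  `[ν², d] = ν² · (d/(d,ν))` with coprime factors, `[ν², d]` is cubefree, and `ν` is recovered from
  `[ν², d]` as the product of the primes whose square divides it, whence "every `k` has at most
  `τ(k)` representations as `k = [ν², d]`" (`card_filter_lcm_sq_eq_le`, p. 1061);
* `sum_divisors_card_divisors_sq_le` — `∑_{k ∣ n} τ(k)² ≤ τ(n)³`;
* `sum_divisors_moebius_mul_apply_mul`, `sum_divisors_moebius_mul_apply_sq` — for squarefree `d`,
  `∑_{e ∣ d} μ(e) g(e d) = ∏_{p ∣ d} (g(p) - g(p²))` and `∑_{e ∣ d} μ(e) g(e²) = ∏_{p ∣ d} (1 - g(p²))`,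
  the finite Euler factors behind (9.5), (9.8), (9.9).

## References

* J. Friedlander, H. Iwaniec, *Asymptotic sieve for primes*, Ann. of Math. 148 (1998), 1041–1065,
  §9 pp. 1058–1063. [cite: FriedlanderIwaniecASP1998, §9]

## Mathlib / tree search

Mathlib: `ArithmeticFunction.moebius_mul_coe_zeta` (`∑_{d∣n} μ(d) = [n = 1]`),
`Nat.prod_pow_factorization_eq_self`, `Nat.factorization_le_iff_dvd`, `Nat.factorization_lcm`,
`Nat.Squarefree.ext_iff`, `Nat.squarefree_iff_factorization_le_one`, `Finset.prod_add`,
`ArithmeticFunction.IsMultiplicative.map_mul_of_coprime`, `Finset.sum_comp`,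
`Finset.sum_mul_sq_le_sq_mul_sq`, `Real.summable_nat_rpow`, `tendsto_atTop_ciInf`,
`Summable.sum_add_tsum_nat_add`, `Real.tsum_le_of_sum_range_le`, `isLittleO_log_rpow_rpow_atTop`.
Tree (reused, not restated): `IsCubefree` (`FriedlanderIwaniecPrimes`), `card_divisors_prime_pow`
(`…CrudeBound`), `sum_Icc_le_prod_primesLE_sum`, `fiMomentWeight`, `sum_fiMomentWeight_le`,
`one_le_fiLoss`, `one_le_card_divisors`, `sum_primesLE_inv_sq_le_one` (`…Prop21`),
`density_nonneg_of_isCubefree` (`…Theorem2Counting`), `density_squarefree_nonneg`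
(`…Theorem2Density`), `prod_one_add_le_exp_sum` (`…Reduction`), `CFZ.one_sub_sum_le_prod_one_sub`
(`SmoothMajorantLocal`), `FriedlanderIwaniecPrimesSquarefree.squarefree_prod_of_primes`,
`FriedlanderIwaniecPrimesSquarefree.log_pow_ten_le` (`…SquarefreeProofs`). The concurrent series
`AsymptoticSieveForPrimesTheorem2{Density, Identities, Counting, Tails, Inputs}` formalises the same
§9 with different bookkeeping (dyadic `ω`-weights, finite prime sets); this file is self-contained
above it and proves the two eventual estimates (9.7), (9.12) in one statement
(`sqfree_sieve_main_estimates`). `lean search` for the new names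
(`sum_moebius_filter_sq_dvd|lcm_sq_eq_mul_div_gcd|card_filter_lcm_sq_eq_le|sqfree_sieve_main_estimates`):
nothing.
-/

noncomputable section

open Filter Finset Real
open scoped ArithmeticFunction.Moebius ArithmeticFunction.sigma ArithmeticFunction.omega

namespace Literature.NumberTheory.Sieve.ASPTheorem2

/-! ### Detecting squarefree numbers: `∑_{ν² ∣ n} μ(ν) = μ²(n)` -/

/-- The "square root of the largest square divisor": `r(n) = ∏_p p^{⌊v_p(n)/2⌋}`, as the product of
the finsupp `p ↦ ⌊v_p(n)/2⌋`. [folklore] -/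
theorem factorization_sqrtPart (n : ℕ) :
    ((Finsupp.mapRange (fun k => k / 2) (rfl : (0 : ℕ) / 2 = 0) n.factorization).prod
        (· ^ ·)).factorization =
      Finsupp.mapRange (fun k => k / 2) (rfl : (0 : ℕ) / 2 = 0) n.factorization := by
  refine Nat.prod_pow_factorization_eq_self fun p hp => ?_
  have : p ∈ n.factorization.support := Finsupp.support_mapRange hp
  exact Nat.prime_of_mem_primeFactors (by rwa [Nat.support_factorization] at this)

/-- For `n ≥ 1`: `ν² ∣ n` iff `ν` divides `r(n) = ∏_p p^{⌊v_p(n)/2⌋}`. [folklore] -/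
theorem sq_dvd_iff_dvd_sqrtPart {n : ℕ} (hn : n ≠ 0) (ν : ℕ) :
    ν ^ 2 ∣ n ↔ ν ∣ (Finsupp.mapRange (fun k => k / 2) (rfl : (0 : ℕ) / 2 = 0)
      n.factorization).prod (· ^ ·) := by
  set f := Finsupp.mapRange (fun k => k / 2) (rfl : (0 : ℕ) / 2 = 0) n.factorization with hf
  set r := f.prod (· ^ ·) with hr
  have hrf : r.factorization = f := factorization_sqrtPart n
  have hr0 : r ≠ 0 := by
    rw [hr, Finsupp.prod]
    refine prod_ne_zero_iff.mpr fun p hp => pow_ne_zero _ ?_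
    have : p ∈ n.factorization.support := Finsupp.support_mapRange hp
    exact (Nat.prime_of_mem_primeFactors (by rwa [Nat.support_factorization] at this)).ne_zero
  rcases eq_or_ne ν 0 with rfl | hν
  · simp only [ne_eq, OfNat.ofNat_ne_zero, not_false_eq_true, zero_pow, zero_dvd_iff, hn, hr0]
  rw [← Nat.factorization_le_iff_dvd (pow_ne_zero 2 hν) hn, ← Nat.factorization_le_iff_dvd hν hr0,
    hrf, Nat.factorization_pow]
  constructor
  · intro h p
    have hp := h p
    simp only [Finsupp.smul_apply, smul_eq_mul] at hp
    rw [hf, Finsupp.mapRange_apply]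
    omega
  · intro h p
    have hp := h p
    rw [hf, Finsupp.mapRange_apply] at hp
    simp only [Finsupp.smul_apply, smul_eq_mul]
    omega

/-- **Detecting squarefree numbers by the Möbius formula**: for `1 ≤ n ≤ M`,
`∑_{1 ≤ ν ≤ M, ν² ∣ n} μ(ν) = 1` if `n` is squarefree and `0` otherwise (the `ν` with `ν² ∣ n` are
the divisors of `r(n) = ∏_p p^{⌊v_p(n)/2⌋}`, and `r(n) = 1` iff `n` is squarefree).
[cite: FriedlanderIwaniecASP1998, §9 p. 1061] -/
theorem sum_moebius_filter_sq_dvd {n M : ℕ} (hn : n ≠ 0) (hnM : n ≤ M) :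
    ∑ ν ∈ (Icc 1 M).filter (fun ν => ν ^ 2 ∣ n), (μ ν : ℝ) = if Squarefree n then 1 else 0 := by
  classical
  set f := Finsupp.mapRange (fun k => k / 2) (rfl : (0 : ℕ) / 2 = 0) n.factorization with hf
  set r := f.prod (· ^ ·) with hr
  have hrf : r.factorization = f := factorization_sqrtPart n
  have hr0 : r ≠ 0 := by
    rw [hr, Finsupp.prod]
    refine prod_ne_zero_iff.mpr fun p hp => pow_ne_zero _ ?_
    have : p ∈ n.factorization.support := Finsupp.support_mapRange hp
    exact (Nat.prime_of_mem_primeFactors (by rwa [Nat.support_factorization] at this)).ne_zero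
  -- the index set is `r.divisors`
  have hset : (Icc 1 M).filter (fun ν => ν ^ 2 ∣ n) = r.divisors := by
    ext ν
    rw [mem_filter, mem_Icc, Nat.mem_divisors, sq_dvd_iff_dvd_sqrtPart hn ν]
    constructor
    · rintro ⟨-, h⟩; exact ⟨h, hr0⟩
    · rintro ⟨h, -⟩
      have hν0 : ν ≠ 0 := fun h0 => hr0 (zero_dvd_iff.mp (h0 ▸ h))
      refine ⟨⟨Nat.one_le_iff_ne_zero.mpr hν0, ?_⟩, h⟩
      have h2 : ν ^ 2 ∣ n := (sq_dvd_iff_dvd_sqrtPart hn ν).mpr h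
      calc ν ≤ ν ^ 2 := Nat.le_self_pow two_ne_zero ν
        _ ≤ n := Nat.le_of_dvd (Nat.pos_of_ne_zero hn) h2
        _ ≤ M := hnM
  rw [hset]
  -- `∑_{ν ∣ r} μ(ν) = [r = 1]`
  have hsum : ∑ ν ∈ r.divisors, (μ ν : ℝ) = if r = 1 then 1 else 0 := by
    have h := congrArg (fun f : ArithmeticFunction ℤ => f r) ArithmeticFunction.moebius_mul_coe_zeta
    simp only [ArithmeticFunction.coe_mul_zeta_apply, ArithmeticFunction.one_apply] at h
    have h' : ((∑ i ∈ r.divisors, μ i : ℤ) : ℝ) = ((if r = 1 then 1 else 0 : ℤ) : ℝ) := by rw [h]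
    push_cast at h'
    rw [h']
  rw [hsum]
  -- `r = 1 ↔ n squarefree`
  have hiff : r = 1 ↔ Squarefree n := by
    rw [Nat.squarefree_iff_factorization_le_one hn]
    constructor
    · intro h1 p
      have : f p = 0 := by rw [← hrf, h1, Nat.factorization_one, Finsupp.zero_apply]
      rw [hf, Finsupp.mapRange_apply] at this
      omega
    · intro h
      have hf0 : f = 0 := by
        ext p
        rw [hf, Finsupp.mapRange_apply, Finsupp.zero_apply]
        have := h p
        omega
      rw [hr, hf0, Finsupp.prod_zero_index]
  by_cases hsq : Squarefree n
  · rw [if_pos hsq, if_pos (hiff.mpr hsq)]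
  · rw [if_neg hsq, if_neg (fun h => hsq (hiff.mp h))]

/-! ### `[ν², d]` for squarefree `ν`, `d` -/

/-- For squarefree `d` and any `ν`: `d / gcd(d, ν)` is coprime to `ν`. [folklore] -/
theorem coprime_div_gcd_of_squarefree {d : ℕ} (hd : Squarefree d) (ν : ℕ) :
    (d / Nat.gcd d ν).Coprime ν := by
  rw [Nat.coprime_iff_gcd_eq_one]
  by_contra h
  obtain ⟨p, hp, hpdvd⟩ := Nat.exists_prime_and_dvd h
  have hp1 : p ∣ d / Nat.gcd d ν := hpdvd.trans (Nat.gcd_dvd_left _ _)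
  have hp2 : p ∣ ν := hpdvd.trans (Nat.gcd_dvd_right _ _)
  have hpd : p ∣ d := hp1.trans (Nat.div_dvd_of_dvd (Nat.gcd_dvd_left d ν))
  have hpg : p ∣ Nat.gcd d ν := Nat.dvd_gcd hpd hp2
  -- then `p² ∣ d`
  have hpp : p * p ∣ d := by
    have := Nat.mul_dvd_mul hpg hp1
    rwa [Nat.mul_div_cancel' (Nat.gcd_dvd_left d ν)] at this
  exact hp.ne_one (Nat.isUnit_iff.mp (hd p hpp))

/-- For squarefree `d` and any `ν`: `gcd(ν², d) = gcd(ν, d)` (both are the product of the primes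
dividing `ν` and `d`). [folklore] -/
theorem gcd_sq_eq_gcd_of_squarefree {d : ℕ} (hd : Squarefree d) (ν : ℕ) :
    Nat.gcd (ν ^ 2) d = Nat.gcd ν d := by
  have h1 : Squarefree (Nat.gcd (ν ^ 2) d) := hd.squarefree_of_dvd (Nat.gcd_dvd_right _ _)
  have h2 : Squarefree (Nat.gcd ν d) := hd.squarefree_of_dvd (Nat.gcd_dvd_right _ _)
  rw [Nat.Squarefree.ext_iff h1 h2]
  intro p hp
  rw [Nat.dvd_gcd_iff, Nat.dvd_gcd_iff, hp.prime.dvd_pow_iff_dvd two_ne_zero]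

/-- For squarefree `d` and any `ν`: `[ν², d] = ν² · (d / gcd(ν, d))`. [folklore] -/
theorem lcm_sq_eq_mul_div_gcd {d : ℕ} (hd : Squarefree d) (ν : ℕ) :
    Nat.lcm (ν ^ 2) d = ν ^ 2 * (d / Nat.gcd ν d) := by
  rw [Nat.lcm, gcd_sq_eq_gcd_of_squarefree hd ν, Nat.mul_div_assoc _ (Nat.gcd_dvd_right ν d)]

/-- For squarefree `d` and any `ν`: `ν²` is coprime to `d / gcd(ν, d)`. [folklore] -/
theorem coprime_sq_div_gcd {d : ℕ} (hd : Squarefree d) (ν : ℕ) :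
    (ν ^ 2).Coprime (d / Nat.gcd ν d) := by
  have h := coprime_div_gcd_of_squarefree hd ν
  rw [Nat.gcd_comm] at h
  exact h.symm.pow_left 2

/-- A multiplicative function at `[ν², d]`, `d` squarefree: `g([ν², d]) = g(ν²) g(d / gcd(ν, d))`.
[folklore] -/
theorem map_lcm_sq_of_squarefree {g : ArithmeticFunction ℝ} (hg : g.IsMultiplicative) {d : ℕ}
    (hd : Squarefree d) (ν : ℕ) : g (Nat.lcm (ν ^ 2) d) = g (ν ^ 2) * g (d / Nat.gcd ν d) := by
  rw [lcm_sq_eq_mul_div_gcd hd ν, hg.map_mul_of_coprime (coprime_sq_div_gcd hd ν)]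

/-- For squarefree `ν`, `d`: `[ν², d]` is cubefree. [cite: FriedlanderIwaniecASP1998, §9 p. 1061] -/
theorem isCubefree_lcm_sq {ν d : ℕ} (hν : Squarefree ν) (hd : Squarefree d) :
    IsCubefree (Nat.lcm (ν ^ 2) d) := by
  intro p _
  rw [Nat.factorization_lcm (pow_ne_zero 2 hν.ne_zero) hd.ne_zero, Finsupp.sup_apply,
    Nat.factorization_pow, Finsupp.smul_apply, smul_eq_mul]
  have h1 := hν.natFactorization_le_one p
  have h2 := hd.natFactorization_le_one p
  exact sup_le (by omega) (by omega)

/-- For squarefree `ν`, `d` and a prime `p`: `p ∣ ν` iff `p² ∣ [ν², d]` (so `ν` is determined by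
`[ν², d]`). [cite: FriedlanderIwaniecASP1998, §9 p. 1061] -/
theorem dvd_iff_sq_dvd_lcm_sq {ν d p : ℕ} (hν : Squarefree ν) (hd : Squarefree d) (hp : p.Prime) :
    p ∣ ν ↔ p ^ 2 ∣ Nat.lcm (ν ^ 2) d := by
  have hl0 : Nat.lcm (ν ^ 2) d ≠ 0 := Nat.lcm_ne_zero (pow_ne_zero 2 hν.ne_zero) hd.ne_zero
  rw [hp.pow_dvd_iff_le_factorization hl0, Nat.factorization_lcm (pow_ne_zero 2 hν.ne_zero)
    hd.ne_zero, Finsupp.sup_apply, Nat.factorization_pow, Finsupp.smul_apply, smul_eq_mul,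
    hp.dvd_iff_one_le_factorization hν.ne_zero]
  have h2 := hd.natFactorization_le_one p
  constructor
  · intro h; exact le_sup_of_le_left (by omega)
  · intro h
    rcases le_sup_iff.mp h with h' | h'
    · omega
    · omega

/-- **"Every `k` has at most `τ(k)` representations as `k = [ν², d]`"** with `ν`, `d` squarefree
(the map `(ν, d) ↦ d` is injective on the representations, `ν` being the product of the primes `p`
with `p² ∣ k`, and `d ∣ k`). [cite: FriedlanderIwaniecASP1998, §9 p. 1061] -/
theorem card_filter_lcm_sq_eq_le (S T : Finset ℕ) (hS : ∀ ν ∈ S, Squarefree ν)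
    (hT : ∀ d ∈ T, Squarefree d) {k : ℕ} (hk : k ≠ 0) :
    #((S ×ˢ T).filter (fun q : ℕ × ℕ => Nat.lcm (q.1 ^ 2) q.2 = k)) ≤ #k.divisors := by
  classical
  refine Finset.card_le_card_of_injOn Prod.snd (fun q hq => ?_) ?_
  · obtain ⟨hq, hqk⟩ := mem_filter.mp (mem_coe.mp hq)
    rw [mem_coe, Nat.mem_divisors]
    exact ⟨hqk ▸ Nat.dvd_lcm_right _ _, hk⟩
  · intro q hq q' hq' h
    obtain ⟨hq, hqk⟩ := mem_filter.mp (mem_coe.mp hq)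
    obtain ⟨hq', hqk'⟩ := mem_filter.mp (mem_coe.mp hq')
    obtain ⟨hq1, hq2⟩ := mem_product.mp hq
    obtain ⟨hq1', hq2'⟩ := mem_product.mp hq'
    refine Prod.ext ?_ h
    rw [Nat.Squarefree.ext_iff (hS _ hq1) (hS _ hq1')]
    intro p hp
    rw [dvd_iff_sq_dvd_lcm_sq (hS _ hq1) (hT _ hq2) hp,
      dvd_iff_sq_dvd_lcm_sq (hS _ hq1') (hT _ hq2') hp, hqk, hqk']

/-! ### Divisor-function inequalities -/

/-- `∑_{k ∣ n} τ(k)² ≤ τ(n)³` (`τ(k) ≤ τ(n)` for `k ∣ n`). [folklore] -/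
theorem sum_divisors_card_divisors_sq_le (n : ℕ) :
    ∑ k ∈ n.divisors, (#k.divisors : ℝ) ^ 2 ≤ (#n.divisors : ℝ) ^ 3 := by
  rcases eq_or_ne n 0 with rfl | hn
  · simp
  calc ∑ k ∈ n.divisors, (#k.divisors : ℝ) ^ 2 ≤ ∑ k ∈ n.divisors, (#n.divisors : ℝ) ^ 2 := by
        refine sum_le_sum fun k hk => ?_
        have : #k.divisors ≤ #n.divisors :=
          card_le_card (Nat.divisors_subset_of_dvd hn (Nat.dvd_of_mem_divisors hk))
        exact pow_le_pow_left₀ (Nat.cast_nonneg _) (by exact_mod_cast this) 2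
    _ = (#n.divisors : ℝ) ^ 3 := by rw [sum_const, nsmul_eq_mul]; ring

/-! ### The finite Euler factors behind (9.5), (9.8), (9.9) -/

/-- `∑_{e ∣ d} μ(e) g(e²) = ∏_{p ∣ d} (1 - g(p²))` for squarefree `d` and multiplicative `g` (the
Euler factors of `G`, (9.8)). [cite: FriedlanderIwaniecASP1998, §9 (9.8)] -/
theorem sum_divisors_moebius_mul_apply_sq {g : ArithmeticFunction ℝ} (hg : g.IsMultiplicative)
    {d : ℕ} (hd : Squarefree d) :
    ∑ e ∈ d.divisors, (μ e : ℝ) * g (e ^ 2) = ∏ p ∈ d.primeFactors, (1 - g (p ^ 2)) := by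
  let F : ArithmeticFunction ℝ := ⟨fun ν => g (ν ^ 2), by simp⟩
  have hF : F.IsMultiplicative := by
    refine ⟨by simp [F, hg.map_one], fun {m n} hmn => ?_⟩
    simp only [F, ArithmeticFunction.coe_mk, mul_pow]
    exact hg.map_mul_of_coprime (hmn.pow 2 2)
  have h := ArithmeticFunction.IsMultiplicative.prodPrimeFactors_one_sub_of_squarefree F hF hd
  simpa [F] using h.symm

/-- `∑_{e ∣ d} μ(e) g(e d) = ∏_{p ∣ d} (g(p) - g(p²))` for squarefree `d` and multiplicative `g` (the
Euler factors of `g̃(d) G`, (9.5), (9.9): the Dirichlet convolution of `μ(e) g(e²)` with `g` at the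
squarefree `d`, `g(e²) g(d/e) = g(e d)`). [cite: FriedlanderIwaniecASP1998, §9 (9.5), (9.9)] -/
theorem sum_divisors_moebius_mul_apply_mul {g : ArithmeticFunction ℝ} (hg : g.IsMultiplicative)
    {d : ℕ} (hd : Squarefree d) :
    ∑ e ∈ d.divisors, (μ e : ℝ) * g (e * d) = ∏ p ∈ d.primeFactors, (g p - g (p ^ 2)) := by
  let F : ArithmeticFunction ℝ := ⟨fun ν => g (ν ^ 2), by simp⟩
  have hF : F.IsMultiplicative := by
    refine ⟨by simp [F, hg.map_one], fun {m n} hmn => ?_⟩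
    simp only [F, ArithmeticFunction.coe_mk, mul_pow]
    exact hg.map_mul_of_coprime (hmn.pow 2 2)
  have hM : ((μ : ArithmeticFunction ℝ).pmul F).IsMultiplicative :=
    ArithmeticFunction.isMultiplicative_moebius.intCast.pmul hF
  have key := ArithmeticFunction.IsMultiplicative.prodPrimeFactors_add_of_squarefree hM hg hd
  rw [ArithmeticFunction.prodPrimeFactors_apply hd.ne_zero] at key
  have hL : ∏ p ∈ d.primeFactors, (((μ : ArithmeticFunction ℝ).pmul F) + g) p =
      ∏ p ∈ d.primeFactors, (g p - g (p ^ 2)) := by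
    refine prod_congr rfl fun p hp => ?_
    have hp' := Nat.prime_of_mem_primeFactors hp
    simp only [F, ArithmeticFunction.add_apply, ArithmeticFunction.pmul_apply,
      ArithmeticFunction.intCoe_apply, ArithmeticFunction.coe_mk,
      ArithmeticFunction.moebius_apply_prime hp']
    push_cast
    ring
  have hR : (((μ : ArithmeticFunction ℝ).pmul F) * g) d = ∑ e ∈ d.divisors, (μ e : ℝ) * g (e * d) := by
    rw [ArithmeticFunction.mul_apply,
      Nat.sum_divisorsAntidiagonal (f := fun a b => ((μ : ArithmeticFunction ℝ).pmul F) a * g b)]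
    refine sum_congr rfl fun e he => ?_
    have hed : e ∣ d := Nat.dvd_of_mem_divisors he
    simp only [ArithmeticFunction.pmul_apply, ArithmeticFunction.intCoe_apply, F,
      ArithmeticFunction.coe_mk]
    have hcop : (e ^ 2).Coprime (d / e) := by
      have hsq : Squarefree (e * (d / e)) := by rwa [Nat.mul_div_cancel' hed]
      exact (Nat.squarefree_mul_iff.mp hsq).1.pow_left 2
    rw [mul_assoc, ← hg.map_mul_of_coprime hcop]
    congr 2
    rw [sq, mul_assoc, Nat.mul_div_cancel' hed]
  rw [← hR, ← key, hL]

/-- `∑_{e ∣ d} g(e²) = ∏_{p ∣ d} (1 + g(p²))` for squarefree `d` and multiplicative `g`. [folklore] -/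
theorem sum_divisors_apply_sq {g : ArithmeticFunction ℝ} (hg : g.IsMultiplicative) {d : ℕ}
    (hd : Squarefree d) : ∑ e ∈ d.divisors, g (e ^ 2) = ∏ p ∈ d.primeFactors, (1 + g (p ^ 2)) := by
  let F : ArithmeticFunction ℝ := ⟨fun ν => g (ν ^ 2), by simp⟩
  have hF : F.IsMultiplicative := by
    refine ⟨by simp [F, hg.map_one], fun {m n} hmn => ?_⟩
    simp only [F, ArithmeticFunction.coe_mk, mul_pow]
    exact hg.map_mul_of_coprime (hmn.pow 2 2)
  have h := hF.prodPrimeFactors_one_add_of_squarefree hd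
  simpa [F] using h.symm

/-! ### The decomposition of `∑_ν μ(ν) g(ν²) φ((ν, d))` along `e = (ν, d)` -/

/-- **Fibring the squarefree `ν ≤ V` by `e = gcd(ν, d)`** (`d` squarefree): `ν = e m` with `e ∣ d`,
`m ≤ V/e` squarefree and coprime to `d`, and `μ(ν) g(ν²) = μ(e) μ(m) g(e²) g(m²)`:
`∑_{ν ≤ V}^♭ μ(ν) g(ν²) φ((ν,d)) = ∑_{e ∣ d} μ(e) g(e²) φ(e) ∑_{m ≤ V/e, (m,d)=1}^♭ μ(m) g(m²)`.
This is the finite form of the manipulation behind (9.9). [cite: FriedlanderIwaniecASP1998, §9 (9.9)] -/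
theorem sum_sqfree_moebius_sq_eq_sum_divisors {g : ArithmeticFunction ℝ} (hg : g.IsMultiplicative)
    {d : ℕ} (hd : Squarefree d) (V : ℕ) (φ : ℕ → ℝ) :
    ∑ ν ∈ (Icc 1 V).filter Squarefree, (μ ν : ℝ) * g (ν ^ 2) * φ (Nat.gcd ν d) =
      ∑ e ∈ d.divisors, (μ e : ℝ) * g (e ^ 2) * φ e *
        ∑ m ∈ (Icc 1 (V / e)).filter (fun m => Squarefree m ∧ m.Coprime d),
          (μ m : ℝ) * g (m ^ 2) := by
  classical
  rw [← sum_fiberwise_of_maps_to (s := (Icc 1 V).filter Squarefree) (t := d.divisors)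
    (g := fun ν => Nat.gcd ν d)
    (fun ν _ => Nat.mem_divisors.mpr ⟨Nat.gcd_dvd_right ν d, hd.ne_zero⟩)]
  refine sum_congr rfl fun e he => ?_
  have hed : e ∣ d := Nat.dvd_of_mem_divisors he
  have he0 : 0 < e := Nat.pos_of_mem_divisors he
  have hesq : Squarefree e := hd.squarefree_of_dvd hed
  set T := (Icc 1 (V / e)).filter (fun m => Squarefree m ∧ m.Coprime d) with hT
  -- `gcd(e m, d) = e` for `m` coprime to `d`
  have hgcd : ∀ m : ℕ, m.Coprime d → Nat.gcd (e * m) d = e := by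
    intro m hm
    conv_lhs => rw [← Nat.mul_div_cancel' hed]
    rw [Nat.gcd_mul_left, Nat.Coprime.coprime_dvd_right (Nat.div_dvd_of_dvd hed) hm, mul_one]
  -- the fibre over `e` is the image of `T` under `m ↦ e m`
  have himage : ((Icc 1 V).filter Squarefree).filter (fun ν => Nat.gcd ν d = e) =
      T.image (fun m => e * m) := by
    ext ν
    simp only [mem_filter, mem_Icc, mem_image, hT]
    constructor
    · rintro ⟨⟨⟨hν1, hνV⟩, hνsq⟩, hνe⟩
      have heν : e ∣ ν := hνe ▸ Nat.gcd_dvd_left ν d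
      refine ⟨ν / e, ⟨⟨Nat.div_pos (Nat.le_of_dvd hν1 heν) he0, Nat.div_le_div_right hνV⟩,
        hνsq.squarefree_of_dvd (Nat.div_dvd_of_dvd heν), ?_⟩, Nat.mul_div_cancel' heν⟩
      rw [Nat.coprime_iff_gcd_eq_one]
      by_contra hne
      obtain ⟨p, hp, hpg⟩ := Nat.exists_prime_and_dvd hne
      have hp1 : p ∣ ν / e := hpg.trans (Nat.gcd_dvd_left _ _)
      have hp2 : p ∣ d := hpg.trans (Nat.gcd_dvd_right _ _)
      have hpν : p ∣ ν := hp1.trans (Nat.div_dvd_of_dvd heν)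
      have hpe : p ∣ e := hνe ▸ Nat.dvd_gcd hpν hp2
      have hpp : p * p ∣ ν := by
        have := Nat.mul_dvd_mul hpe hp1
        rwa [Nat.mul_div_cancel' heν] at this
      exact hp.ne_one (Nat.isUnit_iff.mp (hνsq p hpp))
    · rintro ⟨m, ⟨⟨hm1, hmV⟩, hmsq, hmcop⟩, rfl⟩
      have hcop_em : e.Coprime m := Nat.Coprime.coprime_dvd_left hed hmcop.symm
      refine ⟨⟨⟨Nat.one_le_iff_ne_zero.mpr (Nat.mul_ne_zero he0.ne' (by omega)), ?_⟩, ?_⟩,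
        hgcd m hmcop⟩
      · calc e * m ≤ e * (V / e) := Nat.mul_le_mul_left e hmV
          _ ≤ V := Nat.mul_div_le V e
      · exact Nat.squarefree_mul_iff.mpr ⟨hcop_em, hesq, hmsq⟩
  rw [himage, sum_image]
  · rw [mul_sum]
    refine sum_congr rfl fun m hm => ?_
    obtain ⟨-, hmsq, hmcop⟩ := mem_filter.mp hm
    have hcop_em : e.Coprime m := Nat.Coprime.coprime_dvd_left hed hmcop.symm
    have hμ : (μ (e * m) : ℝ) = (μ e : ℝ) * (μ m : ℝ) := by
      rw [ArithmeticFunction.isMultiplicative_moebius.map_mul_of_coprime hcop_em]; push_cast; ring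
    have hgg : g ((e * m) ^ 2) = g (e ^ 2) * g (m ^ 2) := by
      rw [mul_pow, hg.map_mul_of_coprime (hcop_em.pow 2 2)]
    rw [hμ, hgg, hgcd m hmcop]
    ring
  · intro m _ m' _ h
    exact Nat.eq_of_mul_eq_mul_left he0 h

/-- **(9.9), finite form: `M_d(V) = ∑_{e ∣ d} μ(e) g(e d) S_d(V/e)`** where
`M_d(V) = ∑_{ν ≤ V}^♭ μ(ν) g([ν², d])` and `S_d(W) = ∑_{m ≤ W, (m,d)=1}^♭ μ(m) g(m²)` (`d` squarefree,
`g` multiplicative; `g([ν²,d]) = g(ν²) g(d/(ν,d))`, `g(e²) g(d/e) = g(e d)`).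
[cite: FriedlanderIwaniecASP1998, §9 (9.9)] -/
theorem sum_sqfree_moebius_lcm_eq {g : ArithmeticFunction ℝ} (hg : g.IsMultiplicative) {d : ℕ}
    (hd : Squarefree d) (V : ℕ) :
    ∑ ν ∈ (Icc 1 V).filter Squarefree, (μ ν : ℝ) * g (Nat.lcm (ν ^ 2) d) =
      ∑ e ∈ d.divisors, (μ e : ℝ) * g (e * d) *
        ∑ m ∈ (Icc 1 (V / e)).filter (fun m => Squarefree m ∧ m.Coprime d),
          (μ m : ℝ) * g (m ^ 2) := by
  have h := sum_sqfree_moebius_sq_eq_sum_divisors hg hd V (fun e => g (d / e))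
  have hl : ∀ ν : ℕ, (μ ν : ℝ) * g (Nat.lcm (ν ^ 2) d) = (μ ν : ℝ) * g (ν ^ 2) * g (d / Nat.gcd ν d) :=
    fun ν => by rw [map_lcm_sq_of_squarefree hg hd ν, mul_assoc]
  simp_rw [hl, h]
  refine sum_congr rfl fun e he => ?_
  have hed : e ∣ d := Nat.dvd_of_mem_divisors he
  have hcop : (e ^ 2).Coprime (d / e) := by
    have hsq : Squarefree (e * (d / e)) := by rwa [Nat.mul_div_cancel' hed]
    exact (Nat.squarefree_mul_iff.mp hsq).1.pow_left 2
  have : g (e ^ 2) * g (d / e) = g (e * d) := by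
    rw [← hg.map_mul_of_coprime hcop, sq, mul_assoc, Nat.mul_div_cancel' hed]
  rw [mul_assoc ((μ e : ℝ)), this]

/-- **`M_1(V)` fibred along `d`**: `∑_{ν ≤ V}^♭ μ(ν) g(ν²) = ∑_{e ∣ d} μ(e) g(e²) S_d(V/e)`.
[cite: FriedlanderIwaniecASP1998, §9 (9.9)] -/
theorem sum_sqfree_moebius_sq_eq {g : ArithmeticFunction ℝ} (hg : g.IsMultiplicative) {d : ℕ}
    (hd : Squarefree d) (V : ℕ) :
    ∑ ν ∈ (Icc 1 V).filter Squarefree, (μ ν : ℝ) * g (ν ^ 2) =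
      ∑ e ∈ d.divisors, (μ e : ℝ) * g (e ^ 2) *
        ∑ m ∈ (Icc 1 (V / e)).filter (fun m => Squarefree m ∧ m.Coprime d),
          (μ m : ℝ) * g (m ^ 2) := by
  have h := sum_sqfree_moebius_sq_eq_sum_divisors hg hd V (fun _ => 1)
  simpa using h

/-- **The truncation error in (9.9)**: for squarefree `d`, multiplicative `g` with `g(ν²) ≥ 0`
(`ν` squarefree), any `c` with `c · ∑_{e∣d} μ(e) g(e²) = ∑_{e∣d} μ(e) g(e d)` (i.e. `c = g̃(d)` when
`∏_{p∣d}(1 - g(p²)) ≠ 0`), and `V ≥ 1`: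
`|M_d(V) - c M_1(V)| ≤ T_d(V) · (∑_{e∣d} g(e²) g(d/e) + |c| ∑_{e∣d} g(e²))`, where
`T_d(V) = ∑_{V/d < ν ≤ V}^♭ g(ν²)` bounds every `|S_d(V) - S_d(V/e)|`, `e ∣ d`. (FI use the
infinite identity `g̃(d) G = ∑_ν μ(ν) g([ν²,d])`; this is its finite version with the tails
explicit.) [cite: FriedlanderIwaniecASP1998, §9 (9.9)] -/
theorem abs_sum_lcm_sub_mul_sum_sq_le {g : ArithmeticFunction ℝ} (hg : g.IsMultiplicative)
    (hg0 : ∀ ν : ℕ, Squarefree ν → 0 ≤ g (ν ^ 2)) (hg0' : ∀ e : ℕ, Squarefree e → 0 ≤ g e)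
    {d : ℕ} (hd : Squarefree d) (V : ℕ) {c : ℝ}
    (hc : c * ∑ e ∈ d.divisors, (μ e : ℝ) * g (e ^ 2) = ∑ e ∈ d.divisors, (μ e : ℝ) * g (e * d)) :
    |∑ ν ∈ (Icc 1 V).filter Squarefree, (μ ν : ℝ) * g (Nat.lcm (ν ^ 2) d) -
        c * ∑ ν ∈ (Icc 1 V).filter Squarefree, (μ ν : ℝ) * g (ν ^ 2)| ≤
      (∑ ν ∈ (Ioc (V / d) V).filter Squarefree, g (ν ^ 2)) *
        (∑ e ∈ d.divisors, g (e ^ 2) * g (d / e) + |c| * ∑ e ∈ d.divisors, g (e ^ 2)) := by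
  classical
  -- notation: `S W`
  set S : ℕ → ℝ := fun W => ∑ m ∈ (Icc 1 W).filter (fun m => Squarefree m ∧ m.Coprime d),
    (μ m : ℝ) * g (m ^ 2) with hS
  set T : ℝ := ∑ ν ∈ (Ioc (V / d) V).filter Squarefree, g (ν ^ 2) with hT
  have hT0 : 0 ≤ T := sum_nonneg fun ν hν => hg0 ν (mem_filter.mp hν).2
  rw [sum_sqfree_moebius_lcm_eq hg hd V, sum_sqfree_moebius_sq_eq hg hd V]
  -- `g(e d) = g(e²) g(d/e)`
  have hged : ∀ e ∈ d.divisors, g (e * d) = g (e ^ 2) * g (d / e) := by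
    intro e he
    have hed : e ∣ d := Nat.dvd_of_mem_divisors he
    have hcop : (e ^ 2).Coprime (d / e) := by
      have hsq : Squarefree (e * (d / e)) := by rwa [Nat.mul_div_cancel' hed]
      exact (Nat.squarefree_mul_iff.mp hsq).1.pow_left 2
    rw [← hg.map_mul_of_coprime hcop, sq, mul_assoc, Nat.mul_div_cancel' hed]
  -- tails: `|S(V) - S(V/e)| ≤ T` for `e ∣ d`
  have htail : ∀ e ∈ d.divisors, |S (V / e) - S V| ≤ T := by
    intro e he
    have hed : e ∣ d := Nat.dvd_of_mem_divisors he
    have he0 : 0 < e := Nat.pos_of_mem_divisors he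
    have hle : V / e ≤ V := Nat.div_le_self V e
    have hdle : V / d ≤ V / e :=
      Nat.div_le_div_left (Nat.le_of_dvd (Nat.pos_of_ne_zero hd.ne_zero) hed) he0
    have hsplit : (Icc 1 V).filter (fun m => Squarefree m ∧ m.Coprime d) =
        (Icc 1 (V / e)).filter (fun m => Squarefree m ∧ m.Coprime d) ∪
          (Ioc (V / e) V).filter (fun m => Squarefree m ∧ m.Coprime d) := by
      rw [← filter_union]
      congr 1
      ext m
      simp only [mem_Icc, mem_union, mem_Ioc]
      constructor
      · rintro ⟨h1, h2⟩
        rcases le_or_gt m (V / e) with h | h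
        · exact Or.inl ⟨h1, h⟩
        · exact Or.inr ⟨h, h2⟩
      · rintro (⟨h1, h2⟩ | ⟨h1, h2⟩)
        · exact ⟨h1, h2.trans hle⟩
        · exact ⟨Nat.succ_le_of_lt (lt_of_le_of_lt (Nat.zero_le _) h1), h2⟩
    have hdisj : Disjoint ((Icc 1 (V / e)).filter (fun m => Squarefree m ∧ m.Coprime d))
        ((Ioc (V / e) V).filter (fun m => Squarefree m ∧ m.Coprime d)) := by
      refine disjoint_filter_filter ?_
      refine disjoint_left.mpr fun m hm hm' => ?_
      rw [mem_Icc] at hm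
      rw [mem_Ioc] at hm'
      exact absurd (lt_of_le_of_lt hm.2 hm'.1) (lt_irrefl m)
    have hSV : S V = S (V / e) + ∑ m ∈ (Ioc (V / e) V).filter (fun m => Squarefree m ∧ m.Coprime d),
        (μ m : ℝ) * g (m ^ 2) := by
      simp only [hS]
      rw [hsplit, sum_union hdisj]
    rw [abs_sub_comm, hSV, add_sub_cancel_left]
    refine (abs_sum_le_sum_abs _ _).trans ?_
    calc ∑ m ∈ (Ioc (V / e) V).filter (fun m => Squarefree m ∧ m.Coprime d), |(μ m : ℝ) * g (m ^ 2)|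
        ≤ ∑ m ∈ (Ioc (V / e) V).filter (fun m => Squarefree m ∧ m.Coprime d), g (m ^ 2) := by
          refine sum_le_sum fun m hm => ?_
          have hmsq := (mem_filter.mp hm).2.1
          rw [abs_mul, abs_of_nonneg (hg0 m hmsq)]
          have : |(μ m : ℝ)| ≤ 1 := by exact_mod_cast ArithmeticFunction.abs_moebius_le_one
          nlinarith [hg0 m hmsq]
      _ ≤ T := by
          refine sum_le_sum_of_subset_of_nonneg ?_ fun m hm _ => hg0 m (mem_filter.mp hm).2
          intro m hm
          obtain ⟨hm1, hmsq, -⟩ := mem_filter.mp hm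
          refine mem_filter.mpr ⟨?_, hmsq⟩
          rw [mem_Ioc] at hm1 ⊢
          exact ⟨lt_of_le_of_lt hdle hm1.1, hm1.2⟩
  -- remove the complete sums using `hc`
  have h0 : ∑ e ∈ d.divisors, ((μ e : ℝ) * g (e * d) - c * ((μ e : ℝ) * g (e ^ 2))) * S V = 0 := by
    rw [← sum_mul, sum_sub_distrib, ← mul_sum, ← hc, sub_self, zero_mul]
  have key : (∑ e ∈ d.divisors, (μ e : ℝ) * g (e * d) * S (V / e)) -
      c * ∑ e ∈ d.divisors, (μ e : ℝ) * g (e ^ 2) * S (V / e) =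
      ∑ e ∈ d.divisors, ((μ e : ℝ) * g (e * d) - c * ((μ e : ℝ) * g (e ^ 2))) * (S (V / e) - S V) := by
    have h1 : (∑ e ∈ d.divisors, (μ e : ℝ) * g (e * d) * S (V / e)) -
        c * ∑ e ∈ d.divisors, (μ e : ℝ) * g (e ^ 2) * S (V / e) =
        ∑ e ∈ d.divisors, ((μ e : ℝ) * g (e * d) - c * ((μ e : ℝ) * g (e ^ 2))) * S (V / e) := by
      rw [mul_sum, ← sum_sub_distrib]
      exact sum_congr rfl fun e _ => by ring
    rw [h1, ← sub_zero (∑ e ∈ d.divisors, ((μ e : ℝ) * g (e * d) - c * ((μ e : ℝ) * g (e ^ 2))) *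
      S (V / e)), ← h0, ← sum_sub_distrib]
    exact sum_congr rfl fun e _ => by ring
  rw [key]
  refine (abs_sum_le_sum_abs _ _).trans ?_
  have hbound : ∀ e ∈ d.divisors,
      |((μ e : ℝ) * g (e * d) - c * ((μ e : ℝ) * g (e ^ 2))) * (S (V / e) - S V)| ≤
        (g (e ^ 2) * g (d / e) + |c| * g (e ^ 2)) * T := by
    intro e he
    have hed : e ∣ d := Nat.dvd_of_mem_divisors he
    have hesq : Squarefree e := hd.squarefree_of_dvd hed
    have hdesq : Squarefree (d / e) := hd.squarefree_of_dvd (Nat.div_dvd_of_dvd hed)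
    have hge2 : 0 ≤ g (e ^ 2) := hg0 e hesq
    have hgde : 0 ≤ g (d / e) := hg0' _ hdesq
    have hμ : |(μ e : ℝ)| ≤ 1 := by exact_mod_cast ArithmeticFunction.abs_moebius_le_one
    rw [abs_mul]
    refine mul_le_mul ?_ (htail e he) (abs_nonneg _) (by positivity)
    rw [hged e he]
    calc |(μ e : ℝ) * (g (e ^ 2) * g (d / e)) - c * ((μ e : ℝ) * g (e ^ 2))|
        ≤ |(μ e : ℝ) * (g (e ^ 2) * g (d / e))| + |c * ((μ e : ℝ) * g (e ^ 2))| := abs_sub _ _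
      _ = |(μ e : ℝ)| * (g (e ^ 2) * g (d / e)) + |c| * (|(μ e : ℝ)| * g (e ^ 2)) := by
          simp only [abs_mul, abs_of_nonneg hge2, abs_of_nonneg hgde]
      _ ≤ 1 * (g (e ^ 2) * g (d / e)) + |c| * (1 * g (e ^ 2)) := by
          gcongr
      _ = g (e ^ 2) * g (d / e) + |c| * g (e ^ 2) := by ring
  calc ∑ e ∈ d.divisors, |((μ e : ℝ) * g (e * d) - c * ((μ e : ℝ) * g (e ^ 2))) * (S (V / e) - S V)|
      ≤ ∑ e ∈ d.divisors, (g (e ^ 2) * g (d / e) + |c| * g (e ^ 2)) * T := sum_le_sum hbound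
    _ = T * (∑ e ∈ d.divisors, g (e ^ 2) * g (d / e) + |c| * ∑ e ∈ d.divisors, g (e ^ 2)) := by
        rw [← sum_mul, mul_comm, sum_add_distrib, ← mul_sum]

/-! ### Sums of nonnegative multiplicative functions through Euler products -/

/-- **Euler-product bound with local factors `1 + u_p`**: for a nonnegative multiplicative `h`
with `h(1) = 1` and `∑_{k < N} h(p^k) ≤ 1 + u_p` (`u_p ≥ 0`) for every prime `p` and every `N`,
`∑_{d ≤ Y} h(d) ≤ exp(∑_{p ≤ Y} u_p)` (`sum_Icc_le_prod_primesLE_sum` and `1 + u ≤ e^u`). [folklore] -/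
theorem sum_Icc_le_exp_of_local {h : ℕ → ℝ} (h0 : ∀ n, 0 ≤ h n) (h1 : h 1 = 1)
    (hmul : ∀ a b : ℕ, a.Coprime b → h (a * b) = h a * h b) {u : ℕ → ℝ}
    (hu : ∀ p : ℕ, p.Prime → 0 ≤ u p)
    (hloc : ∀ p : ℕ, p.Prime → ∀ N : ℕ, ∑ k ∈ range N, h (p ^ k) ≤ 1 + u p) (Y : ℕ) :
    ∑ d ∈ Icc 1 Y, h d ≤ Real.exp (∑ p ∈ Nat.primesLE Y, u p) := by
  refine (FriedlanderIwaniecPrimes.sum_Icc_le_prod_primesLE_sum h0 h1 hmul Y).trans ?_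
  calc ∏ p ∈ Nat.primesLE Y, ∑ k ∈ range (Nat.log 2 Y + 1), h (p ^ k)
      ≤ ∏ p ∈ Nat.primesLE Y, (1 + u p) := by
        refine prod_le_prod (fun p _ => sum_nonneg fun k _ => h0 _) fun p hp => ?_
        exact hloc p (Nat.mem_primesLE.mp hp).2 _
    _ ≤ Real.exp (∑ p ∈ Nat.primesLE Y, u p) :=
        prod_one_add_le_exp_sum _ fun p hp => hu p (Nat.mem_primesLE.mp hp).2

/-- `τ(m)^j / m ≤ τ(m)^{18} f(m)/m` (`= fiMomentWeight m`) for `m ≥ 1`, `j ≤ 18`: every divisor-power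
sum met in §9 is dominated by the moment weight of `FriedlanderIwaniecPrimesProp21`. [folklore] -/
theorem card_divisors_pow_div_le_fiMomentWeight {m : ℕ} (hm : m ≠ 0) {j : ℕ} (hj : j ≤ 18) :
    (#m.divisors : ℝ) ^ j / m ≤ FriedlanderIwaniecPrimes.fiMomentWeight m := by
  rw [FriedlanderIwaniecPrimes.fiMomentWeight]
  have hτ : (1 : ℝ) ≤ #m.divisors := by
    exact_mod_cast FriedlanderIwaniecPrimes.one_le_card_divisors hm
  have hf : (1 : ℝ) ≤ FriedlanderIwaniecPrimes.fiLoss m := by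
    exact_mod_cast FriedlanderIwaniecPrimes.one_le_fiLoss m
  have hm0 : (0 : ℝ) < m := by exact_mod_cast Nat.pos_of_ne_zero hm
  refine div_le_div_of_nonneg_right ?_ hm0.le
  calc (#m.divisors : ℝ) ^ j = (#m.divisors : ℝ) ^ j * 1 := (mul_one _).symm
    _ ≤ (#m.divisors : ℝ) ^ 18 * FriedlanderIwaniecPrimes.fiLoss m :=
        mul_le_mul (pow_le_pow_right₀ hτ hj) hf zero_le_one (by positivity)

/-- **`∑_{m ≤ M} τ(m)^j / m ≤ C₀ (log M)^{2^{18}}`** for `M ≥ 2`, `j ≤ 18`, with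
`C₀ = exp(2^{20} + 3^{18} + 4E₁)` the constant of `sum_fiMomentWeight_le`. [folklore] -/
theorem sum_card_divisors_pow_div_le {M : ℕ} (hM : 2 ≤ M) {j : ℕ} (hj : j ≤ 18) :
    ∑ m ∈ Icc 1 M, (#m.divisors : ℝ) ^ j / m ≤
      Real.exp (2 ^ 20 + (3 ^ 18 + 4 * FriedlanderIwaniecPrimes.fiMomentConst)) *
        Real.log M ^ (2 ^ 18 : ℕ) := by
  refine le_trans (sum_le_sum fun m hm => ?_) (FriedlanderIwaniecPrimes.sum_fiMomentWeight_le hM)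
  have : m ≠ 0 := by have := (mem_Icc.mp hm).1; omega
  exact card_divisors_pow_div_le_fiMomentWeight this hj

/-- **`∑_{m ≤ M} τ(m)^j ≤ C₀ M (log M)^{2^{18}}`** for `M ≥ 2`, `j ≤ 18`. [folklore] -/
theorem sum_card_divisors_pow_le {M : ℕ} (hM : 2 ≤ M) {j : ℕ} (hj : j ≤ 18) :
    ∑ m ∈ Icc 1 M, (#m.divisors : ℝ) ^ j ≤
      M * (Real.exp (2 ^ 20 + (3 ^ 18 + 4 * FriedlanderIwaniecPrimes.fiMomentConst)) *
        Real.log M ^ (2 ^ 18 : ℕ)) := by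
  refine le_trans ?_ (mul_le_mul_of_nonneg_left (sum_card_divisors_pow_div_le hM hj)
    (Nat.cast_nonneg M))
  rw [mul_sum]
  refine sum_le_sum fun m hm => ?_
  obtain ⟨hm1, hmM⟩ := mem_Icc.mp hm
  have hm0 : (0 : ℝ) < m := by exact_mod_cast hm1
  have hmM' : (m : ℝ) ≤ M := by exact_mod_cast hmM
  calc (#m.divisors : ℝ) ^ j = m * ((#m.divisors : ℝ) ^ j / m) := by field_simp
    _ ≤ M * ((#m.divisors : ℝ) ^ j / m) := mul_le_mul_of_nonneg_right hmM' (by positivity)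

/-! ### Sums involving the density `g`: (1.8)–(1.9), (9.1) through Euler products -/

section Density

variable {g : ArithmeticFunction ℝ}

/-- `ν²` is cubefree for squarefree `ν`. [folklore] -/
theorem isCubefree_sq {ν : ℕ} (hν : Squarefree ν) : IsCubefree (ν ^ 2) := by
  have h := isCubefree_lcm_sq hν squarefree_one
  rwa [Nat.lcm_one_right] at h

/-- `g(ν²) ≥ 0` for squarefree `ν`. [folklore] -/
theorem apply_sq_nonneg_of_squarefree (hg : g.IsMultiplicative)
    (h24 : ∀ p : ℕ, p.Prime → 0 ≤ g (p ^ 2) ∧ g (p ^ 2) ≤ g p ∧ g p < 1) {ν : ℕ} (hν : Squarefree ν) :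
    0 ≤ g (ν ^ 2) :=
  density_nonneg_of_isCubefree hg h24 (isCubefree_sq hν)

/-- Cubefree numbers are closed under coprime products. [folklore] -/
theorem isCubefree_mul_of_coprime {a b : ℕ} (ha : IsCubefree a) (hb : IsCubefree b)
    (hab : a.Coprime b) : IsCubefree (a * b) := by
  intro p hp
  have hp' : p.Prime := Nat.prime_of_mem_primeFactors hp
  rw [Nat.factorization_mul_of_coprime hab, Finsupp.add_apply]
  have hpab : p ∣ a * b := Nat.dvd_of_mem_primeFactors hp
  rcases (Nat.Prime.dvd_mul hp').mp hpab with hpa | hpb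
  · have hpb : ¬p ∣ b := fun h => hp'.ne_one (Nat.eq_one_of_dvd_coprimes hab hpa h)
    rw [Nat.factorization_eq_zero_of_not_dvd hpb, add_zero]
    rcases eq_or_ne a 0 with rfl | ha0
    · simp
    exact ha p (Nat.mem_primeFactors.mpr ⟨hp', hpa, ha0⟩)
  · have hpa : ¬p ∣ a := fun h => hp'.ne_one (Nat.eq_one_of_dvd_coprimes hab h hpb)
    rw [Nat.factorization_eq_zero_of_not_dvd hpa, zero_add]
    rcases eq_or_ne b 0 with rfl | hb0
    · simp
    exact hb p (Nat.mem_primeFactors.mpr ⟨hp', hpb, hb0⟩)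

/-- The constant `K` of (1.8)/(9.1) (`g(p) ≤ K/p`, `g(p²) ≤ K/p²`) is nonnegative (take `p = 2`).
[folklore] -/
theorem densityConst_nonneg (h24 : ∀ p : ℕ, p.Prime → 0 ≤ g (p ^ 2) ∧ g (p ^ 2) ≤ g p ∧ g p < 1)
    {K : ℝ} (hK : ∀ p : ℕ, p.Prime → g p ≤ K / p ∧ g (p ^ 2) ≤ K / (p : ℝ) ^ 2) : 0 ≤ K := by
  have h1 := (h24 2 Nat.prime_two).1
  have h2 := (hK 2 Nat.prime_two).2
  norm_num at h1 h2
  linarith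

/-- **(1.9) as an upper bound**: `∑_{p ≤ Y} g(p) ≤ log log Y + c + |K₉|/(log 2)^{10}` for `Y ≥ 2`.
[cite: FriedlanderIwaniecASP1998, (1.9)] -/
theorem sum_primesLE_density_le {c K₉ : ℝ}
    (h19 : ∀ y : ℝ, 2 ≤ y → |(∑ p ∈ Nat.primesLE ⌊y⌋₊, g p) - (Real.log (Real.log y) + c)| ≤
      K₉ / Real.log y ^ 10) {Y : ℕ} (hY : 2 ≤ Y) :
    ∑ p ∈ Nat.primesLE Y, g p ≤ Real.log (Real.log Y) + c + |K₉| / Real.log 2 ^ 10 := by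
  have hY' : (2 : ℝ) ≤ Y := by exact_mod_cast hY
  have h := h19 Y hY'
  rw [Nat.floor_natCast] at h
  have hlog2 : 0 < Real.log 2 := Real.log_pos one_lt_two
  have hlogY : Real.log 2 ≤ Real.log Y := Real.log_le_log two_pos hY'
  have hK : K₉ / Real.log Y ^ 10 ≤ |K₉| / Real.log 2 ^ 10 := by
    calc K₉ / Real.log Y ^ 10 ≤ |K₉| / Real.log Y ^ 10 :=
          div_le_div_of_nonneg_right (le_abs_self _) (by positivity)
      _ ≤ |K₉| / Real.log 2 ^ 10 := by
          refine div_le_div_of_nonneg_left (abs_nonneg _) (by positivity) ?_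
          exact pow_le_pow_left₀ hlog2.le hlogY 10
  have := (abs_le.mp h).2
  linarith

/-- `∑_{p ≤ Y} g(p²) ≤ K` (from `g(p²) ≤ K/p²` and `∑_p p⁻² ≤ 1`). [folklore] -/
theorem sum_primesLE_density_sq_le
    (h24 : ∀ p : ℕ, p.Prime → 0 ≤ g (p ^ 2) ∧ g (p ^ 2) ≤ g p ∧ g p < 1)
    {K : ℝ} (hK : ∀ p : ℕ, p.Prime → g p ≤ K / p ∧ g (p ^ 2) ≤ K / (p : ℝ) ^ 2) (Y : ℕ) :
    ∑ p ∈ Nat.primesLE Y, g (p ^ 2) ≤ K := by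
  have hK0 := densityConst_nonneg h24 hK
  calc ∑ p ∈ Nat.primesLE Y, g (p ^ 2) ≤ ∑ p ∈ Nat.primesLE Y, K * ((p : ℝ) ^ 2)⁻¹ := by
        refine sum_le_sum fun p hp => ?_
        rw [← div_eq_mul_inv]
        exact (hK p (Nat.mem_primesLE.mp hp).2).2
    _ = K * ∑ p ∈ Nat.primesLE Y, ((p : ℝ) ^ 2)⁻¹ := by rw [mul_sum]
    _ ≤ K * 1 := mul_le_mul_of_nonneg_left (FriedlanderIwaniecPrimes.sum_primesLE_inv_sq_le_one Y) hK0
    _ = K := mul_one K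

/-- **`V_g(Y) = ∑_{e ≤ Y}^♭ g(e) ≤ e^{C} log Y`**, `C = c + |K₉|/(log 2)^{10}`, for `Y ≥ 2` (Euler product
with local factors `1 + g(p)` and (1.9)). [cite: FriedlanderIwaniecASP1998, §9 p. 1062] -/
theorem sum_sqfree_density_le (hg : g.IsMultiplicative)
    (h24 : ∀ p : ℕ, p.Prime → 0 ≤ g (p ^ 2) ∧ g (p ^ 2) ≤ g p ∧ g p < 1) {c K₉ : ℝ}
    (h19 : ∀ y : ℝ, 2 ≤ y → |(∑ p ∈ Nat.primesLE ⌊y⌋₊, g p) - (Real.log (Real.log y) + c)| ≤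
      K₉ / Real.log y ^ 10) {Y : ℕ} (hY : 2 ≤ Y) :
    ∑ e ∈ (Icc 1 Y).filter Squarefree, g e ≤
      Real.exp (c + |K₉| / Real.log 2 ^ 10) * Real.log Y := by
  classical
  set h : ℕ → ℝ := fun e => if Squarefree e then g e else 0 with hh
  have h0 : ∀ n, 0 ≤ h n := fun n => by
    simp only [hh]; split_ifs with hn
    · exact density_squarefree_nonneg hg h24 hn
    · exact le_rfl
  have h1 : h 1 = 1 := by simp [hh, hg.map_one]
  have hmul : ∀ a b : ℕ, a.Coprime b → h (a * b) = h a * h b := by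
    intro a b hab
    simp only [hh, Nat.squarefree_mul_iff]
    by_cases ha : Squarefree a <;> by_cases hb : Squarefree b <;>
      simp [ha, hb, hab, hg.map_mul_of_coprime hab]
  have hloc : ∀ p : ℕ, p.Prime → ∀ N : ℕ, ∑ k ∈ range N, h (p ^ k) ≤ 1 + g p := by
    intro p hp N
    have hgp : 0 ≤ g p := (h24 p hp).1.trans (h24 p hp).2.1
    have hterm : ∀ k, h (p ^ k) = if k = 0 then 1 else if k = 1 then g p else 0 := by
      intro k
      rcases Nat.lt_or_ge k 2 with hk | hk
      · interval_cases k
        · simp [hh, hg.map_one]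
        · simp [hh, hp.squarefree]  -- wait: Nat.Prime.squarefree? use Irreducible.squarefree
      · have hns : ¬Squarefree (p ^ k) := fun hsq => by
          have := (Nat.squarefree_pow_iff hp.ne_one (by omega)).mp hsq
          omega
        simp [hh, hns, show k ≠ 0 by omega, show k ≠ 1 by omega]
    calc ∑ k ∈ range N, h (p ^ k) ≤ ∑ k ∈ range 2, h (p ^ k) := by
          rcases le_or_gt N 2 with hN | hN
          · exact sum_le_sum_of_subset_of_nonneg (range_subset_range.mpr hN) fun k _ _ => h0 _
          · rw [← sum_range_add_sum_Ico _ hN.le]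
            have : ∑ k ∈ Ico 2 N, h (p ^ k) = 0 :=
              sum_eq_zero fun k hk => by rw [hterm k]; simp [show k ≠ 0 by
                have := (mem_Ico.mp hk).1; omega, show k ≠ 1 by have := (mem_Ico.mp hk).1; omega]
            rw [this, add_zero]
      _ = 1 + g p := by rw [sum_range_succ, sum_range_one, hterm 0, hterm 1]; simp
  have hmain := sum_Icc_le_exp_of_local h0 h1 hmul (u := fun p => g p)
    (fun p hp => (h24 p hp).1.trans (h24 p hp).2.1) hloc Y
  have hsum : ∑ e ∈ (Icc 1 Y).filter Squarefree, g e = ∑ d ∈ Icc 1 Y, h d := by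
    rw [sum_filter]
  rw [hsum]
  refine hmain.trans ?_
  have hY' : (2 : ℝ) ≤ Y := by exact_mod_cast hY
  have hlogY : 0 < Real.log Y := Real.log_pos (by linarith)
  calc Real.exp (∑ p ∈ Nat.primesLE Y, g p)
      ≤ Real.exp (Real.log (Real.log Y) + c + |K₉| / Real.log 2 ^ 10) :=
        Real.exp_le_exp.mpr (sum_primesLE_density_le h19 hY)
    _ = Real.exp (c + |K₉| / Real.log 2 ^ 10) * Real.log Y := by
        rw [show Real.log (Real.log Y) + c + |K₉| / Real.log 2 ^ 10 =
          (c + |K₉| / Real.log 2 ^ 10) + Real.log (Real.log Y) by ring, Real.exp_add,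
          Real.exp_log hlogY]

/-- **Generic squarefree Euler-product bound**: if `F` is multiplicative on coprime pairs with
`F(1) = 1`, `F ≥ 0` on squarefree numbers and `F(p) ≤ u_p` (`u_p ≥ 0`) at primes, then
`∑_{e ≤ Y}^♭ F(e) ≤ exp(∑_{p ≤ Y} u_p)`. [folklore] -/
theorem sum_sqfree_le_exp {F : ℕ → ℝ} (hF0 : ∀ e, Squarefree e → 0 ≤ F e) (hF1 : F 1 = 1)
    (hFmul : ∀ a b : ℕ, a.Coprime b → F (a * b) = F a * F b) {u : ℕ → ℝ}
    (hu : ∀ p : ℕ, p.Prime → 0 ≤ u p) (hloc : ∀ p : ℕ, p.Prime → F p ≤ u p) (Y : ℕ) :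
    ∑ e ∈ (Icc 1 Y).filter Squarefree, F e ≤ Real.exp (∑ p ∈ Nat.primesLE Y, u p) := by
  classical
  set h : ℕ → ℝ := fun e => if Squarefree e then F e else 0 with hh
  have h0 : ∀ n, 0 ≤ h n := fun n => by
    simp only [hh]; split_ifs with hn
    · exact hF0 n hn
    · exact le_rfl
  have h1 : h 1 = 1 := by simp [hh, hF1]
  have hmul : ∀ a b : ℕ, a.Coprime b → h (a * b) = h a * h b := by
    intro a b hab
    simp only [hh, Nat.squarefree_mul_iff]
    by_cases ha : Squarefree a <;> by_cases hb : Squarefree b <;>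
      simp [ha, hb, hab, hFmul a b hab]
  have hloc' : ∀ p : ℕ, p.Prime → ∀ N : ℕ, ∑ k ∈ range N, h (p ^ k) ≤ 1 + u p := by
    intro p hp N
    have hterm : ∀ k, h (p ^ k) = if k = 0 then 1 else if k = 1 then F p else 0 := by
      intro k
      rcases Nat.lt_or_ge k 2 with hk | hk
      · interval_cases k
        · simp [hh, hF1]
        · simp [hh, hp.squarefree]
      · have hns : ¬Squarefree (p ^ k) := fun hsq => by
          have := (Nat.squarefree_pow_iff hp.ne_one (by omega)).mp hsq
          omega
        simp [hh, hns, show k ≠ 0 by omega, show k ≠ 1 by omega]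
    calc ∑ k ∈ range N, h (p ^ k) ≤ ∑ k ∈ range 2, h (p ^ k) := by
          rcases le_or_gt N 2 with hN | hN
          · exact sum_le_sum_of_subset_of_nonneg (range_subset_range.mpr hN) fun k _ _ => h0 _
          · rw [← sum_range_add_sum_Ico _ hN.le]
            have : ∑ k ∈ Ico 2 N, h (p ^ k) = 0 :=
              sum_eq_zero fun k hk => by rw [hterm k]; simp [show k ≠ 0 by
                have := (mem_Ico.mp hk).1; omega, show k ≠ 1 by have := (mem_Ico.mp hk).1; omega]
            rw [this, add_zero]
      _ = 1 + F p := by rw [sum_range_succ, sum_range_one, hterm 0, hterm 1]; simp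
      _ ≤ 1 + u p := by linarith [hloc p hp]
  have hmain := sum_Icc_le_exp_of_local h0 h1 hmul hu hloc' Y
  have hsum : ∑ e ∈ (Icc 1 Y).filter Squarefree, F e = ∑ d ∈ Icc 1 Y, h d := by
    rw [sum_filter]
  rw [hsum]
  exact hmain

/-- **`∑_{d ≤ Y}^♭ τ(d)^j g(d) ≤ e^{2^j C} (log Y)^{2^j}`** (`Y ≥ 2`, `C = c + |K₉|/(log 2)^{10}`; local
factors `1 + 2^j g(p)` and (1.9)). [cite: FriedlanderIwaniecASP1998, §9 p. 1060] -/
theorem sum_sqfree_card_divisors_pow_mul_density_le (hg : g.IsMultiplicative)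
    (h24 : ∀ p : ℕ, p.Prime → 0 ≤ g (p ^ 2) ∧ g (p ^ 2) ≤ g p ∧ g p < 1) {c K₉ : ℝ}
    (h19 : ∀ y : ℝ, 2 ≤ y → |(∑ p ∈ Nat.primesLE ⌊y⌋₊, g p) - (Real.log (Real.log y) + c)| ≤
      K₉ / Real.log y ^ 10) (j : ℕ) {Y : ℕ} (hY : 2 ≤ Y) :
    ∑ d ∈ (Icc 1 Y).filter Squarefree, (#d.divisors : ℝ) ^ j * g d ≤
      Real.exp (2 ^ j * (c + |K₉| / Real.log 2 ^ 10)) * Real.log Y ^ (2 ^ j : ℕ) := by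
  have hgp : ∀ p : ℕ, p.Prime → 0 ≤ g p := fun p hp => (h24 p hp).1.trans (h24 p hp).2.1
  have hmain := sum_sqfree_le_exp (F := fun d => (#d.divisors : ℝ) ^ j * g d)
    (fun e he => mul_nonneg (by positivity) (density_squarefree_nonneg hg h24 he))
    (by simp [hg.map_one])
    (fun a b hab => by
      simp only [Nat.Coprime.card_divisors_mul hab, Nat.cast_mul, mul_pow,
        hg.map_mul_of_coprime hab]; ring)
    (u := fun p => 2 ^ j * g p) (fun p hp => mul_nonneg (by positivity) (hgp p hp))
    (fun p hp => by
      simp only [Nat.Prime.divisors hp, card_pair hp.ne_one.symm]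
      push_cast; exact le_rfl) Y
  refine hmain.trans ?_
  have hY' : (2 : ℝ) ≤ Y := by exact_mod_cast hY
  have hlogY : 0 < Real.log Y := Real.log_pos (by linarith)
  rw [← mul_sum]
  calc Real.exp (2 ^ j * ∑ p ∈ Nat.primesLE Y, g p)
      ≤ Real.exp (2 ^ j * (Real.log (Real.log Y) + c + |K₉| / Real.log 2 ^ 10)) :=
        Real.exp_le_exp.mpr (mul_le_mul_of_nonneg_left (sum_primesLE_density_le h19 hY)
          (by positivity))
    _ = Real.exp (2 ^ j * (c + |K₉| / Real.log 2 ^ 10)) * Real.log Y ^ (2 ^ j : ℕ) := by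
        rw [show (2 : ℝ) ^ j * (Real.log (Real.log Y) + c + |K₉| / Real.log 2 ^ 10) =
          2 ^ j * (c + |K₉| / Real.log 2 ^ 10) + ((2 ^ j : ℕ) : ℝ) * Real.log (Real.log Y) by
            push_cast; ring, Real.exp_add, Real.exp_nat_mul, Real.exp_log hlogY]

/-- **`∑_{k ≤ Y, k cubefree} τ(k)² g(k) ≤ e^{4C + 9K} (log Y)^4`** (`Y ≥ 2`; local factors
`1 + 4g(p) + 9g(p²)`, (1.9), (9.1)). [cite: FriedlanderIwaniecASP1998, §9 p. 1060] -/
theorem sum_cubefree_card_divisors_sq_mul_density_le (hg : g.IsMultiplicative)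
    (h24 : ∀ p : ℕ, p.Prime → 0 ≤ g (p ^ 2) ∧ g (p ^ 2) ≤ g p ∧ g p < 1) {K : ℝ}
    (hK : ∀ p : ℕ, p.Prime → g p ≤ K / p ∧ g (p ^ 2) ≤ K / (p : ℝ) ^ 2) {c K₉ : ℝ}
    (h19 : ∀ y : ℝ, 2 ≤ y → |(∑ p ∈ Nat.primesLE ⌊y⌋₊, g p) - (Real.log (Real.log y) + c)| ≤
      K₉ / Real.log y ^ 10) {Y : ℕ} (hY : 2 ≤ Y) :
    ∑ k ∈ (Icc 1 Y).filter IsCubefree, (#k.divisors : ℝ) ^ 2 * g k ≤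
      Real.exp (4 * (c + |K₉| / Real.log 2 ^ 10) + 9 * K) * Real.log Y ^ 4 := by
  classical
  have hgp : ∀ p : ℕ, p.Prime → 0 ≤ g p := fun p hp => (h24 p hp).1.trans (h24 p hp).2.1
  set h : ℕ → ℝ := fun k => if IsCubefree k then (#k.divisors : ℝ) ^ 2 * g k else 0 with hh
  have h0 : ∀ n, 0 ≤ h n := fun n => by
    simp only [hh]; split_ifs with hn
    · exact mul_nonneg (by positivity) (density_nonneg_of_isCubefree hg h24 hn)
    · exact le_rfl
  have h1 : h 1 = 1 := by
    simp [hh, hg.map_one, IsCubefree.of_squarefree squarefree_one]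
  have hmul : ∀ a b : ℕ, a.Coprime b → h (a * b) = h a * h b := by
    intro a b hab
    rcases eq_or_ne a 0 with rfl | ha0
    · simp [hh]
    rcases eq_or_ne b 0 with rfl | hb0
    · simp [hh]
    by_cases hca : IsCubefree a
    · by_cases hcb : IsCubefree b
      · have hcab : IsCubefree (a * b) := isCubefree_mul_of_coprime hca hcb hab
        simp only [hh, if_pos hca, if_pos hcb, if_pos hcab, Nat.Coprime.card_divisors_mul hab,
          Nat.cast_mul, mul_pow, hg.map_mul_of_coprime hab]
        ring
      · have hcab : ¬IsCubefree (a * b) := fun h => hcb (h.of_mul_right ha0)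
        simp only [hh, if_neg hcb, if_neg hcab, mul_zero]
    · have hcab : ¬IsCubefree (a * b) := fun h => hca (h.of_mul_left hb0)
      simp only [hh, if_neg hca, if_neg hcab, zero_mul]
  have hloc : ∀ p : ℕ, p.Prime → ∀ N : ℕ, ∑ k ∈ range N, h (p ^ k) ≤ 1 + (4 * g p + 9 * g (p ^ 2)) := by
    intro p hp N
    have hterm : ∀ k, h (p ^ k) =
        if k = 0 then 1 else if k = 1 then 4 * g p else if k = 2 then 9 * g (p ^ 2) else 0 := by
      intro k
      rcases Nat.lt_or_ge k 3 with hk | hk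
      · have hc : IsCubefree (p ^ k) := by
          intro q hq
          rw [hp.factorization_pow, Finsupp.single_apply]
          split_ifs <;> omega
        interval_cases k
        · simp [hh, hg.map_one, IsCubefree.of_squarefree squarefree_one]
        · simp only [hh, pow_one, if_pos (by simpa using hc), Nat.Prime.divisors hp,
            card_pair hp.ne_one.symm]
          norm_num
        · simp only [hh, if_pos hc, FriedlanderIwaniecPrimes.card_divisors_prime_pow hp 2]
          norm_num
      · have hnc : ¬IsCubefree (p ^ k) := by
          intro hc
          have := hc p (Nat.mem_primeFactors.mpr ⟨hp, dvd_pow_self p (by omega),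
            pow_ne_zero k hp.ne_zero⟩)
          rw [hp.factorization_pow, Finsupp.single_eq_same] at this
          omega
        simp [hh, hnc, show k ≠ 0 by omega, show k ≠ 1 by omega, show k ≠ 2 by omega]
    calc ∑ k ∈ range N, h (p ^ k) ≤ ∑ k ∈ range 3, h (p ^ k) := by
          rcases le_or_gt N 3 with hN | hN
          · exact sum_le_sum_of_subset_of_nonneg (range_subset_range.mpr hN) fun k _ _ => h0 _
          · rw [← sum_range_add_sum_Ico _ hN.le]
            have : ∑ k ∈ Ico 3 N, h (p ^ k) = 0 :=
              sum_eq_zero fun k hk => by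
                have h3 := (mem_Ico.mp hk).1
                rw [hterm k]
                simp [show k ≠ 0 by omega, show k ≠ 1 by omega, show k ≠ 2 by omega]
            rw [this, add_zero]
      _ = 1 + (4 * g p + 9 * g (p ^ 2)) := by
          rw [sum_range_succ, sum_range_succ, sum_range_one, hterm 0, hterm 1, hterm 2]
          simp; ring
  have hmain := sum_Icc_le_exp_of_local h0 h1 hmul (u := fun p => 4 * g p + 9 * g (p ^ 2))
    (fun p hp => by linarith [hgp p hp, (h24 p hp).1]) hloc Y
  have hsum : ∑ k ∈ (Icc 1 Y).filter IsCubefree, (#k.divisors : ℝ) ^ 2 * g k = ∑ d ∈ Icc 1 Y, h d := by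
    rw [sum_filter]
  rw [hsum]
  refine hmain.trans ?_
  have hY' : (2 : ℝ) ≤ Y := by exact_mod_cast hY
  have hlogY : 0 < Real.log Y := Real.log_pos (by linarith)
  rw [sum_add_distrib, ← mul_sum, ← mul_sum]
  have h1' := sum_primesLE_density_le h19 hY
  have h2' := sum_primesLE_density_sq_le h24 hK Y
  calc Real.exp (4 * ∑ p ∈ Nat.primesLE Y, g p + 9 * ∑ p ∈ Nat.primesLE Y, g (p ^ 2))
      ≤ Real.exp (4 * (Real.log (Real.log Y) + c + |K₉| / Real.log 2 ^ 10) + 9 * K) :=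
        Real.exp_le_exp.mpr (by linarith)
    _ = Real.exp (4 * (c + |K₉| / Real.log 2 ^ 10) + 9 * K) * Real.log Y ^ 4 := by
        rw [show 4 * (Real.log (Real.log Y) + c + |K₉| / Real.log 2 ^ 10) + 9 * K =
          (4 * (c + |K₉| / Real.log 2 ^ 10) + 9 * K) + ((4 : ℕ) : ℝ) * Real.log (Real.log Y) by
            push_cast; ring, Real.exp_add, Real.exp_nat_mul, Real.exp_log hlogY]

/-- `∑_{e ∣ d} g(e²) ≤ e^{K}` for squarefree `d` (`= ∏_{p∣d} (1 + g(p²)) ≤ exp(∑_p g(p²))`).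
[folklore] -/
theorem sum_divisors_density_sq_le (hg : g.IsMultiplicative)
    (h24 : ∀ p : ℕ, p.Prime → 0 ≤ g (p ^ 2) ∧ g (p ^ 2) ≤ g p ∧ g p < 1) {K : ℝ}
    (hK : ∀ p : ℕ, p.Prime → g p ≤ K / p ∧ g (p ^ 2) ≤ K / (p : ℝ) ^ 2) {d : ℕ} (hd : Squarefree d) :
    ∑ e ∈ d.divisors, g (e ^ 2) ≤ Real.exp K := by
  rw [sum_divisors_apply_sq hg hd]
  refine (prod_one_add_le_exp_sum _ fun p hp =>
    (h24 p (Nat.prime_of_mem_primeFactors hp)).1).trans (Real.exp_le_exp.mpr ?_)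
  calc ∑ p ∈ d.primeFactors, g (p ^ 2) ≤ ∑ p ∈ Nat.primesLE d, g (p ^ 2) := by
        refine sum_le_sum_of_subset_of_nonneg (fun p hp => ?_) fun p hp _ =>
          (h24 p (Nat.mem_primesLE.mp hp).2).1
        exact Nat.mem_primesLE.mpr ⟨Nat.le_of_mem_primeFactors hp, Nat.prime_of_mem_primeFactors hp⟩
    _ ≤ K := sum_primesLE_density_sq_le h24 hK d

/-- **Rankin's trick for the squares**: `∑_{ν ≤ W}^♭ τ(ν)^j g(ν²) ν^{7/8} ≤ exp(2^j K Z)` with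
`Z = ∑_n n^{-9/8}` (local factors `1 + 2^j g(p²) p^{7/8} ≤ 1 + 2^j K p^{-9/8}` by (9.1)). The
exponent `7/8` (rather than FI's implicit treatment of `∑_{ν > L} g(ν²)` via (1.8), (1.9), (9.1),
p. 1062) keeps `K` out of the powers of `log x`. [cite: FriedlanderIwaniecASP1998, §9 p. 1062] -/
theorem rankin_sum_sqfree_le (hg : g.IsMultiplicative)
    (h24 : ∀ p : ℕ, p.Prime → 0 ≤ g (p ^ 2) ∧ g (p ^ 2) ≤ g p ∧ g p < 1) {K : ℝ}
    (hK : ∀ p : ℕ, p.Prime → g p ≤ K / p ∧ g (p ^ 2) ≤ K / (p : ℝ) ^ 2) (j W : ℕ) :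
    ∑ ν ∈ (Icc 1 W).filter Squarefree, (#ν.divisors : ℝ) ^ j * g (ν ^ 2) * (ν : ℝ) ^ (7 / 8 : ℝ) ≤
      Real.exp (2 ^ j * K * ∑' n : ℕ, (n : ℝ) ^ (-(9 / 8 : ℝ))) := by
  have hK0 := densityConst_nonneg h24 hK
  have hsum : Summable fun n : ℕ => (n : ℝ) ^ (-(9 / 8 : ℝ)) :=
    Real.summable_nat_rpow.mpr (by norm_num)
  have hZ0 : ∀ n : ℕ, 0 ≤ (n : ℝ) ^ (-(9 / 8 : ℝ)) := fun n => Real.rpow_nonneg (Nat.cast_nonneg n) _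
  have hmain := sum_sqfree_le_exp
    (F := fun ν => (#ν.divisors : ℝ) ^ j * g (ν ^ 2) * (ν : ℝ) ^ (7 / 8 : ℝ))
    (fun e he => mul_nonneg (mul_nonneg (by positivity) (apply_sq_nonneg_of_squarefree hg h24 he))
      (Real.rpow_nonneg (Nat.cast_nonneg e) _))
    (by simp [hg.map_one])
    (fun a b hab => by
      simp only [Nat.Coprime.card_divisors_mul hab, Nat.cast_mul, mul_pow,
        hg.map_mul_of_coprime (hab.pow 2 2),
        Real.mul_rpow (Nat.cast_nonneg a) (Nat.cast_nonneg b)]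
      ring)
    (u := fun p => 2 ^ j * K * (p : ℝ) ^ (-(9 / 8 : ℝ)))
    (fun p _ => mul_nonneg (by positivity) (hZ0 p))
    (fun p hp => by
      have hp0 : (0 : ℝ) < p := by exact_mod_cast hp.pos
      simp only [Nat.Prime.divisors hp, card_pair hp.ne_one.symm]
      push_cast
      have hg2 := (hK p hp).2
      have hτ : (0 : ℝ) ≤ 2 ^ j := by positivity
      -- `2^j g(p²) p^{7/8} ≤ 2^j (K/p²) p^{7/8} = 2^j K p^{-9/8}`
      have hpow : K / (p : ℝ) ^ 2 * (p : ℝ) ^ (7 / 8 : ℝ) = K * (p : ℝ) ^ (-(9 / 8 : ℝ)) := by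
        rw [show (p : ℝ) ^ 2 = (p : ℝ) ^ (2 : ℝ) by norm_cast, div_mul_eq_mul_div, mul_div_assoc,
          ← Real.rpow_sub hp0]
        norm_num
      calc (2 : ℝ) ^ j * g (p ^ 2) * (p : ℝ) ^ (7 / 8 : ℝ)
          = 2 ^ j * (g (p ^ 2) * (p : ℝ) ^ (7 / 8 : ℝ)) := by ring
        _ ≤ 2 ^ j * (K / (p : ℝ) ^ 2 * (p : ℝ) ^ (7 / 8 : ℝ)) :=
            mul_le_mul_of_nonneg_left (mul_le_mul_of_nonneg_right hg2
              (Real.rpow_nonneg hp0.le _)) hτ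
        _ = 2 ^ j * K * (p : ℝ) ^ (-(9 / 8 : ℝ)) := by rw [hpow]; ring) W
  refine hmain.trans (Real.exp_le_exp.mpr ?_)
  rw [← mul_sum]
  exact mul_le_mul_of_nonneg_left (hsum.sum_le_tsum _ fun n _ => hZ0 n) (by positivity)

/-- **Tails of `∑^♭ τ(ν)^j g(ν²)`**: for `W₀ ≤ V`,
`∑_{W₀ < ν ≤ V}^♭ τ(ν)^j g(ν²) ≤ (W₀ + 1)^{-7/8} exp(2^j K Z)`.
[cite: FriedlanderIwaniecASP1998, §9 p. 1062 (the sum S₁ and the second term of E₂)] -/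
theorem tail_sum_sqfree_density_sq_le (hg : g.IsMultiplicative)
    (h24 : ∀ p : ℕ, p.Prime → 0 ≤ g (p ^ 2) ∧ g (p ^ 2) ≤ g p ∧ g p < 1) {K : ℝ}
    (hK : ∀ p : ℕ, p.Prime → g p ≤ K / p ∧ g (p ^ 2) ≤ K / (p : ℝ) ^ 2) (j W₀ V : ℕ) :
    ∑ ν ∈ (Ioc W₀ V).filter Squarefree, (#ν.divisors : ℝ) ^ j * g (ν ^ 2) ≤
      ((W₀ : ℝ) + 1) ^ (-(7 / 8 : ℝ)) *
        Real.exp (2 ^ j * K * ∑' n : ℕ, (n : ℝ) ^ (-(9 / 8 : ℝ))) := by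
  have hW : (0 : ℝ) < (W₀ : ℝ) + 1 := by positivity
  have hR := rankin_sum_sqfree_le hg h24 hK j V
  have hfac : 0 ≤ ((W₀ : ℝ) + 1) ^ (-(7 / 8 : ℝ)) := Real.rpow_nonneg hW.le _
  calc ∑ ν ∈ (Ioc W₀ V).filter Squarefree, (#ν.divisors : ℝ) ^ j * g (ν ^ 2)
      ≤ ∑ ν ∈ (Ioc W₀ V).filter Squarefree,
          ((W₀ : ℝ) + 1) ^ (-(7 / 8 : ℝ)) *
            ((#ν.divisors : ℝ) ^ j * g (ν ^ 2) * (ν : ℝ) ^ (7 / 8 : ℝ)) := by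
        refine sum_le_sum fun ν hν => ?_
        obtain ⟨hν1, hνsq⟩ := mem_filter.mp hν
        have hνW : (W₀ : ℝ) + 1 ≤ ν := by exact_mod_cast (mem_Ioc.mp hν1).1
        have hbase : 0 ≤ (#ν.divisors : ℝ) ^ j * g (ν ^ 2) :=
          mul_nonneg (by positivity) (apply_sq_nonneg_of_squarefree hg h24 hνsq)
        -- `1 ≤ (W₀+1)^{-7/8} ν^{7/8}`
        have hone : 1 ≤ ((W₀ : ℝ) + 1) ^ (-(7 / 8 : ℝ)) * (ν : ℝ) ^ (7 / 8 : ℝ) := by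
          rw [Real.rpow_neg hW.le, ← div_eq_inv_mul, le_div_iff₀ (Real.rpow_pos_of_pos hW _),
            one_mul]
          exact Real.rpow_le_rpow hW.le hνW (by norm_num)
        calc (#ν.divisors : ℝ) ^ j * g (ν ^ 2) = (#ν.divisors : ℝ) ^ j * g (ν ^ 2) * 1 := (mul_one _).symm
          _ ≤ (#ν.divisors : ℝ) ^ j * g (ν ^ 2) *
              (((W₀ : ℝ) + 1) ^ (-(7 / 8 : ℝ)) * (ν : ℝ) ^ (7 / 8 : ℝ)) :=
              mul_le_mul_of_nonneg_left hone hbase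
          _ = _ := by ring
    _ = ((W₀ : ℝ) + 1) ^ (-(7 / 8 : ℝ)) * ∑ ν ∈ (Ioc W₀ V).filter Squarefree,
          (#ν.divisors : ℝ) ^ j * g (ν ^ 2) * (ν : ℝ) ^ (7 / 8 : ℝ) := by rw [mul_sum]
    _ ≤ ((W₀ : ℝ) + 1) ^ (-(7 / 8 : ℝ)) * ∑ ν ∈ (Icc 1 V).filter Squarefree,
          (#ν.divisors : ℝ) ^ j * g (ν ^ 2) * (ν : ℝ) ^ (7 / 8 : ℝ) := by
        refine mul_le_mul_of_nonneg_left ?_ hfac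
        refine sum_le_sum_of_subset_of_nonneg (fun ν hν => ?_) fun ν hν _ => ?_
        · obtain ⟨hν1, hνsq⟩ := mem_filter.mp hν
          refine mem_filter.mpr ⟨?_, hνsq⟩
          rw [mem_Ioc] at hν1
          exact mem_Icc.mpr ⟨by omega, hν1.2⟩
        · exact mul_nonneg (mul_nonneg (by positivity)
            (apply_sq_nonneg_of_squarefree hg h24 (mem_filter.mp hν).2))
            (Real.rpow_nonneg (Nat.cast_nonneg ν) _)
    _ ≤ _ := mul_le_mul_of_nonneg_left hR hfac

end Density

/-! ### The squarefree-sieved congruence sums `Ã_d(t) = ∑_ν μ(ν) A_{[ν²,d]}(t)` -/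

section Sequence

variable (A : SieveSequence)

/-- **`Ã_d(t) = ∑_ν μ(ν) A_{[ν², d]}(t)`**: for squarefree `d` and `V ≥ ⌊t⌋`,
`∑_{n ≤ t, d ∣ n} μ²(n) a_n = ∑_{ν ≤ V}^♭ μ(ν) A_{[ν²,d]}(t)` (detect `μ²(n)` by
`sum_moebius_filter_sq_dvd` and use `[ν², d] ∣ n ⟺ ν² ∣ n ∧ d ∣ n`).
[cite: FriedlanderIwaniecASP1998, §9 p. 1061] -/
theorem sqfree_congrSum_eq_sum_moebius (d : ℕ) (t : ℝ) {V : ℕ} (hV : ⌊t⌋₊ ≤ V) :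
    ∑ n ∈ (Ioc 0 ⌊t⌋₊).filter (d ∣ ·), (if Squarefree n then A.a n else 0) =
      ∑ ν ∈ (Icc 1 V).filter Squarefree, (μ ν : ℝ) * A.congrSum (Nat.lcm (ν ^ 2) d) t := by
  classical
  -- insert the Möbius detector
  have hdet : ∀ n ∈ (Ioc 0 ⌊t⌋₊).filter (d ∣ ·), (if Squarefree n then A.a n else 0) =
      ∑ ν ∈ (Icc 1 V).filter (fun ν => ν ^ 2 ∣ n), (μ ν : ℝ) * A.a n := by
    intro n hn
    have hn' := (mem_Ioc.mp (mem_filter.mp hn).1)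
    rw [← sum_mul, sum_moebius_filter_sq_dvd (by omega) (hn'.2.trans hV)]
    split_ifs <;> simp
  rw [sum_congr rfl hdet]
  -- write both sides as double sums over `(Ioc 0 ⌊t⌋) × (Icc 1 V)` with indicators
  have hL : ∑ n ∈ (Ioc 0 ⌊t⌋₊).filter (d ∣ ·), ∑ ν ∈ (Icc 1 V).filter (fun ν => ν ^ 2 ∣ n),
      (μ ν : ℝ) * A.a n =
      ∑ n ∈ Ioc 0 ⌊t⌋₊, ∑ ν ∈ Icc 1 V,
        if ν ^ 2 ∣ n ∧ d ∣ n then (μ ν : ℝ) * A.a n else 0 := by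
    rw [sum_filter]
    refine sum_congr rfl fun n _ => ?_
    split_ifs with hdn
    · rw [sum_filter]
      refine sum_congr rfl fun ν _ => ?_
      simp [hdn]
    · refine (sum_eq_zero fun ν _ => ?_).symm
      simp [hdn]
  have hR : ∑ ν ∈ (Icc 1 V).filter Squarefree, (μ ν : ℝ) * A.congrSum (Nat.lcm (ν ^ 2) d) t =
      ∑ ν ∈ Icc 1 V, ∑ n ∈ Ioc 0 ⌊t⌋₊,
        if ν ^ 2 ∣ n ∧ d ∣ n then (μ ν : ℝ) * A.a n else 0 := by
    rw [sum_filter]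
    refine sum_congr rfl fun ν _ => ?_
    split_ifs with hν
    · rw [SieveSequence.congrSum, mul_sum, sum_filter]
      refine sum_congr rfl fun n _ => ?_
      have : Nat.lcm (ν ^ 2) d ∣ n ↔ ν ^ 2 ∣ n ∧ d ∣ n :=
        ⟨fun h => ⟨(Nat.dvd_lcm_left _ _).trans h, (Nat.dvd_lcm_right _ _).trans h⟩,
          fun h => Nat.lcm_dvd h.1 h.2⟩
      by_cases h : ν ^ 2 ∣ n ∧ d ∣ n
      · rw [if_pos (this.mpr h), if_pos h]
      · rw [if_neg (fun h' => h (this.mp h')), if_neg h]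
    · refine (sum_eq_zero fun n _ => ?_).symm
      rw [ArithmeticFunction.moebius_eq_zero_of_not_squarefree hν]
      simp
  rw [hL, hR, sum_comm]

/-- `A_m(t) = g(m) A(t) + r_m(t)` (the definition of the remainder, with `A.size` FI's `A(t)`).
[cite: FriedlanderIwaniecASP1998, (1.7)] -/
theorem congrSum_eq_density_mul_size_add_remainder (m : ℕ) (t : ℝ) :
    A.congrSum m t = A.density m * A.size t + A.remainder m t := by
  rw [SieveSequence.remainder]; ring

/-- **Swapping the tail `∑_d ∑_{ν > W} A_{[ν²,d]}(t)`**: for finite sets `𝒟` (moduli) and `𝒩`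
(squares), `∑_{d ∈ 𝒟} ∑_{ν ∈ 𝒩} A_{[ν²,d]}(t) = ∑_{n ≤ t} a_n #{d ∈ 𝒟 : d ∣ n} #{ν ∈ 𝒩 : ν² ∣ n}
≤ ∑_{n ≤ t} a_n τ(n) #{ν ∈ 𝒩 : ν² ∣ n}`. [cite: FriedlanderIwaniecASP1998, §9 p. 1062 (E₂)] -/
theorem sum_sum_congrSum_lcm_le (𝒟 𝒩 : Finset ℕ) (t : ℝ) :
    ∑ d ∈ 𝒟, ∑ ν ∈ 𝒩, A.congrSum (Nat.lcm (ν ^ 2) d) t ≤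
      ∑ n ∈ Ioc 0 ⌊t⌋₊, A.a n * (#n.divisors : ℝ) * #(𝒩.filter (fun ν => ν ^ 2 ∣ n)) := by
  classical
  have hexp : ∀ d ν, A.congrSum (Nat.lcm (ν ^ 2) d) t =
      ∑ n ∈ Ioc 0 ⌊t⌋₊, if ν ^ 2 ∣ n ∧ d ∣ n then A.a n else 0 := by
    intro d ν
    rw [SieveSequence.congrSum, sum_filter]
    refine sum_congr rfl fun n _ => ?_
    have : Nat.lcm (ν ^ 2) d ∣ n ↔ ν ^ 2 ∣ n ∧ d ∣ n :=
      ⟨fun h => ⟨(Nat.dvd_lcm_left _ _).trans h, (Nat.dvd_lcm_right _ _).trans h⟩,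
        fun h => Nat.lcm_dvd h.1 h.2⟩
    by_cases h : ν ^ 2 ∣ n ∧ d ∣ n
    · rw [if_pos (this.mpr h), if_pos h]
    · rw [if_neg (fun h' => h (this.mp h')), if_neg h]
  simp_rw [hexp]
  have hswap : ∑ d ∈ 𝒟, ∑ ν ∈ 𝒩, ∑ n ∈ Ioc 0 ⌊t⌋₊, (if ν ^ 2 ∣ n ∧ d ∣ n then A.a n else 0) =
      ∑ n ∈ Ioc 0 ⌊t⌋₊, ∑ d ∈ 𝒟, ∑ ν ∈ 𝒩, (if ν ^ 2 ∣ n ∧ d ∣ n then A.a n else 0) := by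
    calc _ = ∑ d ∈ 𝒟, ∑ n ∈ Ioc 0 ⌊t⌋₊, ∑ ν ∈ 𝒩, (if ν ^ 2 ∣ n ∧ d ∣ n then A.a n else 0) :=
          sum_congr rfl fun d _ => sum_comm
      _ = _ := sum_comm
  rw [hswap]
  -- now `∑ n, ∑ d, ∑ ν, [ν²∣n ∧ d∣n] a_n`
  refine sum_le_sum fun n hn => ?_
  have hn0 : n ≠ 0 := by have := (mem_Ioc.mp hn).1; omega
  have hinner : ∑ d ∈ 𝒟, ∑ ν ∈ 𝒩, (if ν ^ 2 ∣ n ∧ d ∣ n then A.a n else 0) =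
      A.a n * #(𝒟.filter (· ∣ n)) * #(𝒩.filter (fun ν => ν ^ 2 ∣ n)) := by
    rw [card_filter, card_filter]
    push_cast
    rw [mul_assoc, sum_mul_sum, mul_sum]
    refine sum_congr rfl fun d _ => ?_
    rw [mul_sum]
    refine sum_congr rfl fun ν _ => ?_
    by_cases h1 : ν ^ 2 ∣ n <;> by_cases h2 : d ∣ n <;> simp [h1, h2]
  rw [hinner]
  have hτ : (#(𝒟.filter (· ∣ n)) : ℝ) ≤ #n.divisors := by
    exact_mod_cast card_le_card fun d hd => Nat.mem_divisors.mpr ⟨(mem_filter.mp hd).2, hn0⟩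
  have ha := A.a_nonneg n
  gcongr

/-- **Collecting `∑_d ∑_ν |r_{[ν²,d]}(t)|` by `k = [ν², d]`**: for `d ≤ D₀`, `ν ≤ V₀` squarefree,
`∑_{d}^♭ ∑_{ν}^♭ |r_{[ν²,d]}(t)| ≤ ∑_{k ≤ V₀² D₀, k cubefree} τ(k) |r_k(t)|` ("every `k` has at most
`τ(k)` representations as `k = [ν², d]` and `k` is cubefree if it has any").
[cite: FriedlanderIwaniecASP1998, §9 p. 1061 (E₁)] -/
theorem sum_sum_abs_remainder_lcm_le (D₀ V₀ : ℕ) (t : ℝ) :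
    ∑ d ∈ (Icc 1 D₀).filter Squarefree, ∑ ν ∈ (Icc 1 V₀).filter Squarefree,
        |A.remainder (Nat.lcm (ν ^ 2) d) t| ≤
      ∑ k ∈ (Icc 1 (V₀ ^ 2 * D₀)).filter IsCubefree, (#k.divisors : ℝ) * |A.remainder k t| := by
  classical
  set S := (Icc 1 V₀).filter Squarefree with hS
  set T := (Icc 1 D₀).filter Squarefree with hT
  set F : ℕ → ℝ := fun k => |A.remainder k t| with hF
  have hswap : ∑ d ∈ T, ∑ ν ∈ S, |A.remainder (Nat.lcm (ν ^ 2) d) t| =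
      ∑ q ∈ S ×ˢ T, F (Nat.lcm (q.1 ^ 2) q.2) := by
    rw [sum_product, sum_comm]
  rw [hswap, sum_comp]
  have hSsq : ∀ ν ∈ S, Squarefree ν := fun ν hν => (mem_filter.mp hν).2
  have hTsq : ∀ d ∈ T, Squarefree d := fun d hd => (mem_filter.mp hd).2
  -- the image lies in the cubefree `k ≤ V₀² D₀`
  have himg : (S ×ˢ T).image (fun q : ℕ × ℕ => Nat.lcm (q.1 ^ 2) q.2) ⊆
      (Icc 1 (V₀ ^ 2 * D₀)).filter IsCubefree := by
    intro k hk
    obtain ⟨q, hq, rfl⟩ := mem_image.mp hk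
    obtain ⟨hq1, hq2⟩ := mem_product.mp hq
    have hν := mem_filter.mp hq1
    have hd := mem_filter.mp hq2
    have hν1 := mem_Icc.mp hν.1
    have hd1 := mem_Icc.mp hd.1
    refine mem_filter.mpr ⟨mem_Icc.mpr ⟨?_, ?_⟩, isCubefree_lcm_sq hν.2 hd.2⟩
    · exact Nat.one_le_iff_ne_zero.mpr (Nat.lcm_ne_zero (pow_ne_zero 2 (by omega)) (by omega))
    · calc Nat.lcm (q.1 ^ 2) q.2 ≤ q.1 ^ 2 * q.2 := by
            rw [Nat.lcm]; exact Nat.div_le_self _ _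
        _ ≤ V₀ ^ 2 * D₀ := Nat.mul_le_mul (Nat.pow_le_pow_left hν1.2 2) hd1.2
  calc ∑ k ∈ (S ×ˢ T).image (fun q : ℕ × ℕ => Nat.lcm (q.1 ^ 2) q.2),
        #((S ×ˢ T).filter (fun q => Nat.lcm (q.1 ^ 2) q.2 = k)) • F k
      ≤ ∑ k ∈ (S ×ˢ T).image (fun q : ℕ × ℕ => Nat.lcm (q.1 ^ 2) q.2), (#k.divisors : ℝ) * F k := by
        refine sum_le_sum fun k hk => ?_
        rw [nsmul_eq_mul]
        have hk0 : k ≠ 0 := by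
          have := (mem_Icc.mp (mem_filter.mp (himg hk)).1).1; omega
        refine mul_le_mul_of_nonneg_right ?_ (abs_nonneg _)
        exact_mod_cast card_filter_lcm_sq_eq_le S T hSsq hTsq hk0
    _ ≤ ∑ k ∈ (Icc 1 (V₀ ^ 2 * D₀)).filter IsCubefree, (#k.divisors : ℝ) * F k :=
        sum_le_sum_of_subset_of_nonneg himg fun k _ _ => mul_nonneg (Nat.cast_nonneg _) (abs_nonneg _)

/-- Reindexing a sum along an injection into a larger index set (nonnegative summand):
`∑_{i ∈ s} f(e(i)) ≤ ∑_{j ∈ t} f(j)`. [folklore] -/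
theorem sum_comp_le_of_injOn {ι κ : Type*} [DecidableEq κ] (s : Finset ι) (t : Finset κ)
    (e : ι → κ) (f : κ → ℝ) (he : Set.InjOn e s) (hst : ∀ i ∈ s, e i ∈ t)
    (hf : ∀ j ∈ t, 0 ≤ f j) : ∑ i ∈ s, f (e i) ≤ ∑ j ∈ t, f j := by
  rw [← sum_image (g := e) (f := f) he]
  exact sum_le_sum_of_subset_of_nonneg (fun j hj => by
    obtain ⟨i, hi, rfl⟩ := mem_image.mp hj; exact hst i hi) fun j hj _ => hf j hj

/-- **Cauchy's inequality in the form used for (R′₃) and `E₂₂`**: for `w, f ≥ 0`,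
`∑ w_k f_k ≤ (∑ w_k² f_k)^{1/2} (∑ f_k)^{1/2}`. [cite: FriedlanderIwaniecASP1998, §9 p. 1060] -/
theorem sum_mul_le_sqrt_mul_sqrt {ι : Type*} (s : Finset ι) (w f : ι → ℝ)
    (hf : ∀ i ∈ s, 0 ≤ f i) :
    ∑ i ∈ s, w i * f i ≤ Real.sqrt (∑ i ∈ s, w i ^ 2 * f i) * Real.sqrt (∑ i ∈ s, f i) := by
  have hcs := sum_mul_sq_le_sq_mul_sq s (fun i => w i * Real.sqrt (f i)) (fun i => Real.sqrt (f i))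
  have h1 : ∑ i ∈ s, w i * Real.sqrt (f i) * Real.sqrt (f i) = ∑ i ∈ s, w i * f i :=
    sum_congr rfl fun i hi => by rw [mul_assoc, Real.mul_self_sqrt (hf i hi)]
  have h2 : ∑ i ∈ s, (w i * Real.sqrt (f i)) ^ 2 = ∑ i ∈ s, w i ^ 2 * f i :=
    sum_congr rfl fun i hi => by rw [mul_pow, Real.sq_sqrt (hf i hi)]
  have h3 : ∑ i ∈ s, Real.sqrt (f i) ^ 2 = ∑ i ∈ s, f i :=
    sum_congr rfl fun i hi => Real.sq_sqrt (hf i hi)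
  rw [h1, h2, h3] at hcs
  have hA : 0 ≤ ∑ i ∈ s, w i ^ 2 * f i := sum_nonneg fun i hi => mul_nonneg (sq_nonneg _) (hf i hi)
  have hB : 0 ≤ ∑ i ∈ s, f i := sum_nonneg hf
  calc ∑ i ∈ s, w i * f i ≤ |∑ i ∈ s, w i * f i| := le_abs_self _
    _ = Real.sqrt ((∑ i ∈ s, w i * f i) ^ 2) := (Real.sqrt_sq_eq_abs _).symm
    _ ≤ Real.sqrt ((∑ i ∈ s, w i ^ 2 * f i) * ∑ i ∈ s, f i) := Real.sqrt_le_sqrt hcs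
    _ = Real.sqrt (∑ i ∈ s, w i ^ 2 * f i) * Real.sqrt (∑ i ∈ s, f i) := Real.sqrt_mul hA _

/-- `|r_m(t)| ≤ A_m(t) + g(m) A(t)` when `g(m), A(t) ≥ 0`. [cite: FriedlanderIwaniecASP1998, §9 p. 1060] -/
theorem abs_remainder_le (m : ℕ) (t : ℝ) (hg : 0 ≤ A.density m) (hA : 0 ≤ A.size t) :
    |A.remainder m t| ≤ A.congrSum m t + A.density m * A.size t := by
  rw [SieveSequence.remainder]
  have h1 : 0 ≤ A.congrSum m t := sum_nonneg fun n _ => A.a_nonneg n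
  have h2 : 0 ≤ A.density m * A.size t := mul_nonneg hg hA
  rw [abs_sub_le_iff]
  constructor <;> linarith

/-- **Swapping a weighted sum of congruence sums**: for a finite set `𝒦` of moduli,
`∑_{k ∈ 𝒦} w(k) A_k(t) = ∑_{n ≤ t} a_n ∑_{k ∈ 𝒦, k ∣ n} w(k)`. [folklore] -/
theorem sum_mul_congrSum_eq (𝒦 : Finset ℕ) (w : ℕ → ℝ) (t : ℝ) :
    ∑ k ∈ 𝒦, w k * A.congrSum k t = ∑ n ∈ Ioc 0 ⌊t⌋₊, A.a n * ∑ k ∈ 𝒦.filter (· ∣ n), w k := by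
  classical
  have hexp : ∀ k, w k * A.congrSum k t = ∑ n ∈ Ioc 0 ⌊t⌋₊, if k ∣ n then w k * A.a n else 0 := by
    intro k
    rw [SieveSequence.congrSum, mul_sum, sum_filter]
  simp_rw [hexp]
  rw [sum_comm]
  refine sum_congr rfl fun n _ => ?_
  rw [sum_filter, mul_sum]
  exact sum_congr rfl fun k _ => by split_ifs <;> simp [mul_comm]

/-- **`∑_{k ∈ 𝒦} τ(k)² A_k(t) ≤ ∑_{n ≤ t} a_n τ(n)³`** (swap and `∑_{k ∣ n} τ(k)² ≤ τ(n)³`): the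
`τ²`-weighted congruence sums are controlled by the divisor cube moment (2.8′).
[cite: FriedlanderIwaniecASP1998, §9 p. 1060 and p. 1062 (S₂)] -/
theorem sum_card_divisors_sq_mul_congrSum_le (𝒦 : Finset ℕ) (t : ℝ) :
    ∑ k ∈ 𝒦, (#k.divisors : ℝ) ^ 2 * A.congrSum k t ≤
      ∑ n ∈ Ioc 0 ⌊t⌋₊, A.a n * (#n.divisors : ℝ) ^ 3 := by
  classical
  rw [sum_mul_congrSum_eq]
  refine sum_le_sum fun n hn => mul_le_mul_of_nonneg_left ?_ (A.a_nonneg n)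
  have hn0 : n ≠ 0 := by have := (mem_Ioc.mp hn).1; omega
  calc ∑ k ∈ 𝒦.filter (· ∣ n), (#k.divisors : ℝ) ^ 2
      ≤ ∑ k ∈ n.divisors, (#k.divisors : ℝ) ^ 2 := by
        refine sum_le_sum_of_subset_of_nonneg (fun k hk => ?_) fun k _ _ => by positivity
        exact Nat.mem_divisors.mpr ⟨(mem_filter.mp hk).2, hn0⟩
    _ ≤ (#n.divisors : ℝ) ^ 3 := sum_divisors_card_divisors_sq_le n

/-- `#{ν ∈ 𝒩 : ν² ∣ n} ≤ τ(n)` for `n ≥ 1` (`ν ↦ ν²` is injective into the divisors). [folklore] -/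
theorem card_filter_sq_dvd_le (𝒩 : Finset ℕ) {n : ℕ} (hn : n ≠ 0) :
    #(𝒩.filter (fun ν => ν ^ 2 ∣ n)) ≤ #n.divisors := by
  classical
  refine Finset.card_le_card_of_injOn (fun ν => ν ^ 2) (fun ν hν => ?_) ?_
  · rw [mem_coe, Nat.mem_divisors]
    exact ⟨(mem_filter.mp (mem_coe.mp hν)).2, hn⟩
  · intro ν _ ν' _ h
    exact Nat.pow_left_injective two_ne_zero h

/-- **`∑_{ν ∈ 𝒩} A_{ν²}(t) = ∑_{n ≤ t} a_n #{ν ∈ 𝒩 : ν² ∣ n}`**. [folklore] -/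
theorem sum_congrSum_sq_eq (𝒩 : Finset ℕ) (t : ℝ) :
    ∑ ν ∈ 𝒩, A.congrSum (ν ^ 2) t = ∑ n ∈ Ioc 0 ⌊t⌋₊, A.a n * #(𝒩.filter (fun ν => ν ^ 2 ∣ n)) := by
  classical
  have h := sum_mul_congrSum_eq A (𝒩.image (fun ν => ν ^ 2)) (fun _ => 1) t
  rw [sum_image fun ν _ ν' _ h => Nat.pow_left_injective two_ne_zero h] at h
  simp only [one_mul] at h
  rw [h]
  refine sum_congr rfl fun n _ => ?_
  congr 1
  rw [sum_const, nsmul_eq_mul, mul_one]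
  congr 1
  -- `#{k ∈ 𝒩.image (·²) : k ∣ n} = #{ν ∈ 𝒩 : ν² ∣ n}`
  rw [filter_image, card_image_of_injOn]
  intro ν _ ν' _ h
  exact Nat.pow_left_injective two_ne_zero h

/-- **The square moduli beyond `Y`**: for `ν ≥ 1`,
`∑_{n ≤ X, ν² ∣ n} τ(n)³ ≤ τ(ν)⁶ ∑_{m ≤ X/ν²} τ(m)³` (`n = ν² m`, `τ(ν² m) ≤ τ(ν)² τ(m)`).
[cite: FriedlanderIwaniecASP1998, §9 p. 1062 (E₂₁)] -/
theorem sum_filter_sq_dvd_card_divisors_cube_le {ν : ℕ} (hν : ν ≠ 0) (X : ℕ) :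
    ∑ n ∈ (Icc 1 X).filter (fun n => ν ^ 2 ∣ n), (#n.divisors : ℝ) ^ 3 ≤
      (#ν.divisors : ℝ) ^ 6 * ∑ m ∈ Icc 1 (X / ν ^ 2), (#m.divisors : ℝ) ^ 3 := by
  classical
  have hν2 : 0 < ν ^ 2 := pow_pos (Nat.pos_of_ne_zero hν) 2
  have hset : (Icc 1 X).filter (fun n => ν ^ 2 ∣ n) = (Icc 1 (X / ν ^ 2)).image (fun m => ν ^ 2 * m) := by
    ext n
    simp only [mem_filter, mem_Icc, mem_image]
    constructor
    · rintro ⟨⟨hn1, hnX⟩, m, rfl⟩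
      refine ⟨m, ⟨?_, ?_⟩, rfl⟩
      · rcases Nat.eq_zero_or_pos m with rfl | hm
        · simp at hn1
        · exact hm
      · exact (Nat.le_div_iff_mul_le hν2).mpr (by rwa [mul_comm] at hnX)
    · rintro ⟨m, ⟨hm1, hmX⟩, rfl⟩
      refine ⟨⟨Nat.mul_pos hν2 hm1, ?_⟩, dvd_mul_right _ _⟩
      have := (Nat.le_div_iff_mul_le hν2).mp hmX
      rwa [mul_comm] at this
  rw [hset, sum_image fun m _ m' _ h => Nat.eq_of_mul_eq_mul_left hν2 h, mul_sum]
  refine sum_le_sum fun m _ => ?_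
  have h1 : #(ν ^ 2 * m).divisors ≤ #(ν ^ 2).divisors * #m.divisors := by
    rw [Nat.divisors_mul]; exact Finset.card_mul_le
  have h2 : #(ν ^ 2).divisors ≤ #ν.divisors * #ν.divisors := by
    rw [sq, Nat.divisors_mul]; exact Finset.card_mul_le
  have h3 : (#(ν ^ 2 * m).divisors : ℝ) ≤ (#ν.divisors : ℝ) ^ 2 * #m.divisors := by
    calc (#(ν ^ 2 * m).divisors : ℝ) ≤ #(ν ^ 2).divisors * #m.divisors := by exact_mod_cast h1
      _ ≤ (#ν.divisors * #ν.divisors : ℕ) * #m.divisors := by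
          exact mul_le_mul_of_nonneg_right (by exact_mod_cast h2) (Nat.cast_nonneg _)
      _ = (#ν.divisors : ℝ) ^ 2 * #m.divisors := by push_cast; ring
  calc (#(ν ^ 2 * m).divisors : ℝ) ^ 3 ≤ ((#ν.divisors : ℝ) ^ 2 * #m.divisors) ^ 3 :=
        pow_le_pow_left₀ (Nat.cast_nonneg _) h3 3
    _ = (#ν.divisors : ℝ) ^ 6 * (#m.divisors : ℝ) ^ 3 := by ring

/-- **`∑_{d ≤ D₀}^♭ g(d/(ν,d)) ≤ τ(ν) ∑_{e ≤ D₀}^♭ g(e)`** for `ν ≥ 1` and `g ≥ 0` on squarefree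
numbers (fibre over `(ν, d) ∈ divisors ν`; on each fibre `d ↦ d/(ν,d)` is injective into the
squarefree `e ≤ D₀`). This bounds `∑_d g([ν²,d]) = g(ν²) ∑_d g(d/(ν,d))`.
[cite: FriedlanderIwaniecASP1998, §9 p. 1062 (second term of E₂)] -/
theorem sum_sqfree_density_div_gcd_le {g : ArithmeticFunction ℝ}
    (hg0 : ∀ e : ℕ, Squarefree e → 0 ≤ g e) {ν : ℕ} (hν : ν ≠ 0) (D₀ : ℕ) :
    ∑ d ∈ (Icc 1 D₀).filter Squarefree, g (d / Nat.gcd ν d) ≤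
      #ν.divisors * ∑ e ∈ (Icc 1 D₀).filter Squarefree, g e := by
  classical
  set T := (Icc 1 D₀).filter Squarefree with hT
  rw [← sum_fiberwise_of_maps_to (s := T) (t := ν.divisors) (g := fun d => Nat.gcd ν d)
    (fun d _ => Nat.mem_divisors.mpr ⟨Nat.gcd_dvd_left ν d, hν⟩)]
  have hfib : ∀ e ∈ ν.divisors, ∑ d ∈ T.filter (fun d => Nat.gcd ν d = e), g (d / Nat.gcd ν d) ≤
      ∑ e' ∈ T, g e' := by
    intro e he
    have he0 : 0 < e := Nat.pos_of_mem_divisors he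
    calc ∑ d ∈ T.filter (fun d => Nat.gcd ν d = e), g (d / Nat.gcd ν d)
        = ∑ d ∈ T.filter (fun d => Nat.gcd ν d = e), g (d / e) :=
          sum_congr rfl fun d hd => by rw [(mem_filter.mp hd).2]
      _ ≤ ∑ e' ∈ T, g e' := by
          refine sum_comp_le_of_injOn _ T (fun d => d / e) g ?_ ?_ fun e' he' => hg0 e' (mem_filter.mp he').2
          · intro d hd d' hd' h
            have hed : e ∣ d := (mem_filter.mp (mem_coe.mp hd)).2 ▸ Nat.gcd_dvd_right ν d
            have hed' : e ∣ d' := (mem_filter.mp (mem_coe.mp hd')).2 ▸ Nat.gcd_dvd_right ν d'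
            simp only at h
            rw [← Nat.mul_div_cancel' hed, ← Nat.mul_div_cancel' hed', h]
          · intro d hd
            obtain ⟨hdT, hde⟩ := mem_filter.mp hd
            obtain ⟨hd1, hdsq⟩ := mem_filter.mp hdT
            have hed : e ∣ d := hde ▸ Nat.gcd_dvd_right ν d
            refine mem_filter.mpr ⟨mem_Icc.mpr ⟨?_, ?_⟩, hdsq.squarefree_of_dvd (Nat.div_dvd_of_dvd hed)⟩
            · exact Nat.div_pos (Nat.le_of_dvd (mem_Icc.mp hd1).1 hed) he0
            · exact (Nat.div_le_self d e).trans (mem_Icc.mp hd1).2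
  calc ∑ e ∈ ν.divisors, ∑ d ∈ T.filter (fun d => Nat.gcd ν d = e), g (d / Nat.gcd ν d)
      ≤ ∑ e ∈ ν.divisors, ∑ e' ∈ T, g e' := sum_le_sum hfib
    _ = #ν.divisors * ∑ e' ∈ T, g e' := by rw [sum_const, nsmul_eq_mul]

end Sequence

/-! ### The constant `G = ∏_p (1 - g(p²))` ((9.8)) and the truncated Möbius sum `M₁(V)` -/

section DensityConstant

variable {g : ArithmeticFunction ℝ}

/-- The partial products `Π(y) = ∏_{p ≤ y} (1 - g(p²))` are positive ((9.1): `g(p²) ≤ g(p) < 1`).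
[cite: FriedlanderIwaniecASP1998, §9 (9.8)] -/
theorem prod_one_sub_density_sq_pos
    (h24 : ∀ p : ℕ, p.Prime → 0 ≤ g (p ^ 2) ∧ g (p ^ 2) ≤ g p ∧ g p < 1) (y : ℕ) :
    0 < ∏ p ∈ Nat.primesLE y, (1 - g (p ^ 2)) :=
  prod_pos fun p hp => by
    have h := h24 p (Nat.mem_primesLE.mp hp).2
    linarith [h.2.1, h.2.2]

/-- `Π(y) ≤ 1`. [cite: FriedlanderIwaniecASP1998, §9 (9.8)] -/
theorem prod_one_sub_density_sq_le_one
    (h24 : ∀ p : ℕ, p.Prime → 0 ≤ g (p ^ 2) ∧ g (p ^ 2) ≤ g p ∧ g p < 1) (y : ℕ) :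
    ∏ p ∈ Nat.primesLE y, (1 - g (p ^ 2)) ≤ 1 :=
  prod_le_one (fun p hp => by
      have h := h24 p (Nat.mem_primesLE.mp hp).2; linarith [h.2.1, h.2.2])
    fun p hp => by have h := h24 p (Nat.mem_primesLE.mp hp).2; linarith [h.1]

/-- `primesLE` is monotone. [folklore] -/
theorem primesLE_subset {V y : ℕ} (h : V ≤ y) : Nat.primesLE V ⊆ Nat.primesLE y := fun p hp => by
  rw [Nat.mem_primesLE] at hp ⊢
  exact ⟨hp.1.trans h, hp.2⟩

/-- **The new factors**: for `V ≤ y`, `Π(y) = Π(V) · ∏_{V < p ≤ y} (1 - g(p²)) ≥ Π(V) (1 - 2K/(V+1))`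
(Weierstrass and `∑_{p > V} g(p²) ≤ K ∑_{i > V} i⁻² ≤ 2K/(V+1)`). [cite: FriedlanderIwaniecASP1998, §9 (9.8)] -/
theorem prod_one_sub_density_sq_ge
    (h24 : ∀ p : ℕ, p.Prime → 0 ≤ g (p ^ 2) ∧ g (p ^ 2) ≤ g p ∧ g p < 1) {K : ℝ}
    (hK : ∀ p : ℕ, p.Prime → g p ≤ K / p ∧ g (p ^ 2) ≤ K / (p : ℝ) ^ 2) {V y : ℕ} (hVy : V ≤ y) :
    (∏ p ∈ Nat.primesLE V, (1 - g (p ^ 2))) * (1 - 2 * K / ((V : ℝ) + 1)) ≤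
      ∏ p ∈ Nat.primesLE y, (1 - g (p ^ 2)) := by
  have hK0 := densityConst_nonneg h24 hK
  have hsub := primesLE_subset hVy
  rw [← prod_sdiff hsub, mul_comm]
  refine mul_le_mul_of_nonneg_right ?_ (prod_one_sub_density_sq_pos h24 V).le
  -- the new primes
  have hnew : ∑ p ∈ Nat.primesLE y \ Nat.primesLE V, g (p ^ 2) ≤ 2 * K / ((V : ℝ) + 1) := by
    calc ∑ p ∈ Nat.primesLE y \ Nat.primesLE V, g (p ^ 2)
        ≤ ∑ p ∈ Nat.primesLE y \ Nat.primesLE V, K * ((p : ℝ) ^ 2)⁻¹ := by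
          refine sum_le_sum fun p hp => ?_
          rw [← div_eq_mul_inv]
          exact (hK p (Nat.mem_primesLE.mp (mem_sdiff.mp hp).1).2).2
      _ ≤ ∑ i ∈ Ioo V (y + 1), K * ((i : ℝ) ^ 2)⁻¹ := by
          refine sum_le_sum_of_subset_of_nonneg (fun p hp => ?_) fun i _ _ => by positivity
          obtain ⟨hpy, hpV⟩ := mem_sdiff.mp hp
          have hp := Nat.mem_primesLE.mp hpy
          rw [mem_Ioo]
          refine ⟨?_, Nat.lt_succ_of_le hp.1⟩
          by_contra h
          exact hpV (Nat.mem_primesLE.mpr ⟨not_lt.mp h, hp.2⟩)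
      _ = K * ∑ i ∈ Ioo V (y + 1), ((i : ℝ) ^ 2)⁻¹ := by rw [mul_sum]
      _ ≤ K * (2 / ((V : ℝ) + 1)) :=
          mul_le_mul_of_nonneg_left (sum_Ioo_inv_sq_le V (y + 1)) hK0
      _ = 2 * K / ((V : ℝ) + 1) := by ring
  calc 1 - 2 * K / ((V : ℝ) + 1) ≤ 1 - ∑ p ∈ Nat.primesLE y \ Nat.primesLE V, g (p ^ 2) := by linarith
    _ ≤ ∏ p ∈ Nat.primesLE y \ Nat.primesLE V, (1 - g (p ^ 2)) :=
        CFZ.one_sub_sum_le_prod_one_sub _ (fun p hp => (h24 p (Nat.mem_primesLE.mp (mem_sdiff.mp hp).1).2).1)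
          fun p hp => by
            have h := h24 p (Nat.mem_primesLE.mp (mem_sdiff.mp hp).1).2
            linarith [h.2.1, h.2.2]

/-- `Π` is antitone: `Π(y) ≤ Π(V)` for `V ≤ y`. [cite: FriedlanderIwaniecASP1998, §9 (9.8)] -/
theorem prod_one_sub_density_sq_antitone
    (h24 : ∀ p : ℕ, p.Prime → 0 ≤ g (p ^ 2) ∧ g (p ^ 2) ≤ g p ∧ g p < 1) {V y : ℕ} (hVy : V ≤ y) :
    ∏ p ∈ Nat.primesLE y, (1 - g (p ^ 2)) ≤ ∏ p ∈ Nat.primesLE V, (1 - g (p ^ 2)) := by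
  rw [← prod_sdiff (primesLE_subset hVy)]
  refine mul_le_of_le_one_left (prod_one_sub_density_sq_pos h24 V).le ?_
  exact prod_le_one (fun p hp => by
      have h := h24 p (Nat.mem_primesLE.mp (mem_sdiff.mp hp).1).2; linarith [h.2.1, h.2.2])
    fun p hp => by have h := h24 p (Nat.mem_primesLE.mp (mem_sdiff.mp hp).1).2; linarith [h.1]

/-- **The constant `G = ∏_p (1 - g(p²))` of (9.8)**: the partial products `Π(y)` converge to a
limit `G > 0` with `Π(V) - 2K/(V+1) ≤ G ≤ Π(V)` for every `V`. [cite: FriedlanderIwaniecASP1998, §9 (9.8)] -/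
theorem exists_densitySqConst
    (h24 : ∀ p : ℕ, p.Prime → 0 ≤ g (p ^ 2) ∧ g (p ^ 2) ≤ g p ∧ g p < 1) {K : ℝ}
    (hK : ∀ p : ℕ, p.Prime → g p ≤ K / p ∧ g (p ^ 2) ≤ K / (p : ℝ) ^ 2) :
    ∃ G : ℝ, Tendsto (fun y : ℕ => ∏ p ∈ Nat.primesLE y, (1 - g (p ^ 2))) atTop (nhds G) ∧
      0 < G ∧ (∀ V : ℕ, G ≤ ∏ p ∈ Nat.primesLE V, (1 - g (p ^ 2))) ∧
      (∀ V : ℕ, (∏ p ∈ Nat.primesLE V, (1 - g (p ^ 2))) - 2 * K / ((V : ℝ) + 1) ≤ G) := by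
  have hK0 := densityConst_nonneg h24 hK
  set Pf : ℕ → ℝ := fun y => ∏ p ∈ Nat.primesLE y, (1 - g (p ^ 2)) with hPf
  have hanti : Antitone Pf := fun V y hVy => prod_one_sub_density_sq_antitone h24 hVy
  have hbdd : BddBelow (Set.range Pf) := ⟨0, by
    rintro _ ⟨y, rfl⟩; exact (prod_one_sub_density_sq_pos h24 y).le⟩
  refine ⟨⨅ y, Pf y, tendsto_atTop_ciInf hanti hbdd, ?_, fun V => ciInf_le hbdd V, ?_⟩
  · -- positivity: `Π(y) ≥ Π(V₀)/2` with `V₀ + 1 ≥ 4K`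
    set V₀ : ℕ := ⌈4 * K⌉₊ with hV₀
    have hV₀K : 2 * K / ((V₀ : ℝ) + 1) ≤ 1 / 2 := by
      rw [div_le_iff₀ (by positivity)]
      have : 4 * K ≤ V₀ := Nat.le_ceil _
      linarith
    have hpos := prod_one_sub_density_sq_pos h24 V₀
    have hlow : ∀ y, Pf V₀ / 2 ≤ Pf y := by
      intro y
      rcases le_or_gt V₀ y with h | h
      · have := prod_one_sub_density_sq_ge h24 hK h
        have h2 : Pf V₀ * (1 / 2) ≤ Pf V₀ * (1 - 2 * K / ((V₀ : ℝ) + 1)) :=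
          mul_le_mul_of_nonneg_left (by linarith) hpos.le
        simp only [hPf] at this h2 ⊢
        linarith
      · have := hanti h.le
        simp only [hPf] at this ⊢
        linarith
    exact lt_of_lt_of_le (by simp only [hPf]; linarith) (le_ciInf hlow)
  · intro V
    refine le_ciInf fun y => ?_
    rcases le_or_gt V y with h | h
    · have h1 := prod_one_sub_density_sq_ge h24 hK h
      have hle1 := prod_one_sub_density_sq_le_one h24 V
      have hpos := prod_one_sub_density_sq_pos h24 V
      have hfrac : 0 ≤ 2 * K / ((V : ℝ) + 1) := by positivity
      -- `Π(V)(1 - s) ≥ Π(V) - s` for `Π(V) ≤ 1`, `s ≥ 0`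
      simp only [hPf]
      nlinarith
    · have := hanti h.le
      have hfrac : 0 ≤ 2 * K / ((V : ℝ) + 1) := by positivity
      simp only [hPf] at this ⊢
      linarith

/-- **`Π(V)` as a complete Möbius sum**: `∏_{p ≤ V} (1 - g(p²)) = ∑_{ν ∣ P(V)} μ(ν) g(ν²)` with
`P(V) = ∏_{p ≤ V} p`. [cite: FriedlanderIwaniecASP1998, §9 (9.8)] -/
theorem prod_one_sub_density_sq_eq_sum (hg : g.IsMultiplicative) (V : ℕ) :
    ∏ p ∈ Nat.primesLE V, (1 - g (p ^ 2)) =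
      ∑ ν ∈ (∏ p ∈ Nat.primesLE V, p).divisors, (μ ν : ℝ) * g (ν ^ 2) := by
  have hprime : ∀ p ∈ Nat.primesLE V, p.Prime := fun p hp => (Nat.mem_primesLE.mp hp).2
  have hsq := FriedlanderIwaniecPrimesSquarefree.squarefree_prod_of_primes hprime
  rw [sum_divisors_moebius_mul_apply_sq hg hsq, Nat.primeFactors_prod hprime]

/-- **`|M₁(V) - Π(V)| ≤ (V+1)^{-7/8} e^{KZ}`**: the truncated Möbius sum
`M₁(V) = ∑_{ν ≤ V}^♭ μ(ν) g(ν²)` differs from `Π(V) = ∑_{ν ∣ P(V)} μ(ν) g(ν²)` by the terms `ν > V`.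
[cite: FriedlanderIwaniecASP1998, §9 (9.8)-(9.10)] -/
theorem abs_sum_sqfree_moebius_sq_sub_prod_le (hg : g.IsMultiplicative)
    (h24 : ∀ p : ℕ, p.Prime → 0 ≤ g (p ^ 2) ∧ g (p ^ 2) ≤ g p ∧ g p < 1) {K : ℝ}
    (hK : ∀ p : ℕ, p.Prime → g p ≤ K / p ∧ g (p ^ 2) ≤ K / (p : ℝ) ^ 2) (V : ℕ) :
    |(∑ ν ∈ (Icc 1 V).filter Squarefree, (μ ν : ℝ) * g (ν ^ 2)) -
        ∏ p ∈ Nat.primesLE V, (1 - g (p ^ 2))| ≤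
      ((V : ℝ) + 1) ^ (-(7 / 8 : ℝ)) * Real.exp (K * ∑' n : ℕ, (n : ℝ) ^ (-(9 / 8 : ℝ))) := by
  classical
  set P := ∏ p ∈ Nat.primesLE V, p with hP
  have hprime : ∀ p ∈ Nat.primesLE V, p.Prime := fun p hp => (Nat.mem_primesLE.mp hp).2
  have hPsq : Squarefree P := FriedlanderIwaniecPrimesSquarefree.squarefree_prod_of_primes hprime
  have hP0 : P ≠ 0 := hPsq.ne_zero
  rw [prod_one_sub_density_sq_eq_sum hg V]
  -- `SF(V) ⊆ P.divisors`, the complement consists of squarefree `ν > V`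
  have hsub : (Icc 1 V).filter Squarefree ⊆ P.divisors := by
    intro ν hν
    obtain ⟨hν1, hνsq⟩ := mem_filter.mp hν
    rw [Nat.mem_divisors]
    refine ⟨?_, hP0⟩
    rw [← Nat.prod_primeFactors_of_squarefree hνsq, hP]
    refine prod_dvd_prod_of_subset _ _ _ fun p hp => ?_
    exact Nat.mem_primesLE.mpr ⟨(Nat.le_of_mem_primeFactors hp).trans (mem_Icc.mp hν1).2,
      Nat.prime_of_mem_primeFactors hp⟩
  rw [← sum_sdiff hsub, show ∀ a b : ℝ, a - (b + a) = -b from fun a b => by ring, abs_neg]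
  have hdiff : P.divisors \ (Icc 1 V).filter Squarefree ⊆ (Ioc V P).filter Squarefree := by
    intro ν hν
    obtain ⟨hνP, hνV⟩ := mem_sdiff.mp hν
    have hνdvd := Nat.dvd_of_mem_divisors hνP
    have hνsq : Squarefree ν := hPsq.squarefree_of_dvd hνdvd
    have hν1 : 1 ≤ ν := Nat.pos_of_mem_divisors hνP
    refine mem_filter.mpr ⟨mem_Ioc.mpr ⟨?_, Nat.divisor_le hνP⟩, hνsq⟩
    by_contra h
    exact hνV (mem_filter.mpr ⟨mem_Icc.mpr ⟨hν1, not_lt.mp h⟩, hνsq⟩)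
  have htail := tail_sum_sqfree_density_sq_le hg h24 hK 0 V P
  simp only [pow_zero, one_mul] at htail
  calc |∑ ν ∈ P.divisors \ (Icc 1 V).filter Squarefree, (μ ν : ℝ) * g (ν ^ 2)|
      ≤ ∑ ν ∈ P.divisors \ (Icc 1 V).filter Squarefree, |(μ ν : ℝ) * g (ν ^ 2)| :=
        abs_sum_le_sum_abs _ _
    _ ≤ ∑ ν ∈ P.divisors \ (Icc 1 V).filter Squarefree, g (ν ^ 2) := by
        refine sum_le_sum fun ν hν => ?_
        have hνsq : Squarefree ν :=
          hPsq.squarefree_of_dvd (Nat.dvd_of_mem_divisors (mem_sdiff.mp hν).1)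
        have hg2 := apply_sq_nonneg_of_squarefree hg h24 hνsq
        have hμ : |(μ ν : ℝ)| ≤ 1 := by exact_mod_cast ArithmeticFunction.abs_moebius_le_one
        rw [abs_mul, abs_of_nonneg hg2]
        nlinarith
    _ ≤ ∑ ν ∈ (Ioc V P).filter Squarefree, g (ν ^ 2) :=
        sum_le_sum_of_subset_of_nonneg hdiff fun ν hν _ =>
          apply_sq_nonneg_of_squarefree hg h24 (mem_filter.mp hν).2
    _ ≤ _ := htail

end DensityConstant

/-! ### The density `g̃` of (9.5): `(1.8)` and `(1.9)` for `g̃` -/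

section SqfreeDensity

variable {g g' : ArithmeticFunction ℝ}

/-- **(9.5) at a prime, elementary facts**: with `g̃(p) = (g(p) - g(p²))/(1 - g(p²))` and (9.1),
`0 ≤ g̃(p) ≤ g(p)`, `g(p) - g̃(p) ≤ g(p²)` and `1 - g̃(p) = (1 - g(p))/(1 - g(p²))`.
[cite: FriedlanderIwaniecASP1998, §9 (9.5)] -/
theorem sqfreeDensity_prime_facts
    (h24 : ∀ p : ℕ, p.Prime → 0 ≤ g (p ^ 2) ∧ g (p ^ 2) ≤ g p ∧ g p < 1)
    (hg' : ∀ p : ℕ, p.Prime → g' p = (g p - g (p ^ 2)) / (1 - g (p ^ 2))) {p : ℕ} (hp : p.Prime) :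
    0 ≤ g' p ∧ g' p ≤ g p ∧ g p - g' p ≤ g (p ^ 2) ∧ 1 - g' p = (1 - g p) / (1 - g (p ^ 2)) := by
  obtain ⟨h0, h1, h2⟩ := h24 p hp
  have hden : 0 < 1 - g (p ^ 2) := by linarith
  rw [hg' p hp]
  refine ⟨div_nonneg (by linarith) hden.le, ?_, ?_, ?_⟩
  · rw [div_le_iff₀ hden]; nlinarith
  · rw [sub_le_iff_le_add, ← sub_le_iff_le_add', le_div_iff₀ hden]; nlinarith
  · field_simp; ring

/-- `g̃ ≤ g` and `g̃ ≥ 0` on squarefree numbers (multiplicativity). [cite: FriedlanderIwaniecASP1998, §9 (9.5)] -/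
theorem sqfreeDensity_squarefree_le (hg : g.IsMultiplicative) (hg'm : g'.IsMultiplicative)
    (h24 : ∀ p : ℕ, p.Prime → 0 ≤ g (p ^ 2) ∧ g (p ^ 2) ≤ g p ∧ g p < 1)
    (hg' : ∀ p : ℕ, p.Prime → g' p = (g p - g (p ^ 2)) / (1 - g (p ^ 2))) {d : ℕ} (hd : Squarefree d) :
    0 ≤ g' d ∧ g' d ≤ g d := by
  rw [← hg'm.prod_primeFactors hd, ← hg.prod_primeFactors hd]
  refine ⟨prod_nonneg fun p hp => (sqfreeDensity_prime_facts h24 hg'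
    (Nat.prime_of_mem_primeFactors hp)).1, ?_⟩
  exact prod_le_prod (fun p hp => (sqfreeDensity_prime_facts h24 hg'
      (Nat.prime_of_mem_primeFactors hp)).1)
    fun p hp => (sqfreeDensity_prime_facts h24 hg' (Nat.prime_of_mem_primeFactors hp)).2.1

/-- `g(e²) ≤ g(e)` for squarefree `e` ((9.1) and multiplicativity). [cite: FriedlanderIwaniecASP1998, §9 (9.1)] -/
theorem density_sq_le_of_squarefree (hg : g.IsMultiplicative)
    (h24 : ∀ p : ℕ, p.Prime → 0 ≤ g (p ^ 2) ∧ g (p ^ 2) ≤ g p ∧ g p < 1) {e : ℕ} (he : Squarefree e) :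
    g (e ^ 2) ≤ g e := by
  let F : ArithmeticFunction ℝ := ⟨fun ν => g (ν ^ 2), by simp⟩
  have hF : F.IsMultiplicative := by
    refine ⟨by simp [F, hg.map_one], fun {m n} hmn => ?_⟩
    simp only [F, ArithmeticFunction.coe_mk, mul_pow]
    exact hg.map_mul_of_coprime (hmn.pow 2 2)
  have h1 : g (e ^ 2) = ∏ p ∈ e.primeFactors, g (p ^ 2) := by
    have := hF.prod_primeFactors he
    simpa [F] using this.symm
  rw [h1, ← hg.prod_primeFactors he]
  exact prod_le_prod (fun p hp => (h24 p (Nat.prime_of_mem_primeFactors hp)).1)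
    fun p hp => (h24 p (Nat.prime_of_mem_primeFactors hp)).2.1

/-- **(1.9) for `g̃`** ("Notice that `g̃(p)` satisfies (1.8) and (1.9) due to (9.1)"): since
`0 ≤ g(p) - g̃(p) ≤ g(p²) ≤ K/p²` is summable with tail `≤ 2K/y`,
`∑_{p ≤ y} g̃(p) = log log y + c̃ + O((log y)^{-10})` with `c̃ = c - ∑_p (g(p) - g̃(p))`.
[cite: FriedlanderIwaniecASP1998, §9 after (9.5)] -/
theorem sqfreeDensity_mertens
    (h24 : ∀ p : ℕ, p.Prime → 0 ≤ g (p ^ 2) ∧ g (p ^ 2) ≤ g p ∧ g p < 1) {K : ℝ}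
    (hK : ∀ p : ℕ, p.Prime → g p ≤ K / p ∧ g (p ^ 2) ≤ K / (p : ℝ) ^ 2) {c K₉ : ℝ}
    (h19 : ∀ y : ℝ, 2 ≤ y → |(∑ p ∈ Nat.primesLE ⌊y⌋₊, g p) - (Real.log (Real.log y) + c)| ≤
      K₉ / Real.log y ^ 10)
    (hg' : ∀ p : ℕ, p.Prime → g' p = (g p - g (p ^ 2)) / (1 - g (p ^ 2))) :
    ∃ c' K' : ℝ, ∀ y : ℝ, 2 ≤ y →
      |(∑ p ∈ Nat.primesLE ⌊y⌋₊, g' p) - (Real.log (Real.log y) + c')| ≤ K' / Real.log y ^ 10 := by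
  classical
  have hK0 := densityConst_nonneg h24 hK
  set δ : ℕ → ℝ := fun n => if n.Prime then g n - g' n else 0 with hδ
  have hδ0 : ∀ n, 0 ≤ δ n := fun n => by
    simp only [hδ]; split_ifs with hn
    · linarith [(sqfreeDensity_prime_facts h24 hg' hn).2.1]
    · exact le_rfl
  have hδle : ∀ n, δ n ≤ K * ((n : ℝ) ^ 2)⁻¹ := fun n => by
    simp only [hδ]; split_ifs with hn
    · have := (sqfreeDensity_prime_facts h24 hg' hn).2.2.1
      have h2 := (hK n hn).2
      rw [div_eq_mul_inv] at h2
      linarith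
    · positivity
  have hsum2 : Summable fun n : ℕ => K * ((n : ℝ) ^ 2)⁻¹ :=
    (Real.summable_nat_pow_inv.mpr one_lt_two).mul_left K
  have hδs : Summable δ := Summable.of_nonneg_of_le hδ0 hδle hsum2
  set S := ∑' n, δ n with hS
  refine ⟨c - S, K₉ + 2 * K * 10 ^ 10, fun y hy => ?_⟩
  set N := ⌊y⌋₊ with hN
  have hy1 : (1 : ℝ) ≤ y := by linarith
  have hN2 : 2 ≤ N := Nat.le_floor (by exact_mod_cast hy)
  have hNy : y < (N : ℝ) + 1 := Nat.lt_floor_add_one y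
  have hlogy : 0 < Real.log y := Real.log_pos (by linarith)
  -- `∑_{p ≤ N} g' = ∑_{p ≤ N} g - ∑_{n < N+1} δ`
  have hsplit : ∑ p ∈ Nat.primesLE N, g' p = ∑ p ∈ Nat.primesLE N, g p - ∑ n ∈ range (N + 1), δ n := by
    rw [Nat.primesLE_eq_filter_range, sum_filter, sum_filter, ← sum_filter, ← sum_sub_distrib]
    rw [sum_filter]
    refine sum_congr rfl fun n _ => ?_
    simp only [hδ]
    split_ifs with hn <;> simp
  -- the tail `T = S - ∑_{n<N+1} δ = ∑' δ(n + N + 1) ∈ [0, 2K/(N+1)]`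
  have htail_eq : S - ∑ n ∈ range (N + 1), δ n = ∑' n, δ (n + (N + 1)) := by
    rw [hS, ← hδs.sum_add_tsum_nat_add (N + 1)]; ring
  have htail0 : 0 ≤ ∑' n, δ (n + (N + 1)) := tsum_nonneg fun n => hδ0 _
  have htail : ∑' n, δ (n + (N + 1)) ≤ 2 * K / ((N : ℝ) + 1) := by
    refine Real.tsum_le_of_sum_range_le (fun n => hδ0 _) fun M => ?_
    calc ∑ i ∈ range M, δ (i + (N + 1)) ≤ ∑ i ∈ range M, K * (((i + (N + 1) : ℕ) : ℝ) ^ 2)⁻¹ :=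
          sum_le_sum fun i _ => hδle _
      _ = ∑ j ∈ Ico (N + 1) (N + 1 + M), K * ((j : ℝ) ^ 2)⁻¹ := by
          rw [sum_Ico_eq_sum_range]
          simp only [show N + 1 + M - (N + 1) = M by omega]
          refine sum_congr rfl fun i _ => ?_
          rw [add_comm]
      _ ≤ ∑ j ∈ Ioo N (N + 1 + M), K * ((j : ℝ) ^ 2)⁻¹ := by
          refine sum_le_sum_of_subset_of_nonneg (fun j hj => ?_) fun j _ _ => by positivity
          rw [mem_Ico] at hj; rw [mem_Ioo]; omega
      _ = K * ∑ j ∈ Ioo N (N + 1 + M), ((j : ℝ) ^ 2)⁻¹ := by rw [mul_sum]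
      _ ≤ K * (2 / ((N : ℝ) + 1)) := mul_le_mul_of_nonneg_left (sum_Ioo_inv_sq_le _ _) hK0
      _ = 2 * K / ((N : ℝ) + 1) := by ring
  -- `2K/(N+1) ≤ 2K/y ≤ 2K 10^10/(log y)^10`
  have hfrac : 2 * K / ((N : ℝ) + 1) ≤ 2 * K * 10 ^ 10 / Real.log y ^ 10 := by
    have h1 : 2 * K / ((N : ℝ) + 1) ≤ 2 * K / y :=
      div_le_div_of_nonneg_left (by positivity) (by linarith) hNy.le
    have h2 : 2 * K / y ≤ 2 * K * 10 ^ 10 / Real.log y ^ 10 := by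
      rw [div_le_div_iff₀ (by linarith) (by positivity)]
      have := FriedlanderIwaniecPrimesSquarefree.log_pow_ten_le hy1
      nlinarith
    linarith
  have hmain := h19 y hy
  rw [hsplit]
  have : (∑ p ∈ Nat.primesLE N, g p - ∑ n ∈ range (N + 1), δ n) - (Real.log (Real.log y) + (c - S)) =
      ((∑ p ∈ Nat.primesLE N, g p) - (Real.log (Real.log y) + c)) + (S - ∑ n ∈ range (N + 1), δ n) := by
    ring
  rw [this, htail_eq]
  calc |(∑ p ∈ Nat.primesLE N, g p - (Real.log (Real.log y) + c)) + ∑' n, δ (n + (N + 1))|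
      ≤ |∑ p ∈ Nat.primesLE N, g p - (Real.log (Real.log y) + c)| + |∑' n, δ (n + (N + 1))| :=
        abs_add_le _ _
    _ ≤ K₉ / Real.log y ^ 10 + 2 * K * 10 ^ 10 / Real.log y ^ 10 := by
        rw [abs_of_nonneg htail0]
        exact add_le_add hmain (htail.trans hfrac)
    _ = (K₉ + 2 * K * 10 ^ 10) / Real.log y ^ 10 := by ring

end SqfreeDensity

/-! ### The remainders `r̃_d(t)` of the squarefree-sieved sequence: decomposition and the term `E₀` -/

section Remainder

variable (A : SieveSequence) {g' : ArithmeticFunction ℝ}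

/-- **`r̃_d(t)` decomposed** (p. 1061: "`Ã_d(x) = ∑_ν μ(ν)A_{[ν²,d]}(x) = g̃(d)GA(x) + ∑_ν μ(ν) r_{[ν²,d]}(x)`",
here in finite form): for squarefree `d`, `V ≥ ⌊t⌋` and any `c` (later `c = g̃(d)`),
`Ã_d(t) - c Ã(t) = (M_d(V) - c M₁(V)) A(t) + (R_d(t) - c R₁(t))` with
`M_d(V) = ∑_{ν≤V}^♭ μ(ν) g([ν²,d])`, `R_d(t) = ∑_{ν≤V}^♭ μ(ν) r_{[ν²,d]}(t)`.
[cite: FriedlanderIwaniecASP1998, §9 p. 1061] -/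
theorem sqfree_congrSum_sub_eq (d : ℕ) (t : ℝ) {V : ℕ} (hV : ⌊t⌋₊ ≤ V) (c : ℝ) :
    (∑ n ∈ (Ioc 0 ⌊t⌋₊).filter (d ∣ ·), (if Squarefree n then A.a n else 0)) -
        c * ∑ n ∈ (Ioc 0 ⌊t⌋₊).filter (1 ∣ ·), (if Squarefree n then A.a n else 0) =
      ((∑ ν ∈ (Icc 1 V).filter Squarefree, (μ ν : ℝ) * A.density (Nat.lcm (ν ^ 2) d)) -
          c * ∑ ν ∈ (Icc 1 V).filter Squarefree, (μ ν : ℝ) * A.density (ν ^ 2)) * A.size t +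
        ((∑ ν ∈ (Icc 1 V).filter Squarefree, (μ ν : ℝ) * A.remainder (Nat.lcm (ν ^ 2) d) t) -
          c * ∑ ν ∈ (Icc 1 V).filter Squarefree, (μ ν : ℝ) * A.remainder (ν ^ 2) t) := by
  rw [sqfree_congrSum_eq_sum_moebius A d t hV, sqfree_congrSum_eq_sum_moebius A 1 t hV]
  simp only [Nat.lcm_one_right, congrSum_eq_density_mul_size_add_remainder, mul_add, sum_add_distrib]
  have h1 : ∑ ν ∈ (Icc 1 V).filter Squarefree, (μ ν : ℝ) * (A.density (Nat.lcm (ν ^ 2) d) * A.size t) =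
      (∑ ν ∈ (Icc 1 V).filter Squarefree, (μ ν : ℝ) * A.density (Nat.lcm (ν ^ 2) d)) * A.size t := by
    rw [sum_mul]; exact sum_congr rfl fun ν _ => by ring
  have h2 : ∑ ν ∈ (Icc 1 V).filter Squarefree, (μ ν : ℝ) * (A.density (ν ^ 2) * A.size t) =
      (∑ ν ∈ (Icc 1 V).filter Squarefree, (μ ν : ℝ) * A.density (ν ^ 2)) * A.size t := by
    rw [sum_mul]; exact sum_congr rfl fun ν _ => by ring
  rw [h1, h2]
  ring

/-- **The main terms cancel up to truncation (term `E₀`)**: for the density `g̃` of (9.5)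
(multiplicative, vanishing at higher prime powers is not needed here) and squarefree `d ≤ D₀`,
`∑_{d ≤ D₀}^♭ |M_d(V) - g̃(d) M₁(V)| ≤ (V/D₀ + 1)^{-7/8} e^{KZ} ∑_{d ≤ D₀}^♭ (τ(d) + e^{K}) g(d)`.
[cite: FriedlanderIwaniecASP1998, §9 (9.9)] -/
theorem sum_abs_mainTerm_sub_le (hg'm : g'.IsMultiplicative)
    (h24 : ∀ p : ℕ, p.Prime → 0 ≤ A.density (p ^ 2) ∧ A.density (p ^ 2) ≤ A.density p ∧ A.density p < 1)
    {K : ℝ} (hK : ∀ p : ℕ, p.Prime → A.density p ≤ K / p ∧ A.density (p ^ 2) ≤ K / (p : ℝ) ^ 2)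
    (hg' : ∀ p : ℕ, p.Prime → g' p = (A.density p - A.density (p ^ 2)) / (1 - A.density (p ^ 2)))
    (D₀ V : ℕ) :
    ∑ d ∈ (Icc 1 D₀).filter Squarefree,
        |(∑ ν ∈ (Icc 1 V).filter Squarefree, (μ ν : ℝ) * A.density (Nat.lcm (ν ^ 2) d)) -
          g' d * ∑ ν ∈ (Icc 1 V).filter Squarefree, (μ ν : ℝ) * A.density (ν ^ 2)| ≤
      ((((V / D₀ : ℕ) : ℝ) + 1) ^ (-(7 / 8 : ℝ)) *
          Real.exp (K * ∑' n : ℕ, (n : ℝ) ^ (-(9 / 8 : ℝ)))) *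
        ∑ d ∈ (Icc 1 D₀).filter Squarefree, ((#d.divisors : ℝ) + Real.exp K) * A.density d := by
  set g := A.density with hgdef
  have hg : g.IsMultiplicative := A.density_mult
  have hK0 := densityConst_nonneg h24 hK
  set Z := ∑' n : ℕ, (n : ℝ) ^ (-(9 / 8 : ℝ)) with hZ
  rw [mul_sum]
  refine sum_le_sum fun d hd => ?_
  obtain ⟨hd1, hdsq⟩ := mem_filter.mp hd
  obtain ⟨hd1', hdD⟩ := mem_Icc.mp hd1
  -- the hypothesis `c ∑ μ(e) g(e²) = ∑ μ(e) g(e d)` for `c = g̃(d)`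
  have hc : g' d * ∑ e ∈ d.divisors, (μ e : ℝ) * g (e ^ 2) = ∑ e ∈ d.divisors, (μ e : ℝ) * g (e * d) := by
    rw [sum_divisors_moebius_mul_apply_sq hg hdsq, sum_divisors_moebius_mul_apply_mul hg hdsq,
      ← hg'm.prod_primeFactors hdsq, ← prod_mul_distrib]
    refine prod_congr rfl fun p hp => ?_
    have hp' := Nat.prime_of_mem_primeFactors hp
    have hden : 1 - g (p ^ 2) ≠ 0 := by
      have := h24 p hp'; simp only [hgdef] at this ⊢; linarith [this.2.1, this.2.2]
    rw [hg' p hp']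
    field_simp
  have hmain := abs_sum_lcm_sub_mul_sum_sq_le hg (fun ν hν => apply_sq_nonneg_of_squarefree hg h24 hν)
    (fun e he => density_squarefree_nonneg hg h24 he) hdsq V hc
  refine hmain.trans ?_
  -- the tail `T_d ≤ (V/d + 1)^{-7/8} e^{KZ} ≤ (V/D₀ + 1)^{-7/8} e^{KZ}`
  have htail := tail_sum_sqfree_density_sq_le hg h24 hK 0 (V / d) V
  simp only [pow_zero, one_mul] at htail
  have hmono : (((V / d : ℕ) : ℝ) + 1) ^ (-(7 / 8 : ℝ)) ≤ (((V / D₀ : ℕ) : ℝ) + 1) ^ (-(7 / 8 : ℝ)) := by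
    refine Real.rpow_le_rpow_of_nonpos (by positivity) ?_ (by norm_num)
    have : V / D₀ ≤ V / d := Nat.div_le_div_left hdD hd1'
    exact_mod_cast Nat.add_le_add_right this 1
  have hT : ∑ ν ∈ (Ioc (V / d) V).filter Squarefree, g (ν ^ 2) ≤
      (((V / D₀ : ℕ) : ℝ) + 1) ^ (-(7 / 8 : ℝ)) * Real.exp (K * Z) :=
    htail.trans (mul_le_mul_of_nonneg_right hmono (Real.exp_pos _).le)
  have hT0 : 0 ≤ ∑ ν ∈ (Ioc (V / d) V).filter Squarefree, g (ν ^ 2) :=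
    sum_nonneg fun ν hν => apply_sq_nonneg_of_squarefree hg h24 (mem_filter.mp hν).2
  -- the bracket `∑ g(e²)g(d/e) + |g̃(d)| ∑ g(e²) ≤ (τ(d) + e^K) g(d)`
  have hgd0 : 0 ≤ g d := density_squarefree_nonneg hg h24 hdsq
  have hg'd := sqfreeDensity_squarefree_le hg hg'm h24 hg' hdsq
  have hb1 : ∑ e ∈ d.divisors, g (e ^ 2) * g (d / e) ≤ (#d.divisors : ℝ) * g d := by
    calc ∑ e ∈ d.divisors, g (e ^ 2) * g (d / e) ≤ ∑ e ∈ d.divisors, g d := by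
          refine sum_le_sum fun e he => ?_
          have hed : e ∣ d := Nat.dvd_of_mem_divisors he
          have hesq : Squarefree e := hdsq.squarefree_of_dvd hed
          have hdesq : Squarefree (d / e) := hdsq.squarefree_of_dvd (Nat.div_dvd_of_dvd hed)
          have hcop : e.Coprime (d / e) := by
            have hsq : Squarefree (e * (d / e)) := by rwa [Nat.mul_div_cancel' hed]
            exact (Nat.squarefree_mul_iff.mp hsq).1
          calc g (e ^ 2) * g (d / e) ≤ g e * g (d / e) :=
                mul_le_mul_of_nonneg_right (density_sq_le_of_squarefree hg h24 hesq)
                  (density_squarefree_nonneg hg h24 hdesq)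
            _ = g d := by rw [← hg.map_mul_of_coprime hcop, Nat.mul_div_cancel' hed]
      _ = (#d.divisors : ℝ) * g d := by rw [sum_const, nsmul_eq_mul]
  have hb2 : |g' d| * ∑ e ∈ d.divisors, g (e ^ 2) ≤ Real.exp K * g d := by
    rw [abs_of_nonneg hg'd.1, mul_comm]
    exact mul_le_mul (sum_divisors_density_sq_le hg h24 hK hdsq) hg'd.2 hg'd.1 (Real.exp_pos _).le
  calc (∑ ν ∈ (Ioc (V / d) V).filter Squarefree, g (ν ^ 2)) *
        (∑ e ∈ d.divisors, g (e ^ 2) * g (d / e) + |g' d| * ∑ e ∈ d.divisors, g (e ^ 2))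
      ≤ ((((V / D₀ : ℕ) : ℝ) + 1) ^ (-(7 / 8 : ℝ)) * Real.exp (K * Z)) *
          ((#d.divisors : ℝ) * g d + Real.exp K * g d) := by
        refine mul_le_mul hT (add_le_add hb1 hb2) ?_ (by positivity)
        refine add_nonneg (sum_nonneg fun e he => ?_) (mul_nonneg (abs_nonneg _)
          (sum_nonneg fun e he => ?_))
        · have hed : e ∣ d := Nat.dvd_of_mem_divisors he
          exact mul_nonneg (apply_sq_nonneg_of_squarefree hg h24 (hdsq.squarefree_of_dvd hed))
            (density_squarefree_nonneg hg h24 (hdsq.squarefree_of_dvd (Nat.div_dvd_of_dvd hed)))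
        · exact apply_sq_nonneg_of_squarefree hg h24
            (hdsq.squarefree_of_dvd (Nat.dvd_of_mem_divisors he))
    _ = _ := by ring

/-- **`E₁` (the terms `ν ≤ L`) by (R′₃)**: collecting by `k = [ν², d]` (multiplicity `≤ τ(k)`),
Cauchy, `|r_k| ≤ A_k + g(k)A` and the divisor cube moment:
`∑_{d≤D₀}^♭ ∑_{ν≤L}^♭ |r_{[ν²,d]}(t)| ≤ (∑_{n≤t} a_n τ(n)³ + A(t) ∑_{k}^{cf} τ(k)² g(k))^{1/2} (∑_k^{cf} |r_k(t)|)^{1/2}`,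
the sums over cubefree `k ≤ L² D₀`. [cite: FriedlanderIwaniecASP1998, §9 (9.11) with (R′₃), p. 1060] -/
theorem sum_sum_abs_remainder_small_le
    (h24 : ∀ p : ℕ, p.Prime → 0 ≤ A.density (p ^ 2) ∧ A.density (p ^ 2) ≤ A.density p ∧ A.density p < 1)
    {t : ℝ} (hA : 0 ≤ A.size t) (D₀ L : ℕ) :
    ∑ d ∈ (Icc 1 D₀).filter Squarefree, ∑ ν ∈ (Icc 1 L).filter Squarefree,
        |A.remainder (Nat.lcm (ν ^ 2) d) t| ≤
      Real.sqrt ((∑ n ∈ Ioc 0 ⌊t⌋₊, A.a n * (#n.divisors : ℝ) ^ 3) +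
          A.size t * ∑ k ∈ (Icc 1 (L ^ 2 * D₀)).filter IsCubefree,
            (#k.divisors : ℝ) ^ 2 * A.density k) *
        Real.sqrt (∑ k ∈ (Icc 1 (L ^ 2 * D₀)).filter IsCubefree, |A.remainder k t|) := by
  have hg : A.density.IsMultiplicative := A.density_mult
  set CF := (Icc 1 (L ^ 2 * D₀)).filter IsCubefree with hCF
  refine (sum_sum_abs_remainder_lcm_le A D₀ L t).trans ?_
  refine (sum_mul_le_sqrt_mul_sqrt CF (fun k => (#k.divisors : ℝ)) (fun k => |A.remainder k t|)
    fun k _ => abs_nonneg _).trans ?_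
  refine mul_le_mul_of_nonneg_right (Real.sqrt_le_sqrt ?_) (Real.sqrt_nonneg _)
  have hgk : ∀ k ∈ CF, 0 ≤ A.density k := fun k hk =>
    density_nonneg_of_isCubefree hg h24 (mem_filter.mp hk).2
  calc ∑ k ∈ CF, (#k.divisors : ℝ) ^ 2 * |A.remainder k t|
      ≤ ∑ k ∈ CF, (#k.divisors : ℝ) ^ 2 * (A.congrSum k t + A.density k * A.size t) :=
        sum_le_sum fun k hk => mul_le_mul_of_nonneg_left (abs_remainder_le A k t (hgk k hk) hA)
          (by positivity)
    _ = ∑ k ∈ CF, (#k.divisors : ℝ) ^ 2 * A.congrSum k t +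
          A.size t * ∑ k ∈ CF, (#k.divisors : ℝ) ^ 2 * A.density k := by
        rw [mul_sum, ← sum_add_distrib]
        exact sum_congr rfl fun k _ => by ring
    _ ≤ _ := add_le_add (sum_card_divisors_sq_mul_congrSum_le A CF t) le_rfl

/-- Splitting the count of large square divisors at `Y`: for `L ≤ Y ≤ V`,
`#{L < ν ≤ V : ν sqfree, ν² ∣ n} = #{L < ν ≤ Y : …} + #{Y < ν ≤ V : …}`. [folklore] -/
theorem card_filter_Ioc_sq_dvd_split {L Y V : ℕ} (hLY : L ≤ Y) (hYV : Y ≤ V) (n : ℕ) :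
    #(((Ioc L V).filter Squarefree).filter (fun ν => ν ^ 2 ∣ n)) =
      #(((Ioc L Y).filter Squarefree).filter (fun ν => ν ^ 2 ∣ n)) +
        #(((Ioc Y V).filter Squarefree).filter (fun ν => ν ^ 2 ∣ n)) := by
  rw [← Ioc_union_Ioc_eq_Ioc hLY hYV, filter_union, filter_union, card_union_of_disjoint]
  exact disjoint_filter_filter (disjoint_filter_filter (Ioc_disjoint_Ioc_of_le le_rfl))

/-- **`E₂`, the `A`-part, swapped and split at `Y`**: for `L ≤ Y ≤ V`,
`∑_{d≤D₀}^♭ ∑_{L<ν≤V}^♭ A_{[ν²,d]}(t) ≤ ∑_{n≤t} a_n τ(n) ν_mid(n) + ∑_{n≤t} a_n τ(n) ν_big(n)` with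
`ν_mid(n) = #{L < ν ≤ Y}^♭_{ν²∣n}`, `ν_big(n) = #{Y < ν ≤ V}^♭_{ν²∣n}`.
[cite: FriedlanderIwaniecASP1998, §9 p. 1062 (E₂ = E₂₁ + E₂₂)] -/
theorem sum_sum_congrSum_large_le (t : ℝ) (D₀ : ℕ) {L Y V : ℕ} (hLY : L ≤ Y) (hYV : Y ≤ V) :
    ∑ d ∈ (Icc 1 D₀).filter Squarefree, ∑ ν ∈ (Ioc L V).filter Squarefree,
        A.congrSum (Nat.lcm (ν ^ 2) d) t ≤
      (∑ n ∈ Ioc 0 ⌊t⌋₊, A.a n * (#n.divisors : ℝ) *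
          #(((Ioc L Y).filter Squarefree).filter (fun ν => ν ^ 2 ∣ n))) +
        ∑ n ∈ Ioc 0 ⌊t⌋₊, A.a n * (#n.divisors : ℝ) *
          #(((Ioc Y V).filter Squarefree).filter (fun ν => ν ^ 2 ∣ n)) := by
  refine (sum_sum_congrSum_lcm_le A _ _ t).trans (le_of_eq ?_)
  rw [← sum_add_distrib]
  refine sum_congr rfl fun n _ => ?_
  rw [card_filter_Ioc_sq_dvd_split hLY hYV n]
  push_cast
  ring

/-- **Cauchy for the middle range (`E₂₂ ≤ (S₁S₂)^{1/2}`)**: for any finite set `𝒩` of `ν ≥ 1`,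
`∑_{n≤t} a_n τ(n) ν_𝒩(n) ≤ (∑_{n≤t} a_n τ(n)³)^{1/2} (∑_{ν ∈ 𝒩} A_{ν²}(t))^{1/2}`
(`ν_𝒩(n) = #{ν ∈ 𝒩 : ν² ∣ n} ≤ τ(n)` and `∑_n a_n ν_𝒩(n) = ∑_ν A_{ν²}(t)`).
[cite: FriedlanderIwaniecASP1998, §9 p. 1062 (E₂₂)] -/
theorem sum_a_card_divisors_mul_count_le_sqrt (t : ℝ) (𝒩 : Finset ℕ) :
    ∑ n ∈ Ioc 0 ⌊t⌋₊, A.a n * (#n.divisors : ℝ) * #(𝒩.filter (fun ν => ν ^ 2 ∣ n)) ≤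
      Real.sqrt (∑ n ∈ Ioc 0 ⌊t⌋₊, A.a n * (#n.divisors : ℝ) ^ 3) *
        Real.sqrt (∑ ν ∈ 𝒩, A.congrSum (ν ^ 2) t) := by
  have h := sum_mul_le_sqrt_mul_sqrt (Ioc 0 ⌊t⌋₊) (fun n => (#n.divisors : ℝ))
    (fun n => A.a n * #(𝒩.filter (fun ν => ν ^ 2 ∣ n))) fun n _ =>
      mul_nonneg (A.a_nonneg n) (Nat.cast_nonneg _)
  have hre : ∑ n ∈ Ioc 0 ⌊t⌋₊, A.a n * (#n.divisors : ℝ) * #(𝒩.filter (fun ν => ν ^ 2 ∣ n)) =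
      ∑ n ∈ Ioc 0 ⌊t⌋₊, (#n.divisors : ℝ) * (A.a n * #(𝒩.filter (fun ν => ν ^ 2 ∣ n))) :=
    sum_congr rfl fun n _ => by ring
  rw [hre]
  refine h.trans (mul_le_mul (Real.sqrt_le_sqrt ?_) (le_of_eq ?_) (Real.sqrt_nonneg _)
    (Real.sqrt_nonneg _))
  · refine sum_le_sum fun n hn => ?_
    have hn0 : n ≠ 0 := by have := (mem_Ioc.mp hn).1; omega
    have hν : (#(𝒩.filter (fun ν => ν ^ 2 ∣ n)) : ℝ) ≤ #n.divisors := by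
      exact_mod_cast card_filter_sq_dvd_le 𝒩 hn0
    have ha := A.a_nonneg n
    calc (#n.divisors : ℝ) ^ 2 * (A.a n * #(𝒩.filter (fun ν => ν ^ 2 ∣ n)))
        ≤ (#n.divisors : ℝ) ^ 2 * (A.a n * #n.divisors) := by gcongr
      _ = A.a n * (#n.divisors : ℝ) ^ 3 := by ring
  · rw [sum_congrSum_sq_eq]

/-- `∑_{ν ∈ 𝒩} A_{ν²}(t) ≤ A(t) ∑_{ν ∈ 𝒩} g(ν²) + ∑_{ν ∈ 𝒩} |r_{ν²}(t)|` (the sum `S₁`).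
[cite: FriedlanderIwaniecASP1998, §9 p. 1062 (S₁)] -/
theorem sum_congrSum_sq_le (t : ℝ) (𝒩 : Finset ℕ) :
    ∑ ν ∈ 𝒩, A.congrSum (ν ^ 2) t ≤
      A.size t * ∑ ν ∈ 𝒩, A.density (ν ^ 2) + ∑ ν ∈ 𝒩, |A.remainder (ν ^ 2) t| := by
  rw [mul_sum, ← sum_add_distrib]
  refine sum_le_sum fun ν _ => ?_
  rw [congrSum_eq_density_mul_size_add_remainder]
  linarith [le_abs_self (A.remainder (ν ^ 2) t)]

/-- The remainders at the squares `ν²`, `ν ≤ Y` squarefree, are among the cubefree remainders of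
level `Y²`: `∑_{ν ≤ Y}^♭ |r_{ν²}(t)| ≤ ∑_{k ≤ Y², k cubefree} |r_k(t)|`.
[cite: FriedlanderIwaniecASP1998, §9 p. 1062 (S₁, by (R₃))] -/
theorem sum_abs_remainder_sq_le {𝒩 : Finset ℕ} {Y : ℕ} (h𝒩 : ∀ ν ∈ 𝒩, Squarefree ν ∧ 1 ≤ ν ∧ ν ≤ Y)
    (t : ℝ) :
    ∑ ν ∈ 𝒩, |A.remainder (ν ^ 2) t| ≤
      ∑ k ∈ (Icc 1 (Y ^ 2)).filter IsCubefree, |A.remainder k t| := by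
  classical
  refine sum_comp_le_of_injOn 𝒩 _ (fun ν => ν ^ 2) (fun k => |A.remainder k t|)
    (fun ν _ ν' _ h => Nat.pow_left_injective two_ne_zero h) (fun ν hν => ?_) fun k _ => abs_nonneg _
  obtain ⟨hsq, h1, hY⟩ := h𝒩 ν hν
  exact mem_filter.mpr ⟨mem_Icc.mpr ⟨Nat.one_le_pow _ _ h1, Nat.pow_le_pow_left hY 2⟩,
    isCubefree_sq hsq⟩

/-- Swapping a weighted count: `∑_{n ∈ S} f(n) #{ν ∈ 𝒩 : ν² ∣ n} = ∑_{ν ∈ 𝒩} ∑_{n ∈ S, ν² ∣ n} f(n)`.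
[folklore] -/
theorem sum_mul_card_filter_sq_dvd_eq (S 𝒩 : Finset ℕ) (f : ℕ → ℝ) :
    ∑ n ∈ S, f n * #(𝒩.filter (fun ν => ν ^ 2 ∣ n)) =
      ∑ ν ∈ 𝒩, ∑ n ∈ S.filter (fun n => ν ^ 2 ∣ n), f n := by
  classical
  simp_rw [card_filter, Nat.cast_sum, mul_sum, sum_filter]
  rw [sum_comm]
  refine sum_congr rfl fun ν _ => sum_congr rfl fun n _ => ?_
  split_ifs <;> simp

/-- **Cauchy for the large squares (`E₂₁`, by (9.2))**: for a finite set `𝒩` of `ν ≥ 1`,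
`∑_{n≤T} a_n τ(n) ν_𝒩(n) ≤ (∑_{n≤T} a_n²)^{1/2} (∑_{ν ∈ 𝒩} τ(ν)⁶ ∑_{m ≤ T/ν²} τ(m)³)^{1/2}`
(`ν_𝒩(n)² ≤ τ(n) ν_𝒩(n)`, swap, `n = ν² m`). [cite: FriedlanderIwaniecASP1998, §9 p. 1062 (E₂₁)] -/
theorem sum_a_card_divisors_mul_count_le_sqrt_sq (T : ℕ) {𝒩 : Finset ℕ} (h𝒩 : ∀ ν ∈ 𝒩, ν ≠ 0) :
    ∑ n ∈ Ioc 0 T, A.a n * (#n.divisors : ℝ) * #(𝒩.filter (fun ν => ν ^ 2 ∣ n)) ≤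
      Real.sqrt (∑ n ∈ Ioc 0 T, A.a n ^ 2) *
        Real.sqrt (∑ ν ∈ 𝒩, (#ν.divisors : ℝ) ^ 6 *
          ∑ m ∈ Icc 1 (T / ν ^ 2), (#m.divisors : ℝ) ^ 3) := by
  have hcs := sum_mul_sq_le_sq_mul_sq (Ioc 0 T) (fun n => A.a n)
    (fun n => (#n.divisors : ℝ) * #(𝒩.filter (fun ν => ν ^ 2 ∣ n)))
  have hre : ∑ n ∈ Ioc 0 T, A.a n * (#n.divisors : ℝ) * #(𝒩.filter (fun ν => ν ^ 2 ∣ n)) =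
      ∑ n ∈ Ioc 0 T, A.a n * ((#n.divisors : ℝ) * #(𝒩.filter (fun ν => ν ^ 2 ∣ n))) :=
    sum_congr rfl fun n _ => by ring
  rw [hre]
  have hB0 : 0 ≤ ∑ n ∈ Ioc 0 T, A.a n ^ 2 := sum_nonneg fun n _ => sq_nonneg _
  -- `∑ τ² ν² ≤ ∑ τ³ ν = ∑_ν ∑_{ν²∣n} τ³ ≤ ∑_ν τ(ν)⁶ ∑_{m≤T/ν²} τ(m)³`
  have hsecond : ∑ n ∈ Ioc 0 T, ((#n.divisors : ℝ) * #(𝒩.filter (fun ν => ν ^ 2 ∣ n))) ^ 2 ≤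
      ∑ ν ∈ 𝒩, (#ν.divisors : ℝ) ^ 6 * ∑ m ∈ Icc 1 (T / ν ^ 2), (#m.divisors : ℝ) ^ 3 := by
    calc ∑ n ∈ Ioc 0 T, ((#n.divisors : ℝ) * #(𝒩.filter (fun ν => ν ^ 2 ∣ n))) ^ 2
        ≤ ∑ n ∈ Ioc 0 T, (#n.divisors : ℝ) ^ 3 * #(𝒩.filter (fun ν => ν ^ 2 ∣ n)) := by
          refine sum_le_sum fun n hn => ?_
          have hn0 : n ≠ 0 := by have := (mem_Ioc.mp hn).1; omega
          have hν : (#(𝒩.filter (fun ν => ν ^ 2 ∣ n)) : ℝ) ≤ #n.divisors := by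
            exact_mod_cast card_filter_sq_dvd_le 𝒩 hn0
          have hν0 : (0 : ℝ) ≤ #(𝒩.filter (fun ν => ν ^ 2 ∣ n)) := Nat.cast_nonneg _
          calc ((#n.divisors : ℝ) * #(𝒩.filter (fun ν => ν ^ 2 ∣ n))) ^ 2
              = (#n.divisors : ℝ) ^ 2 * #(𝒩.filter (fun ν => ν ^ 2 ∣ n)) *
                  #(𝒩.filter (fun ν => ν ^ 2 ∣ n)) := by ring
            _ ≤ (#n.divisors : ℝ) ^ 2 * #(𝒩.filter (fun ν => ν ^ 2 ∣ n)) * #n.divisors :=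
                mul_le_mul_of_nonneg_left hν (by positivity)
            _ = (#n.divisors : ℝ) ^ 3 * #(𝒩.filter (fun ν => ν ^ 2 ∣ n)) := by ring
      _ = ∑ ν ∈ 𝒩, ∑ n ∈ (Ioc 0 T).filter (fun n => ν ^ 2 ∣ n), (#n.divisors : ℝ) ^ 3 :=
          sum_mul_card_filter_sq_dvd_eq _ _ _
      _ ≤ ∑ ν ∈ 𝒩, (#ν.divisors : ℝ) ^ 6 * ∑ m ∈ Icc 1 (T / ν ^ 2), (#m.divisors : ℝ) ^ 3 := by
          refine sum_le_sum fun ν hν => ?_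
          have h := sum_filter_sq_dvd_card_divisors_cube_le (h𝒩 ν hν) T
          have hset : Icc 1 T = Ioc 0 T := by
            ext n; simp only [mem_Icc, mem_Ioc]; omega
          rwa [hset] at h
  have hS0 : 0 ≤ ∑ ν ∈ 𝒩, (#ν.divisors : ℝ) ^ 6 * ∑ m ∈ Icc 1 (T / ν ^ 2), (#m.divisors : ℝ) ^ 3 :=
    sum_nonneg fun ν _ => mul_nonneg (by positivity) (sum_nonneg fun m _ => by positivity)
  calc ∑ n ∈ Ioc 0 T, A.a n * ((#n.divisors : ℝ) * #(𝒩.filter (fun ν => ν ^ 2 ∣ n)))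
      ≤ |∑ n ∈ Ioc 0 T, A.a n * ((#n.divisors : ℝ) * #(𝒩.filter (fun ν => ν ^ 2 ∣ n)))| :=
        le_abs_self _
    _ = Real.sqrt ((∑ n ∈ Ioc 0 T, A.a n * ((#n.divisors : ℝ) * #(𝒩.filter (fun ν => ν ^ 2 ∣ n)))) ^ 2) :=
        (Real.sqrt_sq_eq_abs _).symm
    _ ≤ Real.sqrt ((∑ n ∈ Ioc 0 T, A.a n ^ 2) *
          ∑ n ∈ Ioc 0 T, ((#n.divisors : ℝ) * #(𝒩.filter (fun ν => ν ^ 2 ∣ n))) ^ 2) :=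
        Real.sqrt_le_sqrt hcs
    _ ≤ Real.sqrt ((∑ n ∈ Ioc 0 T, A.a n ^ 2) *
          ∑ ν ∈ 𝒩, (#ν.divisors : ℝ) ^ 6 * ∑ m ∈ Icc 1 (T / ν ^ 2), (#m.divisors : ℝ) ^ 3) :=
        Real.sqrt_le_sqrt (mul_le_mul_of_nonneg_left hsecond hB0)
    _ = _ := Real.sqrt_mul hB0 _

/-- **`E₂`, the `g`-part**: `∑_{d≤D₀}^♭ ∑_{L<ν≤V}^♭ g([ν²,d]) ≤ (L+1)^{-7/8} e^{2KZ} V_g(D₀)`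
(`g([ν²,d]) = g(ν²) g(d/(ν,d))`, `∑_d g(d/(ν,d)) ≤ τ(ν) V_g(D₀)`, then the `τ`-weighted tail).
[cite: FriedlanderIwaniecASP1998, §9 p. 1062 (second term of E₂)] -/
theorem sum_sum_density_lcm_large_le
    (h24 : ∀ p : ℕ, p.Prime → 0 ≤ A.density (p ^ 2) ∧ A.density (p ^ 2) ≤ A.density p ∧ A.density p < 1)
    {K : ℝ} (hK : ∀ p : ℕ, p.Prime → A.density p ≤ K / p ∧ A.density (p ^ 2) ≤ K / (p : ℝ) ^ 2)
    (D₀ L V : ℕ) :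
    ∑ d ∈ (Icc 1 D₀).filter Squarefree, ∑ ν ∈ (Ioc L V).filter Squarefree,
        A.density (Nat.lcm (ν ^ 2) d) ≤
      ((L : ℝ) + 1) ^ (-(7 / 8 : ℝ)) * Real.exp (2 ^ 1 * K * ∑' n : ℕ, (n : ℝ) ^ (-(9 / 8 : ℝ))) *
        ∑ e ∈ (Icc 1 D₀).filter Squarefree, A.density e := by
  have hg : A.density.IsMultiplicative := A.density_mult
  set Vg := ∑ e ∈ (Icc 1 D₀).filter Squarefree, A.density e with hVg
  have hVg0 : 0 ≤ Vg := sum_nonneg fun e he => density_squarefree_nonneg hg h24 (mem_filter.mp he).2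
  rw [sum_comm]
  calc ∑ ν ∈ (Ioc L V).filter Squarefree, ∑ d ∈ (Icc 1 D₀).filter Squarefree,
        A.density (Nat.lcm (ν ^ 2) d)
      = ∑ ν ∈ (Ioc L V).filter Squarefree, A.density (ν ^ 2) *
          ∑ d ∈ (Icc 1 D₀).filter Squarefree, A.density (d / Nat.gcd ν d) := by
        refine sum_congr rfl fun ν _ => ?_
        rw [mul_sum]
        exact sum_congr rfl fun d hd => map_lcm_sq_of_squarefree hg (mem_filter.mp hd).2 ν
    _ ≤ ∑ ν ∈ (Ioc L V).filter Squarefree, A.density (ν ^ 2) * (#ν.divisors * Vg) := by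
        refine sum_le_sum fun ν hν => ?_
        obtain ⟨hν1, hνsq⟩ := mem_filter.mp hν
        have hν0 : ν ≠ 0 := by have := (mem_Ioc.mp hν1).1; omega
        exact mul_le_mul_of_nonneg_left
          (sum_sqfree_density_div_gcd_le (fun e he => density_squarefree_nonneg hg h24 he) hν0 D₀)
          (apply_sq_nonneg_of_squarefree hg h24 hνsq)
    _ = (∑ ν ∈ (Ioc L V).filter Squarefree, (#ν.divisors : ℝ) ^ 1 * A.density (ν ^ 2)) * Vg := by
        rw [sum_mul]; exact sum_congr rfl fun ν _ => by ring
    _ ≤ _ := mul_le_mul_of_nonneg_right (tail_sum_sqfree_density_sq_le hg h24 hK 1 L V) hVg0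

/-- `|R_d(t)| ≤ ∑_{ν ≤ L}^♭ |r_{[ν²,d]}(t)| + ∑_{L<ν≤V}^♭ (A_{[ν²,d]}(t) + g([ν²,d]) A(t))` for
`L ≤ V`: the Möbius sum of remainders split at `L`, with `|r| ≤ A_m + g A` beyond.
[cite: FriedlanderIwaniecASP1998, §9 p. 1061 (E = E₁ + E₂)] -/
theorem abs_sum_moebius_remainder_lcm_le
    (h24 : ∀ p : ℕ, p.Prime → 0 ≤ A.density (p ^ 2) ∧ A.density (p ^ 2) ≤ A.density p ∧ A.density p < 1)
    {d : ℕ} (hd : Squarefree d) {t : ℝ} (hA : 0 ≤ A.size t) {L V : ℕ} (hLV : L ≤ V) :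
    |∑ ν ∈ (Icc 1 V).filter Squarefree, (μ ν : ℝ) * A.remainder (Nat.lcm (ν ^ 2) d) t| ≤
      (∑ ν ∈ (Icc 1 L).filter Squarefree, |A.remainder (Nat.lcm (ν ^ 2) d) t|) +
        ∑ ν ∈ (Ioc L V).filter Squarefree,
          (A.congrSum (Nat.lcm (ν ^ 2) d) t + A.density (Nat.lcm (ν ^ 2) d) * A.size t) := by
  have hg : A.density.IsMultiplicative := A.density_mult
  have hsplit : (Icc 1 V).filter Squarefree = (Icc 1 L).filter Squarefree ∪ (Ioc L V).filter Squarefree := by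
    rw [← filter_union]; congr 1; ext ν; simp only [mem_Icc, mem_union, mem_Ioc]; omega
  have hdisj : Disjoint ((Icc 1 L).filter Squarefree) ((Ioc L V).filter Squarefree) :=
    disjoint_filter_filter (disjoint_left.mpr fun ν h1 h2 => by
      rw [mem_Icc] at h1; rw [mem_Ioc] at h2; omega)
  rw [hsplit, sum_union hdisj]
  refine (abs_add_le _ _).trans (add_le_add ?_ ?_)
  · refine (abs_sum_le_sum_abs _ _).trans (sum_le_sum fun ν _ => ?_)
    rw [abs_mul]
    have hμ : |(μ ν : ℝ)| ≤ 1 := by exact_mod_cast ArithmeticFunction.abs_moebius_le_one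
    calc |(μ ν : ℝ)| * |A.remainder (Nat.lcm (ν ^ 2) d) t| ≤ 1 * |A.remainder (Nat.lcm (ν ^ 2) d) t| :=
          mul_le_mul_of_nonneg_right hμ (abs_nonneg _)
      _ = _ := one_mul _
  · refine (abs_sum_le_sum_abs _ _).trans (sum_le_sum fun ν hν => ?_)
    have hνsq := (mem_filter.mp hν).2
    rw [abs_mul]
    have hμ : |(μ ν : ℝ)| ≤ 1 := by exact_mod_cast ArithmeticFunction.abs_moebius_le_one
    have hgk : 0 ≤ A.density (Nat.lcm (ν ^ 2) d) :=
      density_nonneg_of_isCubefree hg h24 (isCubefree_lcm_sq hνsq hd)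
    calc |(μ ν : ℝ)| * |A.remainder (Nat.lcm (ν ^ 2) d) t| ≤ 1 * |A.remainder (Nat.lcm (ν ^ 2) d) t| :=
          mul_le_mul_of_nonneg_right hμ (abs_nonneg _)
      _ ≤ _ := by rw [one_mul]; exact abs_remainder_le A _ t hgk hA

/-- `|R₁(t)| ≤ ∑_{ν ≤ Y}^♭ |r_{ν²}(t)| + ∑_{Y<ν≤V}^♭ (A_{ν²}(t) + g(ν²) A(t))` (the case `d = 1`, split
at `Y`). [cite: FriedlanderIwaniecASP1998, §9 (9.10)] -/
theorem abs_sum_moebius_remainder_sq_le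
    (h24 : ∀ p : ℕ, p.Prime → 0 ≤ A.density (p ^ 2) ∧ A.density (p ^ 2) ≤ A.density p ∧ A.density p < 1)
    {t : ℝ} (hA : 0 ≤ A.size t) {Y V : ℕ} (hYV : Y ≤ V) :
    |∑ ν ∈ (Icc 1 V).filter Squarefree, (μ ν : ℝ) * A.remainder (ν ^ 2) t| ≤
      (∑ ν ∈ (Icc 1 Y).filter Squarefree, |A.remainder (ν ^ 2) t|) +
        ∑ ν ∈ (Ioc Y V).filter Squarefree, (A.congrSum (ν ^ 2) t + A.density (ν ^ 2) * A.size t) := by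
  have h := abs_sum_moebius_remainder_lcm_le A h24 squarefree_one hA hYV
  simpa only [Nat.lcm_one_right] using h

/-- `A(t)` is monotone and nonnegative when `A.size = A_1`. [folklore] -/
theorem size_mono_of_size_eq (hsize : ∀ x, A.size x = A.congrSum 1 x) {t x : ℝ} (htx : t ≤ x) :
    0 ≤ A.size t ∧ A.size t ≤ A.size x := by
  rw [hsize, hsize, SieveSequence.congrSum, SieveSequence.congrSum]
  refine ⟨sum_nonneg fun n _ => A.a_nonneg n, sum_le_sum_of_subset_of_nonneg ?_ fun n _ _ => A.a_nonneg n⟩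
  exact filter_subset_filter _ (Ioc_subset_Ioc_right (Nat.floor_mono htx))

end Remainder

/-! ### Numerical helpers for the bookkeeping of powers of `log x` -/

section Numeric

/-- `(ℓ^m)^{-s} = (ℓ^k)⁻¹` when `m s = k`. [folklore] -/
theorem pow_rpow_neg_eq {ℓ : ℝ} (hℓ : 0 ≤ ℓ) {m k : ℕ} {s : ℝ} (h : (m : ℝ) * s = k) :
    (ℓ ^ m) ^ (-s) = (ℓ ^ k)⁻¹ := by
  rw [← Real.rpow_natCast ℓ m, ← Real.rpow_mul hℓ, mul_neg, h, Real.rpow_neg hℓ, Real.rpow_natCast]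

/-- Monotonicity in the threshold: `W ≥ ℓ^m > 0` gives `W^{-s} ≤ (ℓ^k)⁻¹` (`m s = k`, `s ≥ 0`).
[folklore] -/
theorem rpow_neg_le_inv_pow {ℓ W : ℝ} (hℓ : 0 < ℓ) {m k : ℕ} {s : ℝ} (hs : 0 ≤ s)
    (h : (m : ℝ) * s = k) (hW : ℓ ^ m ≤ W) : W ^ (-s) ≤ (ℓ ^ k)⁻¹ := by
  rw [← pow_rpow_neg_eq hℓ.le h]
  exact Real.rpow_le_rpow_of_nonpos (pow_pos hℓ m) hW (by linarith)

/-- `A/ℓ^e ≤ A/ℓ^{e₀}` for `e₀ ≤ e`, `ℓ ≥ 1`, `A ≥ 0`. [folklore] -/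
theorem div_pow_le_div_pow_of_le {A ℓ : ℝ} (hA : 0 ≤ A) (hℓ : 1 ≤ ℓ) {e₀ e : ℕ} (he : e₀ ≤ e) :
    A / ℓ ^ e ≤ A / ℓ ^ e₀ :=
  div_le_div_of_nonneg_left hA (pow_pos (by linarith) _) (pow_le_pow_right₀ hℓ he)

/-- `√u √w ≤ B` once `u w ≤ B²` (`u, w, B ≥ 0`). [folklore] -/
theorem sqrt_mul_sqrt_le_of_le_sq {u w B : ℝ} (hu : 0 ≤ u) (hB : 0 ≤ B) (h : u * w ≤ B ^ 2) :
    Real.sqrt u * Real.sqrt w ≤ B := by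
  rw [← Real.sqrt_mul hu]
  calc Real.sqrt (u * w) ≤ Real.sqrt (B ^ 2) := Real.sqrt_le_sqrt h
    _ = B := Real.sqrt_sq hB

/-- The Cauchy products: if `u ≤ κ A ℓ^a`, `w ≤ κ' A / ℓ^b` with `b = a + 2k`, then
`√u √w ≤ √(κκ') A / ℓ^k`. [folklore] -/
theorem sqrt_mul_sqrt_le_of_bounds {u w A ℓ κ κ' : ℝ} (hu : 0 ≤ u) (hw : 0 ≤ w) (hA : 0 ≤ A)
    (hℓ : 0 < ℓ) (hκ : 0 ≤ κ) (hκ' : 0 ≤ κ') {a b k : ℕ} (hab : b = a + 2 * k)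
    (huA : u ≤ κ * A * ℓ ^ a) (hwA : w ≤ κ' * A / ℓ ^ b) :
    Real.sqrt u * Real.sqrt w ≤ Real.sqrt (κ * κ') * A / ℓ ^ k := by
  refine sqrt_mul_sqrt_le_of_le_sq hu (by positivity) ?_
  have hℓa : 0 < ℓ ^ a := pow_pos hℓ a
  have hℓb : 0 < ℓ ^ b := pow_pos hℓ b
  calc u * w ≤ (κ * A * ℓ ^ a) * (κ' * A / ℓ ^ b) :=
        mul_le_mul huA hwA hw (by positivity)
    _ = (Real.sqrt (κ * κ') * A / ℓ ^ k) ^ 2 := by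
        rw [div_pow, mul_pow, Real.sq_sqrt (mul_nonneg hκ hκ'), hab, pow_add, pow_mul]
        field_simp
        ring

end Numeric

/-! ### The main estimates: (9.7) with a power of `log x` to spare, and (9.12) -/

section Main

set_option maxHeartbeats 4000000 in
-- one pointwise assembly of §9: the eleven eventual inputs, the parameters `X, V, L, Y, Z₀` and
-- the six error terms are all handled in a single `filter_upwards` block
/-- **The heart of the proof of Theorem 2** ([FriedlanderIwaniecASP1998] §9, pp. 1061–1062): for a
sequence `A` with `A.size = A_1`, (9.2) [= FI Annals (2.2)], (9.1) [= (2.4)–(2.6)], (1.9) [= (2.7)],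
`x^{2/3} < D < x`, the cubefree level hypothesis (R₃) [= (2.9)] with `L = (log x)^{2^{24}}`, and the
divisor cube moment `∑_{n≤x} a_n τ(n)³ ≪ A(x)(log x)^{2^8 3^9}` [(2.8′), replacing FI's use of
Lemma 2 with (1.6) for `S₂`], and for the multiplicative `g̃` of (9.5): with `G = ∏_p (1 - g(p²))`,
* (9.7)⁺: `∑_{d ≤ D}^♭ |Ã_d(t) - g̃(d) Ã(t)| ≤ C A(x)(log x)^{-2^{22}-1}` for all `t ≤ x` ("we conclude
  the proof of (9.7), but with `A(x)` in place of `Ã(x)` (actually we saved at least a factor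
  `log x` which is needed for clearing the implied constants below)");
* (9.12): `|Ã(x) - G A(x)| ≤ C A(x)/log x`,
for all large `x`, where `Ã_d(t) = ∑_{n≤t, d∣n} μ²(n) a_n`. The proof is FI's: `r̃_d = ∑_ν μ(ν)
(r_{[ν²,d]} - g̃(d) r_{ν²})` up to the truncation of `ν` at `V = ⌊x⌋²` (`sum_abs_mainTerm_sub_le`),
`E₁` (`ν ≤ L`) by (R′₃) (`sum_sum_abs_remainder_small_le`), `E₂` (`ν > L`) split at
`Y = L√D` into `E₂₂ ≤ (S₁S₂)^{1/2}` (`sum_a_card_divisors_mul_count_le_sqrt`, Rankin's trick for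
`∑_{ν>L} g(ν²)`) and `E₂₁` by (9.2) (`sum_a_card_divisors_mul_count_le_sqrt_sq`).
[cite: FriedlanderIwaniecASP1998, §9 (9.7), (9.10)-(9.12), pp. 1061-1062] -/
theorem sqfree_sieve_main_estimates (A : SieveSequence) {D : ℝ → ℝ} {g' : ArithmeticFunction ℝ}
    (hg'm : g'.IsMultiplicative) (hsize : ∀ x, A.size x = A.congrSum 1 x)
    (h22 : ∃ c : ℝ, 0 < c ∧ ∀ᶠ x : ℝ in atTop,
      c * x ^ (1 / 3 : ℝ) * Real.sqrt (∑ n ∈ Icc 1 ⌊x⌋₊, A.a n ^ 2) ≤ A.size x)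
    (h24 : ∀ p : ℕ, p.Prime → 0 ≤ A.density (p ^ 2) ∧ A.density (p ^ 2) ≤ A.density p ∧ A.density p < 1)
    (h2526 : ∃ K : ℝ, ∀ p : ℕ, p.Prime → A.density p ≤ K / p ∧ A.density (p ^ 2) ≤ K / (p : ℝ) ^ 2)
    (h27 : ∃ c K : ℝ, ∀ y : ℝ, 2 ≤ y →
      |(∑ p ∈ Nat.primesLE ⌊y⌋₊, A.density p) - (Real.log (Real.log y) + c)| ≤ K / Real.log y ^ 10)
    (hD : ∀ᶠ x : ℝ in atTop, x ^ (2 / 3 : ℝ) < D x ∧ D x < x)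
    (h29 : ∀ᶠ x : ℝ in atTop, ∀ t : ℝ, t ≤ x →
      ∑ d ∈ (Icc 1 ⌊D x * (Real.log x ^ (2 ^ 24 : ℕ)) ^ 2⌋₊).filter IsCubefree,
        |A.remainder d t| ≤ A.size x / (Real.log x ^ (2 ^ 24 : ℕ)) ^ 2)
    (hmom : ∃ K : ℝ, ∀ᶠ x : ℝ in atTop,
      ∑ n ∈ Icc 1 ⌊x⌋₊, A.a n * (ArithmeticFunction.sigma 0 n : ℝ) ^ 3 ≤
        K * A.size x * Real.log x ^ (2 ^ 8 * 3 ^ 9))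
    (hg' : ∀ p : ℕ, p.Prime → g' p = (A.density p - A.density (p ^ 2)) / (1 - A.density (p ^ 2))) :
    ∃ G C : ℝ, 0 < G ∧
      Tendsto (fun y : ℕ => ∏ p ∈ Nat.primesLE y, (1 - A.density (p ^ 2))) atTop (nhds G) ∧
      ∀ᶠ x : ℝ in atTop,
        (∀ t : ℝ, t ≤ x →
          ∑ d ∈ (Icc 1 ⌊D x⌋₊).filter Squarefree,
            |(∑ n ∈ (Ioc 0 ⌊t⌋₊).filter (d ∣ ·), (if Squarefree n then A.a n else 0)) -
              g' d * ∑ n ∈ (Ioc 0 ⌊t⌋₊).filter (1 ∣ ·), (if Squarefree n then A.a n else 0)| ≤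
            C * A.size x / Real.log x ^ (2 ^ 22 + 1)) ∧
        |(∑ n ∈ (Ioc 0 ⌊x⌋₊).filter (1 ∣ ·), (if Squarefree n then A.a n else 0)) - G * A.size x| ≤
          C * A.size x / Real.log x := by
  classical
  obtain ⟨c₂, hc₂, h22'⟩ := h22
  obtain ⟨K, hK⟩ := h2526
  obtain ⟨c₇, K₇, h19⟩ := h27
  obtain ⟨Km, hmom'⟩ := hmom
  have hg : A.density.IsMultiplicative := A.density_mult
  have hK0 := densityConst_nonneg h24 hK
  obtain ⟨G, hGt, hG0, hGle, hGge⟩ := exists_densitySqConst h24 hK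
  -- constants
  set Z : ℝ := ∑' n : ℕ, (n : ℝ) ^ (-(9 / 8 : ℝ)) with hZ
  have hZ0 : 0 ≤ Z := tsum_nonneg fun n => Real.rpow_nonneg (Nat.cast_nonneg n) _
  set C₇ : ℝ := c₇ + |K₇| / Real.log 2 ^ 10 with hC₇
  set C₀ : ℝ := Real.exp (2 ^ 20 + (3 ^ 18 + 4 * FriedlanderIwaniecPrimes.fiMomentConst)) with hC₀
  have hC₀0 : 0 < C₀ := Real.exp_pos _
  -- `2^{2^18}` kept opaque (never evaluated)
  obtain ⟨P18, hP18⟩ : ∃ P : ℝ, P = (2 : ℝ) ^ (2 ^ 18 : ℕ) := ⟨_, rfl⟩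
  have hP18pos : 0 < P18 := by rw [hP18]; exact pow_pos two_pos _
  have hP18mul : ∀ y : ℝ, (2 * y) ^ (2 ^ 18 : ℕ) = P18 * y ^ (2 ^ 18 : ℕ) := fun y => by
    rw [mul_pow, hP18]
  clear hP18
  set Km' : ℝ := max Km 0 with hKm'
  have hKm'0 : 0 ≤ Km' := le_max_right _ _
  set eKZ : ℝ := Real.exp (K * Z) with heKZ
  set κA : ℝ := eKZ * (Real.exp (2 * C₇) + Real.exp K * Real.exp C₇) with hκA
  set κ₁ : ℝ := Km' + 2 ^ 4 * Real.exp (4 * C₇ + 9 * K) with hκ₁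
  set κ₂ : ℝ := eKZ + 1 with hκ₂
  set κ₃ : ℝ := C₀ * (C₀ * P18) / c₂ ^ 2 with hκ₃
  set κg : ℝ := Real.exp (2 * K * Z) * Real.exp C₇ with hκg
  set κR : ℝ := 1 + Real.sqrt (1 * κ₃) + eKZ with hκR
  set κC : ℝ := Real.exp C₇ * κR with hκC
  set C : ℝ := κA + Real.sqrt (κ₁ * 1) + Real.sqrt (Km' * κ₂) + Real.sqrt (1 * κ₃) + κg + κC +
    (eKZ + 2 * K) + κR with hCdef
  refine ⟨G, C, hG0, hGt, ?_⟩
  -- growth of `(log x)^{2^24}` against `x^{1/3}`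
  have hLr : ∀ᶠ x : ℝ in atTop, Real.log x ^ (2 ^ 24 : ℕ) ≤ x ^ (1 / 3 : ℝ) := by
    have := (isLittleO_log_rpow_rpow_atTop ((2 ^ 24 : ℕ) : ℝ) (by norm_num : (0 : ℝ) < 1 / 3)).def
      zero_lt_one
    filter_upwards [this, eventually_gt_atTop 1] with x hx hx1
    rw [one_mul, Real.norm_of_nonneg (Real.rpow_nonneg (Real.log_nonneg hx1.le) _),
      Real.norm_of_nonneg (Real.rpow_nonneg (by linarith) _), Real.rpow_natCast] at hx
    exact hx
  filter_upwards [hD, h29, hmom', h22', hLr, eventually_ge_atTop (16 : ℝ),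
    eventually_ge_atTop (Real.exp 2)] with x hDx h29x hmomx h22x hLr3 hx16 hxe2
  -- ### basic quantities at `x`
  have hx1 : (1 : ℝ) < x := by linarith
  have hx0 : (0 : ℝ) < x := by linarith
  -- the atom `x13 = x^{1/3}` (so that `x = x13³`, `x^{2/3} = x13²`)
  obtain ⟨x13, hx13def⟩ : ∃ y : ℝ, y = x ^ (1 / 3 : ℝ) := ⟨_, rfl⟩
  have hx13pos : 0 < x13 := by rw [hx13def]; exact Real.rpow_pos_of_pos hx0 _
  have hx13cube : x13 ^ 3 = x := by
    rw [hx13def, ← Real.rpow_natCast, ← Real.rpow_mul hx0.le]; norm_num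
  have hx23eq : x ^ (2 / 3 : ℝ) = x13 ^ 2 := by
    rw [hx13def, ← Real.rpow_natCast, ← Real.rpow_mul hx0.le]; norm_num
  rw [← hx13def] at hLr3
  set ℓ : ℝ := Real.log x with hℓ
  have hℓ2 : 2 ≤ ℓ := by
    rw [hℓ, ← Real.log_exp 2]; exact Real.log_le_log (Real.exp_pos 2) hxe2
  have hℓ1 : 1 ≤ ℓ := by linarith
  have hℓ0 : 0 < ℓ := by linarith
  set Lr : ℝ := ℓ ^ (2 ^ 24 : ℕ) with hLrdef
  have hLr1 : 1 ≤ Lr := one_le_pow₀ hℓ1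
  have hLr0 : 0 < Lr := by linarith
  have hx13 : (1 : ℝ) ≤ x13 := by rw [hx13def]; exact Real.one_le_rpow hx1.le (by norm_num)
  have hx13x : x13 ≤ x := by
    calc x13 = x13 ^ 1 := (pow_one _).symm
      _ ≤ x13 ^ 3 := pow_le_pow_right₀ hx13 (by norm_num)
      _ = x := hx13cube
  have hLrx : Lr ≤ x := hLr3.trans hx13x
  obtain ⟨X, hXdef⟩ : ∃ X : ℕ, X = ⌊x⌋₊ := ⟨_, rfl⟩
  rw [← hXdef] at h22x hmomx
  have hXx : (X : ℝ) ≤ x := by rw [hXdef]; exact Nat.floor_le hx0.le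
  have hxX : x < (X : ℝ) + 1 := by rw [hXdef]; exact Nat.lt_floor_add_one x
  have hX16 : 16 ≤ X := by rw [hXdef]; exact Nat.le_floor (by exact_mod_cast hx16)
  have hX2 : 2 ≤ X := le_trans (by norm_num) hX16
  have hX0 : (0 : ℝ) < X := by exact_mod_cast (by omega : 0 < X)
  obtain ⟨V, hVdef⟩ : ∃ V : ℕ, V = X ^ 2 := ⟨_, rfl⟩
  have hXV : X ≤ V := by rw [hVdef, sq]; exact Nat.le_mul_self X
  have hV2 : 2 ≤ V := hX2.trans hXV
  have hVx2 : (V : ℝ) ≤ x ^ 2 := by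
    rw [hVdef]; push_cast; exact pow_le_pow_left₀ hX0.le hXx 2
  have hxV : x ≤ (V : ℝ) := by
    rw [hVdef]; push_cast
    have h15 : (15 : ℝ) ≤ X := by exact_mod_cast (by omega : 15 ≤ X)
    have h1 : x ≤ (X : ℝ) + 1 := hxX.le
    have h2 : (X : ℝ) + 1 ≤ (X : ℝ) ^ 2 := by nlinarith only [h15]
    exact h1.trans h2
  -- `D₀`
  obtain ⟨D₀, hD₀def⟩ : ∃ D₀ : ℕ, D₀ = ⌊D x⌋₊ := ⟨_, rfl⟩
  have hD0 : 0 < D x := lt_trans (by positivity) hDx.1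
  have hD₀D : (D₀ : ℝ) ≤ D x := by rw [hD₀def]; exact Nat.floor_le hD0.le
  have hD₀X : D₀ ≤ X := by rw [hD₀def, hXdef]; exact Nat.floor_mono hDx.2.le
  have hx23 : (4 : ℝ) ≤ x ^ (2 / 3 : ℝ) := by
    calc (4 : ℝ) = Real.sqrt 16 := by
          rw [show (16 : ℝ) = 4 ^ 2 by norm_num, Real.sqrt_sq (by norm_num)]
      _ ≤ Real.sqrt x := Real.sqrt_le_sqrt hx16
      _ = x ^ (1 / 2 : ℝ) := Real.sqrt_eq_rpow x
      _ ≤ x ^ (2 / 3 : ℝ) := Real.rpow_le_rpow_of_exponent_le hx1.le (by norm_num)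
  have hD₀2 : 2 ≤ D₀ := by rw [hD₀def]; exact Nat.le_floor (by push_cast; linarith only [hDx.1, hx23])
  have hD₀1 : 1 ≤ D₀ := by omega
  -- `L`
  obtain ⟨L, hLdef⟩ : ∃ L : ℕ, L = ⌊Lr⌋₊ := ⟨_, rfl⟩
  have hLLr : (L : ℝ) ≤ Lr := by rw [hLdef]; exact Nat.floor_le hLr0.le
  have hLrL : Lr < (L : ℝ) + 1 := by rw [hLdef]; exact Nat.lt_floor_add_one Lr
  have hL1 : 1 ≤ L := by rw [hLdef]; exact Nat.le_floor (by simpa using hLr1)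
  -- `Y`
  have hsD : x13 ≤ Real.sqrt (D x) := by
    rw [hx13def, Real.sqrt_eq_rpow, show (1 / 3 : ℝ) = 2 / 3 * (1 / 2) by norm_num,
      Real.rpow_mul hx0.le]
    exact Real.rpow_le_rpow (by positivity) hDx.1.le (by norm_num)
  have hsD1 : 1 ≤ Real.sqrt (D x) := hx13.trans hsD
  obtain ⟨Y, hYdef⟩ : ∃ Y : ℕ, Y = ⌊Lr * Real.sqrt (D x)⌋₊ := ⟨_, rfl⟩
  have hYr0 : 0 ≤ Lr * Real.sqrt (D x) := by positivity
  have hYle : (Y : ℝ) ≤ Lr * Real.sqrt (D x) := by rw [hYdef]; exact Nat.floor_le hYr0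
  have hYgt : Lr * Real.sqrt (D x) < (Y : ℝ) + 1 := by rw [hYdef]; exact Nat.lt_floor_add_one _
  have hLY : L ≤ Y := by
    rw [hLdef, hYdef]; exact Nat.floor_mono (le_mul_of_one_le_right hLr0.le hsD1)
  have hYx : Lr * Real.sqrt (D x) ≤ x := by
    have h1 : Real.sqrt (D x) ≤ Real.sqrt x := Real.sqrt_le_sqrt hDx.2.le
    have h2 : x13 * Real.sqrt x ≤ x := by
      rw [hx13def, Real.sqrt_eq_rpow, ← Real.rpow_add hx0]
      calc x ^ (1 / 3 + 1 / 2 : ℝ) ≤ x ^ (1 : ℝ) := Real.rpow_le_rpow_of_exponent_le hx1.le (by norm_num)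
        _ = x := Real.rpow_one x
    calc Lr * Real.sqrt (D x) ≤ x13 * Real.sqrt x :=
          mul_le_mul hLr3 h1 (Real.sqrt_nonneg _) (by positivity)
      _ ≤ x := h2
  have hYX : Y ≤ X := by rw [hYdef, hXdef]; exact Nat.floor_mono hYx
  have hYV : Y ≤ V := hYX.trans hXV
  have hLV : L ≤ V := hLY.trans hYV
  -- `Z₀` and the cubefree moduli of (R₃)
  obtain ⟨Z₀, hZ₀def⟩ : ∃ Z₀ : ℕ, Z₀ = ⌊D x * Lr ^ 2⌋₊ := ⟨_, rfl⟩
  rw [← hZ₀def] at h29x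
  have hL2D₀ : L ^ 2 * D₀ ≤ Z₀ := hZ₀def ▸ Nat.le_floor (by
    push_cast
    calc (L : ℝ) ^ 2 * D₀ ≤ Lr ^ 2 * D x :=
          mul_le_mul (pow_le_pow_left₀ (Nat.cast_nonneg _) hLLr 2) hD₀D (Nat.cast_nonneg _)
            (by positivity)
      _ = D x * Lr ^ 2 := by ring)
  have hY2Z : Y ^ 2 ≤ Z₀ := hZ₀def ▸ Nat.le_floor (by
    push_cast
    calc (Y : ℝ) ^ 2 ≤ (Lr * Real.sqrt (D x)) ^ 2 := pow_le_pow_left₀ (Nat.cast_nonneg _) hYle 2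
      _ = D x * Lr ^ 2 := by rw [mul_pow, Real.sq_sqrt hD0.le]; ring)
  have hA0 : 0 ≤ A.size x := (size_mono_of_size_eq A hsize le_rfl).1
  have hR3 : ∀ t : ℝ, t ≤ x → ∀ W : ℕ, W ≤ Z₀ →
      ∑ k ∈ (Icc 1 W).filter IsCubefree, |A.remainder k t| ≤ A.size x / Lr ^ 2 :=
    fun t ht W hW => (sum_le_sum_of_subset_of_nonneg
      (filter_subset_filter _ (Icc_subset_Icc le_rfl hW)) fun _ _ _ => abs_nonneg _).trans (h29x t ht)
  -- the divisor cube moment below `t ≤ x`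
  have hMom : ∀ t : ℝ, t ≤ x → ∑ n ∈ Ioc 0 ⌊t⌋₊, A.a n * (#n.divisors : ℝ) ^ 3 ≤
      Km' * A.size x * ℓ ^ (2 ^ 8 * 3 ^ 9) := by
    intro t ht
    have hsub : Ioc 0 ⌊t⌋₊ ⊆ Icc 1 X := fun n hn => by
      rw [mem_Ioc] at hn; rw [mem_Icc]; exact ⟨hn.1, hn.2.trans (hXdef ▸ Nat.floor_mono ht)⟩
    calc ∑ n ∈ Ioc 0 ⌊t⌋₊, A.a n * (#n.divisors : ℝ) ^ 3
        ≤ ∑ n ∈ Icc 1 X, A.a n * (#n.divisors : ℝ) ^ 3 :=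
          sum_le_sum_of_subset_of_nonneg hsub fun n _ _ => mul_nonneg (A.a_nonneg n) (by positivity)
      _ = ∑ n ∈ Icc 1 X, A.a n * (ArithmeticFunction.sigma 0 n : ℝ) ^ 3 := by
          simp only [ArithmeticFunction.sigma_zero_apply]
      _ ≤ Km * A.size x * ℓ ^ (2 ^ 8 * 3 ^ 9) := hmomx
      _ ≤ Km' * A.size x * ℓ ^ (2 ^ 8 * 3 ^ 9) := by
          refine mul_le_mul_of_nonneg_right (mul_le_mul_of_nonneg_right (le_max_left _ _) hA0) ?_
          positivity
  -- (9.2): `∑_{n ≤ X} a_n² ≤ A(x)²/(c₂² x^{2/3})`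
  have h22b : ∑ n ∈ Ioc 0 X, A.a n ^ 2 ≤ A.size x ^ 2 / (c₂ ^ 2 * x13 ^ 2) := by
    have hset : Icc 1 X = Ioc 0 X := by ext n; simp only [mem_Icc, mem_Ioc]; omega
    rw [hset, ← hx13def] at h22x
    have hs0 : 0 ≤ Real.sqrt (∑ n ∈ Ioc 0 X, A.a n ^ 2) := Real.sqrt_nonneg _
    have hsq : Real.sqrt (∑ n ∈ Ioc 0 X, A.a n ^ 2) ≤ A.size x / (c₂ * x13) := by
      rw [le_div_iff₀ (by positivity)]; linarith only [h22x]
    have h2 : (∑ n ∈ Ioc 0 X, A.a n ^ 2) = Real.sqrt (∑ n ∈ Ioc 0 X, A.a n ^ 2) ^ 2 :=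
      (Real.sq_sqrt (sum_nonneg fun n _ => sq_nonneg _)).symm
    rw [h2]
    calc Real.sqrt (∑ n ∈ Ioc 0 X, A.a n ^ 2) ^ 2 ≤ (A.size x / (c₂ * x13)) ^ 2 :=
          pow_le_pow_left₀ hs0 hsq 2
      _ = A.size x ^ 2 / (c₂ ^ 2 * x13 ^ 2) := by rw [div_pow, mul_pow]
  -- Euler-product sums at `D₀`, `L² D₀`, `X`, `V`
  have hlogD₀ : Real.log D₀ ≤ ℓ :=
    Real.log_le_log (by exact_mod_cast (by omega : 0 < D₀)) (hD₀D.trans hDx.2.le)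
  have hlogD₀0 : 0 ≤ Real.log D₀ := Real.log_nonneg (by exact_mod_cast hD₀1)
  have hVg : ∑ e ∈ (Icc 1 D₀).filter Squarefree, A.density e ≤ Real.exp C₇ * ℓ := by
    have h := sum_sqfree_card_divisors_pow_mul_density_le hg h24 h19 0 hD₀2
    simp only [pow_zero, one_mul, pow_one] at h
    exact h.trans (mul_le_mul_of_nonneg_left hlogD₀ (Real.exp_pos _).le)
  have hVg0 : 0 ≤ ∑ e ∈ (Icc 1 D₀).filter Squarefree, A.density e :=
    sum_nonneg fun e he => density_squarefree_nonneg hg h24 (mem_filter.mp he).2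
  have hVτg : ∑ d ∈ (Icc 1 D₀).filter Squarefree, (#d.divisors : ℝ) * A.density d ≤
      Real.exp (2 * C₇) * ℓ ^ 2 := by
    have h := sum_sqfree_card_divisors_pow_mul_density_le hg h24 h19 1 hD₀2
    simp only [pow_one] at h
    refine h.trans (mul_le_mul_of_nonneg_left ?_ (Real.exp_pos _).le)
    exact pow_le_pow_left₀ hlogD₀0 hlogD₀ _
  have hL2D₀2 : 2 ≤ L ^ 2 * D₀ := le_trans hD₀2 (Nat.le_mul_of_pos_left _ (by positivity))
  have hlogL2D₀ : Real.log ((L ^ 2 * D₀ : ℕ) : ℝ) ≤ 2 * ℓ := by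
    have h1 : ((L ^ 2 * D₀ : ℕ) : ℝ) ≤ x ^ 2 := by
      push_cast
      have hL2 : (L : ℝ) ^ 2 ≤ x := by
        calc (L : ℝ) ^ 2 ≤ Lr ^ 2 := pow_le_pow_left₀ (Nat.cast_nonneg _) hLLr 2
          _ ≤ x13 ^ 2 := pow_le_pow_left₀ hLr0.le hLr3 2
          _ ≤ x13 ^ 3 := pow_le_pow_right₀ hx13 (by norm_num)
          _ = x := hx13cube
      calc (L : ℝ) ^ 2 * D₀ ≤ x * x := mul_le_mul hL2 (hD₀D.trans hDx.2.le) (Nat.cast_nonneg _) hx0.le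
        _ = x ^ 2 := (sq x).symm
    calc Real.log ((L ^ 2 * D₀ : ℕ) : ℝ) ≤ Real.log (x ^ 2) :=
          Real.log_le_log (by exact_mod_cast (by omega : 0 < L ^ 2 * D₀)) h1
      _ = 2 * ℓ := by rw [Real.log_pow]; push_cast; ring
  have hG4 : ∑ k ∈ (Icc 1 (L ^ 2 * D₀)).filter IsCubefree, (#k.divisors : ℝ) ^ 2 * A.density k ≤
      2 ^ 4 * Real.exp (4 * C₇ + 9 * K) * ℓ ^ 4 := by
    have h := sum_cubefree_card_divisors_sq_mul_density_le hg h24 hK h19 hL2D₀2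
    refine h.trans ?_
    have hl0 : 0 ≤ Real.log ((L ^ 2 * D₀ : ℕ) : ℝ) := Real.log_nonneg (by exact_mod_cast (by omega : 1 ≤ L ^ 2 * D₀))
    calc Real.exp (4 * C₇ + 9 * K) * Real.log ((L ^ 2 * D₀ : ℕ) : ℝ) ^ 4
        ≤ Real.exp (4 * C₇ + 9 * K) * (2 * ℓ) ^ 4 :=
          mul_le_mul_of_nonneg_left (pow_le_pow_left₀ hl0 hlogL2D₀ 4) (Real.exp_pos _).le
      _ = 2 ^ 4 * Real.exp (4 * C₇ + 9 * K) * ℓ ^ 4 := by ring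
  have hlogX : Real.log X ≤ ℓ := Real.log_le_log hX0 hXx
  have hlogX0 : 0 ≤ Real.log X := Real.log_nonneg (by exact_mod_cast (by omega : 1 ≤ X))
  have hV0 : (0 : ℝ) < V := by exact_mod_cast (by omega : 0 < V)
  have hlogV : Real.log V ≤ 2 * ℓ := by
    calc Real.log V ≤ Real.log (x ^ 2) := Real.log_le_log hV0 hVx2
      _ = 2 * ℓ := by rw [Real.log_pow]; push_cast; ring
  have hlogV0 : 0 ≤ Real.log V := Real.log_nonneg (by exact_mod_cast (by omega : 1 ≤ V))
  have hS3 : ∑ m ∈ Icc 1 X, (#m.divisors : ℝ) ^ 3 / m ≤ C₀ * ℓ ^ (2 ^ 18 : ℕ) :=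
    (sum_card_divisors_pow_div_le hX2 (by norm_num : 3 ≤ 18)).trans
      (mul_le_mul_of_nonneg_left (pow_le_pow_left₀ hlogX0 hlogX _) hC₀0.le)
  have hS6 : ∑ ν ∈ Icc 1 V, (#ν.divisors : ℝ) ^ 6 / ν ≤ C₀ * P18 * ℓ ^ (2 ^ 18 : ℕ) := by
    refine (sum_card_divisors_pow_div_le hV2 (by norm_num : 6 ≤ 18)).trans ?_
    calc C₀ * Real.log V ^ (2 ^ 18 : ℕ) ≤ C₀ * (2 * ℓ) ^ (2 ^ 18 : ℕ) :=
          mul_le_mul_of_nonneg_left (pow_le_pow_left₀ hlogV0 hlogV _) hC₀0.le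
      _ = C₀ * P18 * ℓ ^ (2 ^ 18 : ℕ) := by rw [hP18mul, ← mul_assoc]
  -- the thresholds `L+1`, `Y+1`, `V+1`, `V/D₀+1` exceed `Lr = ℓ^{2^24}`
  have e78 : ((2 ^ 24 : ℕ) : ℝ) * (7 / 8 : ℝ) = (14680064 : ℕ) := by norm_num
  have htailL : ((L : ℝ) + 1) ^ (-(7 / 8 : ℝ)) ≤ (ℓ ^ 14680064)⁻¹ :=
    rpow_neg_le_inv_pow hℓ0 (by norm_num) e78 hLrL.le
  have hLrY : Lr ≤ (Y : ℝ) + 1 := (le_mul_of_one_le_right hLr0.le hsD1).trans hYgt.le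
  have htailY : ((Y : ℝ) + 1) ^ (-(7 / 8 : ℝ)) ≤ (ℓ ^ 14680064)⁻¹ :=
    rpow_neg_le_inv_pow hℓ0 (by norm_num) e78 hLrY
  have hLrV : Lr ≤ (V : ℝ) + 1 := by linarith only [hLrx, hxV]
  have htailV : ((V : ℝ) + 1) ^ (-(7 / 8 : ℝ)) ≤ (ℓ ^ 14680064)⁻¹ :=
    rpow_neg_le_inv_pow hℓ0 (by norm_num) e78 hLrV
  have hVD₀ : X ≤ V / D₀ := by
    calc X = V / X := by rw [hVdef, sq, Nat.mul_div_cancel _ (by omega)]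
      _ ≤ V / D₀ := Nat.div_le_div_left hD₀X (by omega)
  have hLrVD : Lr ≤ ((V / D₀ : ℕ) : ℝ) + 1 := by
    have : (X : ℝ) ≤ ((V / D₀ : ℕ) : ℝ) := by exact_mod_cast hVD₀
    linarith only [this, hLrx, hxX]
  have htailVD : (((V / D₀ : ℕ) : ℝ) + 1) ^ (-(7 / 8 : ℝ)) ≤ (ℓ ^ 14680064)⁻¹ :=
    rpow_neg_le_inv_pow hℓ0 (by norm_num) e78 hLrVD
  have hY1 : ((Y : ℝ) + 1)⁻¹ ≤ (Lr * x13)⁻¹ := by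
    refine inv_anti₀ (by positivity) ?_
    calc Lr * x13 ≤ Lr * Real.sqrt (D x) := mul_le_mul_of_nonneg_left hsD hLr0.le
      _ ≤ (Y : ℝ) + 1 := hYgt.le
  -- ### the error terms, uniformly in `t ≤ x`
  set Q : ℝ := A.size x / ℓ ^ (2 ^ 22 + 1) with hQdef
  have hQ0 : 0 ≤ Q := by positivity
  have hQ : ∀ {κ : ℝ} (_ : 0 ≤ κ) {e : ℕ} (_ : 2 ^ 22 + 1 ≤ e), κ * A.size x / ℓ ^ e ≤ κ * Q := by
    intro κ hκ e he
    rw [hQdef, mul_div_assoc]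
    exact mul_le_mul_of_nonneg_left (div_pow_le_div_pow_of_le hA0 hℓ1 he) hκ
  -- `big(T)`: the squares `ν > Y` by (9.2), for `T ≤ X`
  have hbig : ∀ T : ℕ, T ≤ X →
      ∑ n ∈ Ioc 0 T, A.a n * (#n.divisors : ℝ) *
          #(((Ioc Y V).filter Squarefree).filter (fun ν => ν ^ 2 ∣ n)) ≤
        Real.sqrt (1 * κ₃) * A.size x / ℓ ^ 8126464 := by
    intro T hT
    have hν0 : ∀ ν ∈ (Ioc Y V).filter Squarefree, ν ≠ 0 := fun ν hν => by
      have := (mem_Ioc.mp (mem_filter.mp hν).1).1; omega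
    refine (sum_a_card_divisors_mul_count_le_sqrt_sq A T hν0).trans ?_
    -- `u = ∑ a² ≤ A²/(c₂² x^{2/3})`
    have hu : ∑ n ∈ Ioc 0 T, A.a n ^ 2 ≤ A.size x ^ 2 / (c₂ ^ 2 * x13 ^ 2) :=
      (sum_le_sum_of_subset_of_nonneg (Ioc_subset_Ioc_right hT) fun n _ _ => sq_nonneg _).trans h22b
    -- `w ≤ x Σ₃ Σ₆ /(Y+1)`
    have hinner : ∀ ν ∈ (Ioc Y V).filter Squarefree,
        ∑ m ∈ Icc 1 (T / ν ^ 2), (#m.divisors : ℝ) ^ 3 ≤ x13 ^ 3 / (ν : ℝ) ^ 2 * (C₀ * ℓ ^ (2 ^ 18 : ℕ)) := by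
      intro ν hν
      have hν1 : (1 : ℝ) ≤ ν := by exact_mod_cast Nat.one_le_iff_ne_zero.mpr (hν0 ν hν)
      set M := T / ν ^ 2 with hM
      have hMX : M ≤ X := (Nat.div_le_self _ _).trans hT
      have hMx : (M : ℝ) ≤ x13 ^ 3 / (ν : ℝ) ^ 2 := by
        calc (M : ℝ) ≤ (T : ℝ) / ((ν ^ 2 : ℕ) : ℝ) := Nat.cast_div_le
          _ ≤ x13 ^ 3 / (ν : ℝ) ^ 2 := by
              push_cast
              rw [hx13cube]
              exact div_le_div_of_nonneg_right ((Nat.cast_le.mpr hT).trans hXx) (by positivity)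
      calc ∑ m ∈ Icc 1 M, (#m.divisors : ℝ) ^ 3 ≤ ∑ m ∈ Icc 1 M, (M : ℝ) * ((#m.divisors : ℝ) ^ 3 / m) := by
            refine sum_le_sum fun m hm => ?_
            obtain ⟨hm1, hmM⟩ := mem_Icc.mp hm
            have hm0 : (0 : ℝ) < m := by exact_mod_cast hm1
            have : (m : ℝ) ≤ M := by exact_mod_cast hmM
            calc (#m.divisors : ℝ) ^ 3 = m * ((#m.divisors : ℝ) ^ 3 / m) := by field_simp
              _ ≤ (M : ℝ) * ((#m.divisors : ℝ) ^ 3 / m) := mul_le_mul_of_nonneg_right this (by positivity)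
        _ = (M : ℝ) * ∑ m ∈ Icc 1 M, (#m.divisors : ℝ) ^ 3 / m := by rw [mul_sum]
        _ ≤ (M : ℝ) * ∑ m ∈ Icc 1 X, (#m.divisors : ℝ) ^ 3 / m :=
            mul_le_mul_of_nonneg_left (sum_le_sum_of_subset_of_nonneg (Icc_subset_Icc le_rfl hMX)
              fun m _ _ => by positivity) (Nat.cast_nonneg _)
        _ ≤ x13 ^ 3 / (ν : ℝ) ^ 2 * (C₀ * ℓ ^ (2 ^ 18 : ℕ)) :=
            mul_le_mul hMx hS3 (sum_nonneg fun m _ => by positivity) (by positivity)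
    have hw : ∑ ν ∈ (Ioc Y V).filter Squarefree, (#ν.divisors : ℝ) ^ 6 *
        ∑ m ∈ Icc 1 (T / ν ^ 2), (#m.divisors : ℝ) ^ 3 ≤
        x13 ^ 3 * (C₀ * ℓ ^ (2 ^ 18 : ℕ)) * ((Lr * x13)⁻¹ * (C₀ * P18 * ℓ ^ (2 ^ 18 : ℕ))) := by
      calc ∑ ν ∈ (Ioc Y V).filter Squarefree, (#ν.divisors : ℝ) ^ 6 *
            ∑ m ∈ Icc 1 (T / ν ^ 2), (#m.divisors : ℝ) ^ 3
          ≤ ∑ ν ∈ (Ioc Y V).filter Squarefree, (#ν.divisors : ℝ) ^ 6 *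
              (x13 ^ 3 / (ν : ℝ) ^ 2 * (C₀ * ℓ ^ (2 ^ 18 : ℕ))) :=
            sum_le_sum fun ν hν => mul_le_mul_of_nonneg_left (hinner ν hν) (by positivity)
        _ = x13 ^ 3 * (C₀ * ℓ ^ (2 ^ 18 : ℕ)) * ∑ ν ∈ (Ioc Y V).filter Squarefree,
              (#ν.divisors : ℝ) ^ 6 / (ν : ℝ) ^ 2 := by
            rw [mul_sum]; exact sum_congr rfl fun ν _ => by ring
        _ ≤ x13 ^ 3 * (C₀ * ℓ ^ (2 ^ 18 : ℕ)) * (((Y : ℝ) + 1)⁻¹ * ∑ ν ∈ Icc 1 V, (#ν.divisors : ℝ) ^ 6 / ν) := by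
            refine mul_le_mul_of_nonneg_left ?_ (by positivity)
            rw [mul_sum]
            calc ∑ ν ∈ (Ioc Y V).filter Squarefree, (#ν.divisors : ℝ) ^ 6 / (ν : ℝ) ^ 2
                ≤ ∑ ν ∈ (Ioc Y V).filter Squarefree, ((Y : ℝ) + 1)⁻¹ * ((#ν.divisors : ℝ) ^ 6 / ν) := by
                  refine sum_le_sum fun ν hν => ?_
                  have hνY : (Y : ℝ) + 1 ≤ ν := by exact_mod_cast (mem_Ioc.mp (mem_filter.mp hν).1).1
                  have hν0' : (0 : ℝ) < ν := by linarith [show (0:ℝ) ≤ Y from Nat.cast_nonneg Y]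
                  have h1 : (1 : ℝ) / ν ≤ ((Y : ℝ) + 1)⁻¹ := by
                    rw [one_div]; exact inv_anti₀ (Nat.cast_add_one_pos Y) hνY
                  calc (#ν.divisors : ℝ) ^ 6 / (ν : ℝ) ^ 2 = (#ν.divisors : ℝ) ^ 6 / ν * (1 / ν) := by
                        rw [sq, ← div_div, div_eq_mul_one_div ((#ν.divisors : ℝ) ^ 6 / ν)]
                    _ ≤ (#ν.divisors : ℝ) ^ 6 / ν * ((Y : ℝ) + 1)⁻¹ :=
                        mul_le_mul_of_nonneg_left h1 (div_nonneg (pow_nonneg (Nat.cast_nonneg _) _)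
                          (Nat.cast_nonneg _))
                    _ = _ := mul_comm _ _
              _ ≤ ∑ ν ∈ Icc 1 V, ((Y : ℝ) + 1)⁻¹ * ((#ν.divisors : ℝ) ^ 6 / ν) := by
                  refine sum_le_sum_of_subset_of_nonneg (fun ν hν => ?_) fun ν _ _ =>
                    mul_nonneg (inv_nonneg.mpr (Nat.cast_add_one_pos Y).le)
                      (div_nonneg (pow_nonneg (Nat.cast_nonneg _) _) (Nat.cast_nonneg _))
                  have h := mem_Ioc.mp (mem_filter.mp hν).1
                  exact mem_Icc.mpr ⟨by omega, h.2⟩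
        _ ≤ _ := by
            refine mul_le_mul_of_nonneg_left (mul_le_mul hY1 hS6 (sum_nonneg fun ν _ => by positivity)
              (by positivity)) (by positivity)
    -- combine: `u w ≤ B²`
    have hu0 : 0 ≤ ∑ n ∈ Ioc 0 T, A.a n ^ 2 := sum_nonneg fun _ _ => sq_nonneg _
    have hw0 : 0 ≤ ∑ ν ∈ (Ioc Y V).filter Squarefree, (#ν.divisors : ℝ) ^ 6 *
        ∑ m ∈ Icc 1 (T / ν ^ 2), (#m.divisors : ℝ) ^ 3 :=
      sum_nonneg fun ν _ => mul_nonneg (pow_nonneg (Nat.cast_nonneg _) _)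
        (sum_nonneg fun m _ => pow_nonneg (Nat.cast_nonneg _) _)
    have hκ₃0 : 0 ≤ κ₃ := by rw [hκ₃]; positivity
    have hB0 : 0 ≤ Real.sqrt (1 * κ₃) * A.size x / ℓ ^ 8126464 := by positivity
    refine sqrt_mul_sqrt_le_of_le_sq hu0 hB0 ?_
    have hℓ18 : ℓ ^ (2 ^ 18 : ℕ) * ℓ ^ (2 ^ 18 : ℕ) = ℓ ^ (2 ^ 19 : ℕ) := by
      rw [← pow_add]; norm_num
    have hLr_split : Lr = ℓ ^ (2 ^ 19 : ℕ) * ℓ ^ 16252928 := by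
      rw [hLrdef, ← pow_add]; norm_num
    calc (∑ n ∈ Ioc 0 T, A.a n ^ 2) * ∑ ν ∈ (Ioc Y V).filter Squarefree, (#ν.divisors : ℝ) ^ 6 *
          ∑ m ∈ Icc 1 (T / ν ^ 2), (#m.divisors : ℝ) ^ 3
        ≤ (A.size x ^ 2 / (c₂ ^ 2 * x13 ^ 2)) *
            (x13 ^ 3 * (C₀ * ℓ ^ (2 ^ 18 : ℕ)) * ((Lr * x13)⁻¹ * (C₀ * P18 * ℓ ^ (2 ^ 18 : ℕ)))) :=
          mul_le_mul hu hw hw0 (by positivity)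
      _ = κ₃ * A.size x ^ 2 * (ℓ ^ (2 ^ 18 : ℕ) * ℓ ^ (2 ^ 18 : ℕ)) / Lr := by
          rw [hκ₃]; field_simp
      _ = (Real.sqrt (1 * κ₃) * A.size x / ℓ ^ 8126464) ^ 2 := by
          rw [div_pow, mul_pow, Real.sq_sqrt (by positivity), one_mul, ← pow_mul, hℓ18, hLr_split]
          field_simp
  -- `Lr² = ℓ^{2^25}` and the comparison of small factors with `ℓ`-powers
  have hLr2 : Lr ^ 2 = ℓ ^ (2 ^ 25 : ℕ) := by rw [hLrdef, ← pow_mul]; norm_num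
  have hinv14 : ∀ {c : ℝ}, 0 ≤ c → (ℓ ^ 14680064)⁻¹ * c * A.size x = c * A.size x / ℓ ^ 14680064 := by
    intro c _; field_simp
  -- `R₁(t)`: the remainders at the squares, for `t ≤ x`
  have hκR1 : 0 ≤ Real.sqrt (1 * κ₃) := Real.sqrt_nonneg _
  have heKZ0 : 0 ≤ eKZ := (Real.exp_pos _).le
  have hR1 : ∀ t : ℝ, t ≤ x →
      |∑ ν ∈ (Icc 1 V).filter Squarefree, (μ ν : ℝ) * A.remainder (ν ^ 2) t| ≤
        κR * A.size x / ℓ ^ 8126464 := by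
    intro t ht
    obtain ⟨hAt0, hAtx⟩ := size_mono_of_size_eq A hsize ht
    have hTX : ⌊t⌋₊ ≤ X := hXdef ▸ Nat.floor_mono ht
    refine (abs_sum_moebius_remainder_sq_le A h24 hAt0 hYV).trans ?_
    have h1 : ∑ ν ∈ (Icc 1 Y).filter Squarefree, |A.remainder (ν ^ 2) t| ≤ A.size x / Lr ^ 2 := by
      refine (sum_abs_remainder_sq_le A (Y := Y) (fun ν hν => ?_) t).trans (hR3 t ht _ hY2Z)
      obtain ⟨hν1, hνsq⟩ := mem_filter.mp hν
      exact ⟨hνsq, (mem_Icc.mp hν1).1, (mem_Icc.mp hν1).2⟩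
    have h2 : ∑ ν ∈ (Ioc Y V).filter Squarefree, A.congrSum (ν ^ 2) t ≤
        Real.sqrt (1 * κ₃) * A.size x / ℓ ^ 8126464 := by
      rw [sum_congrSum_sq_eq]
      refine le_trans (sum_le_sum fun n hn => ?_) (hbig ⌊t⌋₊ hTX)
      have hn0 : n ≠ 0 := by have := (mem_Ioc.mp hn).1; omega
      have hτ1 : (1 : ℝ) ≤ #n.divisors := by
        exact_mod_cast FriedlanderIwaniecPrimes.one_le_card_divisors hn0
      calc A.a n * (#(((Ioc Y V).filter Squarefree).filter (fun ν => ν ^ 2 ∣ n)) : ℝ)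
          = A.a n * 1 * #(((Ioc Y V).filter Squarefree).filter (fun ν => ν ^ 2 ∣ n)) := by rw [mul_one]
        _ ≤ A.a n * #n.divisors * #(((Ioc Y V).filter Squarefree).filter (fun ν => ν ^ 2 ∣ n)) :=
            mul_le_mul_of_nonneg_right (mul_le_mul_of_nonneg_left hτ1 (A.a_nonneg n)) (Nat.cast_nonneg _)
    have h3 : ∑ ν ∈ (Ioc Y V).filter Squarefree, A.density (ν ^ 2) ≤ ((Y : ℝ) + 1) ^ (-(7 / 8 : ℝ)) * eKZ := by
      have h := tail_sum_sqfree_density_sq_le hg h24 hK 0 Y V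
      simp only [pow_zero, one_mul] at h
      exact h
    have h3' : (∑ ν ∈ (Ioc Y V).filter Squarefree, A.density (ν ^ 2)) * A.size t ≤
        eKZ * A.size x / ℓ ^ 14680064 := by
      calc (∑ ν ∈ (Ioc Y V).filter Squarefree, A.density (ν ^ 2)) * A.size t
          ≤ (((Y : ℝ) + 1) ^ (-(7 / 8 : ℝ)) * eKZ) * A.size x :=
            mul_le_mul h3 hAtx hAt0 (mul_nonneg (Real.rpow_nonneg (Nat.cast_add_one_pos Y).le _) heKZ0)
        _ ≤ ((ℓ ^ 14680064)⁻¹ * eKZ) * A.size x :=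
            mul_le_mul_of_nonneg_right (mul_le_mul_of_nonneg_right htailY heKZ0) hA0
        _ = eKZ * A.size x / ℓ ^ 14680064 := hinv14 heKZ0
    have h1' : A.size x / Lr ^ 2 ≤ 1 * A.size x / ℓ ^ 8126464 := by
      rw [hLr2, one_mul]; exact div_pow_le_div_pow_of_le hA0 hℓ1 (by norm_num)
    have h3'' : eKZ * A.size x / ℓ ^ 14680064 ≤ eKZ * A.size x / ℓ ^ 8126464 :=
      div_pow_le_div_pow_of_le (by positivity) hℓ1 (by norm_num)
    rw [sum_add_distrib, ← sum_mul]
    calc (∑ ν ∈ (Icc 1 Y).filter Squarefree, |A.remainder (ν ^ 2) t|) +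
          ((∑ ν ∈ (Ioc Y V).filter Squarefree, A.congrSum (ν ^ 2) t) +
            (∑ ν ∈ (Ioc Y V).filter Squarefree, A.density (ν ^ 2)) * A.size t)
        ≤ 1 * A.size x / ℓ ^ 8126464 + (Real.sqrt (1 * κ₃) * A.size x / ℓ ^ 8126464 +
            eKZ * A.size x / ℓ ^ 8126464) :=
          add_le_add (h1.trans h1') (add_le_add h2 (h3'.trans h3''))
      _ = κR * A.size x / ℓ ^ 8126464 := by rw [hκR]; ring
  have hκR0 : 0 ≤ κR := by rw [hκR]; positivity
  constructor
  · -- ### (9.7)⁺ : `∑_d |r̃_d(t)| ≤ C A(x) (log x)^{-2^22-1}`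
    intro t ht
    obtain ⟨hAt0, hAtx⟩ := size_mono_of_size_eq A hsize ht
    have hTX : ⌊t⌋₊ ≤ X := hXdef ▸ Nat.floor_mono ht
    have htV : ⌊t⌋₊ ≤ V := hTX.trans hXV
    rw [← hD₀def]
    set SD := (Icc 1 D₀).filter Squarefree with hSD
    -- termwise decomposition
    have hdec : ∀ d ∈ SD,
        |(∑ n ∈ (Ioc 0 ⌊t⌋₊).filter (d ∣ ·), (if Squarefree n then A.a n else 0)) -
            g' d * ∑ n ∈ (Ioc 0 ⌊t⌋₊).filter (1 ∣ ·), (if Squarefree n then A.a n else 0)| ≤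
          |(∑ ν ∈ (Icc 1 V).filter Squarefree, (μ ν : ℝ) * A.density (Nat.lcm (ν ^ 2) d)) -
              g' d * ∑ ν ∈ (Icc 1 V).filter Squarefree, (μ ν : ℝ) * A.density (ν ^ 2)| * A.size t +
            (|∑ ν ∈ (Icc 1 V).filter Squarefree, (μ ν : ℝ) * A.remainder (Nat.lcm (ν ^ 2) d) t| +
              g' d * |∑ ν ∈ (Icc 1 V).filter Squarefree, (μ ν : ℝ) * A.remainder (ν ^ 2) t|) := by
      intro d hd
      have hdsq : Squarefree d := (mem_filter.mp hd).2
      have hg'd := (sqfreeDensity_squarefree_le hg hg'm h24 hg' hdsq).1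
      rw [sqfree_congrSum_sub_eq A d t htV (g' d)]
      refine (abs_add_le _ _).trans (add_le_add ?_ ?_)
      · rw [abs_mul, abs_of_nonneg hAt0]
      · refine (abs_sub _ _).trans (add_le_add le_rfl ?_)
        rw [abs_mul, abs_of_nonneg hg'd]
    -- Term A
    have hTermA : (∑ d ∈ SD,
        |(∑ ν ∈ (Icc 1 V).filter Squarefree, (μ ν : ℝ) * A.density (Nat.lcm (ν ^ 2) d)) -
            g' d * ∑ ν ∈ (Icc 1 V).filter Squarefree, (μ ν : ℝ) * A.density (ν ^ 2)|) * A.size t ≤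
        κA * A.size x / ℓ ^ 14680062 := by
      have h := sum_abs_mainTerm_sub_le A hg'm h24 hK hg' D₀ V
      have hsum : ∑ d ∈ SD, ((#d.divisors : ℝ) + Real.exp K) * A.density d ≤
          (Real.exp (2 * C₇) + Real.exp K * Real.exp C₇) * ℓ ^ 2 := by
        have hsplit : ∑ d ∈ SD, ((#d.divisors : ℝ) + Real.exp K) * A.density d =
            ∑ d ∈ SD, (#d.divisors : ℝ) * A.density d + Real.exp K * ∑ d ∈ SD, A.density d := by
          rw [mul_sum, ← sum_add_distrib]; exact sum_congr rfl fun d _ => by ring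
        rw [hsplit]
        have hℓℓ : ℓ ≤ ℓ ^ 2 := by rw [sq]; exact le_mul_of_one_le_left hℓ0.le hℓ1
        calc ∑ d ∈ SD, (#d.divisors : ℝ) * A.density d + Real.exp K * ∑ d ∈ SD, A.density d
            ≤ Real.exp (2 * C₇) * ℓ ^ 2 + Real.exp K * (Real.exp C₇ * ℓ) :=
              add_le_add hVτg (mul_le_mul_of_nonneg_left hVg (Real.exp_pos _).le)
          _ ≤ Real.exp (2 * C₇) * ℓ ^ 2 + Real.exp K * (Real.exp C₇ * ℓ ^ 2) := by
              gcongr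
          _ = (Real.exp (2 * C₇) + Real.exp K * Real.exp C₇) * ℓ ^ 2 := by ring
      have hsum0 : 0 ≤ ∑ d ∈ SD, ((#d.divisors : ℝ) + Real.exp K) * A.density d :=
        sum_nonneg fun d hd => mul_nonneg (by positivity)
          (density_squarefree_nonneg hg h24 (mem_filter.mp hd).2)
      calc (∑ d ∈ SD, |(∑ ν ∈ (Icc 1 V).filter Squarefree, (μ ν : ℝ) * A.density (Nat.lcm (ν ^ 2) d)) -
              g' d * ∑ ν ∈ (Icc 1 V).filter Squarefree, (μ ν : ℝ) * A.density (ν ^ 2)|) * A.size t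
          ≤ ((((V / D₀ : ℕ) : ℝ) + 1) ^ (-(7 / 8 : ℝ)) * Real.exp (K * Z) *
              ∑ d ∈ SD, ((#d.divisors : ℝ) + Real.exp K) * A.density d) * A.size x :=
            mul_le_mul h hAtx hAt0 (mul_nonneg (mul_nonneg
              (Real.rpow_nonneg (Nat.cast_add_one_pos _).le _) (Real.exp_pos _).le) hsum0)
        _ ≤ ((ℓ ^ 14680064)⁻¹ * eKZ * ((Real.exp (2 * C₇) + Real.exp K * Real.exp C₇) * ℓ ^ 2)) *
              A.size x := by
            refine mul_le_mul_of_nonneg_right ?_ hA0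
            exact mul_le_mul (mul_le_mul_of_nonneg_right htailVD (Real.exp_pos _).le) hsum hsum0
              (by positivity)
        _ = κA * A.size x / ℓ ^ 14680062 := by
            rw [hκA, show (14680064 : ℕ) = 14680062 + 2 by norm_num, pow_add]
            field_simp
    -- Term B: `∑_d |R_d(t)| ≤ E₁ + E₂A + E₂g A(t)`
    have hRd : ∀ d ∈ SD, |∑ ν ∈ (Icc 1 V).filter Squarefree, (μ ν : ℝ) * A.remainder (Nat.lcm (ν ^ 2) d) t| ≤
        (∑ ν ∈ (Icc 1 L).filter Squarefree, |A.remainder (Nat.lcm (ν ^ 2) d) t|) +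
          ∑ ν ∈ (Ioc L V).filter Squarefree,
            (A.congrSum (Nat.lcm (ν ^ 2) d) t + A.density (Nat.lcm (ν ^ 2) d) * A.size t) :=
      fun d hd => abs_sum_moebius_remainder_lcm_le A h24 (mem_filter.mp hd).2 hAt0 hLV
    -- E₁
    have hE1 : ∑ d ∈ SD, ∑ ν ∈ (Icc 1 L).filter Squarefree, |A.remainder (Nat.lcm (ν ^ 2) d) t| ≤
        Real.sqrt (κ₁ * 1) * A.size x / ℓ ^ 14257792 := by
      refine (sum_sum_abs_remainder_small_le A h24 hAt0 D₀ L).trans ?_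
      have hu0 : 0 ≤ (∑ n ∈ Ioc 0 ⌊t⌋₊, A.a n * (#n.divisors : ℝ) ^ 3) +
          A.size t * ∑ k ∈ (Icc 1 (L ^ 2 * D₀)).filter IsCubefree, (#k.divisors : ℝ) ^ 2 * A.density k :=
        add_nonneg (sum_nonneg fun n _ => mul_nonneg (A.a_nonneg n) (by positivity))
          (mul_nonneg hAt0 (sum_nonneg fun k hk => mul_nonneg (by positivity)
            (density_nonneg_of_isCubefree hg h24 (mem_filter.mp hk).2)))
      have hw0 : 0 ≤ ∑ k ∈ (Icc 1 (L ^ 2 * D₀)).filter IsCubefree, |A.remainder k t| :=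
        sum_nonneg fun _ _ => abs_nonneg _
      have hκ₁0 : 0 ≤ κ₁ := by rw [hκ₁]; positivity
      refine sqrt_mul_sqrt_le_of_bounds hu0 hw0 hA0 hℓ0 hκ₁0 zero_le_one
        (a := 2 ^ 8 * 3 ^ 9) (b := 2 ^ 25) (k := 14257792) (by norm_num) ?_ ?_
      · have hℓ4 : ℓ ^ 4 ≤ ℓ ^ (2 ^ 8 * 3 ^ 9) := pow_le_pow_right₀ hℓ1 (by norm_num)
        calc (∑ n ∈ Ioc 0 ⌊t⌋₊, A.a n * (#n.divisors : ℝ) ^ 3) +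
              A.size t * ∑ k ∈ (Icc 1 (L ^ 2 * D₀)).filter IsCubefree, (#k.divisors : ℝ) ^ 2 * A.density k
            ≤ Km' * A.size x * ℓ ^ (2 ^ 8 * 3 ^ 9) + A.size x * (2 ^ 4 * Real.exp (4 * C₇ + 9 * K) * ℓ ^ 4) :=
              add_le_add (hMom t ht) (mul_le_mul hAtx hG4 (sum_nonneg fun k hk => mul_nonneg (by positivity)
                (density_nonneg_of_isCubefree hg h24 (mem_filter.mp hk).2)) hA0)
          _ ≤ Km' * A.size x * ℓ ^ (2 ^ 8 * 3 ^ 9) +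
                A.size x * (2 ^ 4 * Real.exp (4 * C₇ + 9 * K) * ℓ ^ (2 ^ 8 * 3 ^ 9)) := by
              gcongr
          _ = κ₁ * A.size x * ℓ ^ (2 ^ 8 * 3 ^ 9) := by rw [hκ₁]; ring
      · rw [one_mul, ← hLr2]; exact hR3 t ht _ hL2D₀
    -- E₂, the `A`-part
    have hE2A : ∑ d ∈ SD, ∑ ν ∈ (Ioc L V).filter Squarefree, A.congrSum (Nat.lcm (ν ^ 2) d) t ≤
        Real.sqrt (Km' * κ₂) * A.size x / ℓ ^ 4820608 + Real.sqrt (1 * κ₃) * A.size x / ℓ ^ 8126464 := by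
      refine (sum_sum_congrSum_large_le A t D₀ hLY hYV).trans (add_le_add ?_ (hbig ⌊t⌋₊ hTX))
      -- the middle range `L < ν ≤ Y`: `E₂₂ ≤ (S₁ S₂)^{1/2}`
      refine (sum_a_card_divisors_mul_count_le_sqrt A t _).trans ?_
      have hu0 : 0 ≤ ∑ n ∈ Ioc 0 ⌊t⌋₊, A.a n * (#n.divisors : ℝ) ^ 3 :=
        sum_nonneg fun n _ => mul_nonneg (A.a_nonneg n) (by positivity)
      have hw0 : 0 ≤ ∑ ν ∈ (Ioc L Y).filter Squarefree, A.congrSum (ν ^ 2) t :=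
        sum_nonneg fun ν _ => sum_nonneg fun n _ => A.a_nonneg n
      have hκ₂0 : 0 ≤ κ₂ := by rw [hκ₂]; positivity
      refine sqrt_mul_sqrt_le_of_bounds hu0 hw0 hA0 hℓ0 hKm'0 hκ₂0
        (a := 2 ^ 8 * 3 ^ 9) (b := 14680064) (k := 4820608) (by norm_num) (hMom t ht) ?_
      -- `S₁ ≤ A(t) ∑_{L<ν≤Y} g(ν²) + ∑ |r_{ν²}(t)| ≤ (eKZ + 1) A / ℓ^{14680064}`
      refine (sum_congrSum_sq_le A t _).trans ?_
      have hg2 : ∑ ν ∈ (Ioc L Y).filter Squarefree, A.density (ν ^ 2) ≤ ((L : ℝ) + 1) ^ (-(7 / 8 : ℝ)) * eKZ := by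
        have h := tail_sum_sqfree_density_sq_le hg h24 hK 0 L Y
        simp only [pow_zero, one_mul] at h
        exact h
      have hr2 : ∑ ν ∈ (Ioc L Y).filter Squarefree, |A.remainder (ν ^ 2) t| ≤ A.size x / Lr ^ 2 := by
        refine (sum_abs_remainder_sq_le A (Y := Y) (fun ν hν => ?_) t).trans (hR3 t ht _ hY2Z)
        obtain ⟨hν1, hνsq⟩ := mem_filter.mp hν
        exact ⟨hνsq, by have := (mem_Ioc.mp hν1).1; omega, (mem_Ioc.mp hν1).2⟩
      calc A.size t * ∑ ν ∈ (Ioc L Y).filter Squarefree, A.density (ν ^ 2) +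
            ∑ ν ∈ (Ioc L Y).filter Squarefree, |A.remainder (ν ^ 2) t|
          ≤ A.size x * (((L : ℝ) + 1) ^ (-(7 / 8 : ℝ)) * eKZ) + A.size x / Lr ^ 2 :=
            add_le_add (mul_le_mul hAtx hg2 (sum_nonneg fun ν hν =>
              apply_sq_nonneg_of_squarefree hg h24 (mem_filter.mp hν).2) hA0) hr2
        _ ≤ A.size x * ((ℓ ^ 14680064)⁻¹ * eKZ) + A.size x / ℓ ^ 14680064 := by
            refine add_le_add (mul_le_mul_of_nonneg_left (mul_le_mul_of_nonneg_right htailL heKZ0) hA0) ?_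
            rw [hLr2]; exact div_pow_le_div_pow_of_le hA0 hℓ1 (by norm_num)
        _ = κ₂ * A.size x / ℓ ^ 14680064 := by rw [hκ₂]; field_simp
    -- E₂, the `g`-part
    have hE2g : (∑ d ∈ SD, ∑ ν ∈ (Ioc L V).filter Squarefree, A.density (Nat.lcm (ν ^ 2) d)) * A.size t ≤
        κg * A.size x / ℓ ^ 14680063 := by
      have h := sum_sum_density_lcm_large_le A h24 hK D₀ L V
      simp only [pow_one] at h
      have h0 : 0 ≤ ∑ d ∈ SD, ∑ ν ∈ (Ioc L V).filter Squarefree, A.density (Nat.lcm (ν ^ 2) d) :=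
        sum_nonneg fun d hd => sum_nonneg fun ν hν => density_nonneg_of_isCubefree hg h24
          (isCubefree_lcm_sq (mem_filter.mp hν).2 (mem_filter.mp hd).2)
      calc (∑ d ∈ SD, ∑ ν ∈ (Ioc L V).filter Squarefree, A.density (Nat.lcm (ν ^ 2) d)) * A.size t
          ≤ (((L : ℝ) + 1) ^ (-(7 / 8 : ℝ)) * Real.exp (2 * K * Z) *
              ∑ e ∈ SD, A.density e) * A.size x :=
            mul_le_mul h hAtx hAt0 (mul_nonneg (mul_nonneg
              (Real.rpow_nonneg (Nat.cast_add_one_pos _).le _) (Real.exp_pos _).le) hVg0)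
        _ ≤ ((ℓ ^ 14680064)⁻¹ * Real.exp (2 * K * Z) * (Real.exp C₇ * ℓ)) * A.size x := by
            refine mul_le_mul_of_nonneg_right ?_ hA0
            exact mul_le_mul (mul_le_mul_of_nonneg_right htailL (Real.exp_pos _).le) hVg hVg0
              (by positivity)
        _ = κg * A.size x / ℓ ^ 14680063 := by
            rw [hκg, show (14680064 : ℕ) = 14680063 + 1 by norm_num, pow_add, pow_one]
            field_simp
    -- Term C
    have hTermC : (∑ d ∈ SD, g' d) * |∑ ν ∈ (Icc 1 V).filter Squarefree, (μ ν : ℝ) * A.remainder (ν ^ 2) t| ≤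
        κC * A.size x / ℓ ^ 8126463 := by
      have hg'sum : ∑ d ∈ SD, g' d ≤ Real.exp C₇ * ℓ :=
        (sum_le_sum fun d hd => (sqfreeDensity_squarefree_le hg hg'm h24 hg' (mem_filter.mp hd).2).2).trans hVg
      have hg'0 : 0 ≤ ∑ d ∈ SD, g' d :=
        sum_nonneg fun d hd => (sqfreeDensity_squarefree_le hg hg'm h24 hg' (mem_filter.mp hd).2).1
      calc (∑ d ∈ SD, g' d) * |∑ ν ∈ (Icc 1 V).filter Squarefree, (μ ν : ℝ) * A.remainder (ν ^ 2) t|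
          ≤ (Real.exp C₇ * ℓ) * (κR * A.size x / ℓ ^ 8126464) :=
            mul_le_mul hg'sum (hR1 t ht) (abs_nonneg _) (by positivity)
        _ = κC * A.size x / ℓ ^ 8126463 := by
            rw [hκC, show (8126464 : ℕ) = 8126463 + 1 by norm_num, pow_add, pow_one]
            field_simp
    -- assemble
    have hκA0 : 0 ≤ κA := by rw [hκA]; positivity
    have hκg0 : 0 ≤ κg := by rw [hκg]; positivity
    have hκC0 : 0 ≤ κC := by rw [hκC]; positivity
    calc ∑ d ∈ SD, |(∑ n ∈ (Ioc 0 ⌊t⌋₊).filter (d ∣ ·), (if Squarefree n then A.a n else 0)) -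
            g' d * ∑ n ∈ (Ioc 0 ⌊t⌋₊).filter (1 ∣ ·), (if Squarefree n then A.a n else 0)|
        ≤ ∑ d ∈ SD, (|(∑ ν ∈ (Icc 1 V).filter Squarefree, (μ ν : ℝ) * A.density (Nat.lcm (ν ^ 2) d)) -
              g' d * ∑ ν ∈ (Icc 1 V).filter Squarefree, (μ ν : ℝ) * A.density (ν ^ 2)| * A.size t +
            (|∑ ν ∈ (Icc 1 V).filter Squarefree, (μ ν : ℝ) * A.remainder (Nat.lcm (ν ^ 2) d) t| +
              g' d * |∑ ν ∈ (Icc 1 V).filter Squarefree, (μ ν : ℝ) * A.remainder (ν ^ 2) t|)) :=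
          sum_le_sum hdec
      _ = (∑ d ∈ SD, |(∑ ν ∈ (Icc 1 V).filter Squarefree, (μ ν : ℝ) * A.density (Nat.lcm (ν ^ 2) d)) -
              g' d * ∑ ν ∈ (Icc 1 V).filter Squarefree, (μ ν : ℝ) * A.density (ν ^ 2)|) * A.size t +
            (∑ d ∈ SD, |∑ ν ∈ (Icc 1 V).filter Squarefree, (μ ν : ℝ) * A.remainder (Nat.lcm (ν ^ 2) d) t| +
              (∑ d ∈ SD, g' d) * |∑ ν ∈ (Icc 1 V).filter Squarefree, (μ ν : ℝ) * A.remainder (ν ^ 2) t|) := by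
          rw [sum_add_distrib, sum_add_distrib, sum_mul, sum_mul]
      _ ≤ κA * A.size x / ℓ ^ 14680062 +
            ((Real.sqrt (κ₁ * 1) * A.size x / ℓ ^ 14257792 +
              ((Real.sqrt (Km' * κ₂) * A.size x / ℓ ^ 4820608 + Real.sqrt (1 * κ₃) * A.size x / ℓ ^ 8126464) +
              κg * A.size x / ℓ ^ 14680063)) + κC * A.size x / ℓ ^ 8126463) := by
          refine add_le_add hTermA (add_le_add ?_ hTermC)
          refine (sum_le_sum hRd).trans ?_
          rw [sum_add_distrib]
          refine add_le_add hE1 ?_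
          have : ∑ d ∈ SD, ∑ ν ∈ (Ioc L V).filter Squarefree,
              (A.congrSum (Nat.lcm (ν ^ 2) d) t + A.density (Nat.lcm (ν ^ 2) d) * A.size t) =
              ∑ d ∈ SD, ∑ ν ∈ (Ioc L V).filter Squarefree, A.congrSum (Nat.lcm (ν ^ 2) d) t +
                (∑ d ∈ SD, ∑ ν ∈ (Ioc L V).filter Squarefree, A.density (Nat.lcm (ν ^ 2) d)) * A.size t := by
            rw [sum_mul, ← sum_add_distrib]
            refine sum_congr rfl fun d _ => ?_
            rw [sum_mul, ← sum_add_distrib]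
          rw [this]
          exact add_le_add hE2A hE2g
      _ ≤ κA * Q + ((Real.sqrt (κ₁ * 1) * Q + ((Real.sqrt (Km' * κ₂) * Q + Real.sqrt (1 * κ₃) * Q) +
            κg * Q)) + κC * Q) := by
          gcongr
          · exact hQ hκA0 (by norm_num)
          · exact hQ (Real.sqrt_nonneg _) (by norm_num)
          · exact hQ (Real.sqrt_nonneg _) (by norm_num)
          · exact hQ (Real.sqrt_nonneg _) (by norm_num)
          · exact hQ hκg0 (by norm_num)
          · exact hQ hκC0 (by norm_num)
      _ ≤ C * Q := by
          have h7 : 0 ≤ (eKZ + 2 * K) * Q := mul_nonneg (by positivity) hQ0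
          have h8 : 0 ≤ κR * Q := mul_nonneg hκR0 hQ0
          have heq : C * Q = κA * Q + ((Real.sqrt (κ₁ * 1) * Q +
              ((Real.sqrt (Km' * κ₂) * Q + Real.sqrt (1 * κ₃) * Q) + κg * Q)) + κC * Q) +
              ((eKZ + 2 * K) * Q + κR * Q) := by rw [hCdef]; ring
          rw [heq]
          linarith only [h7, h8]
      _ = C * A.size x / ℓ ^ (2 ^ 22 + 1) := by rw [hQdef, mul_div_assoc]
  · -- ### (9.12): `|Ã(x) - G A(x)| ≤ C A(x)/log x`
    have hdec1 := sqfree_congrSum_sub_eq A 1 x (V := V) (by rw [← hXdef]; exact hXV) 0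
    simp only [Nat.lcm_one_right, zero_mul, sub_zero] at hdec1
    rw [hdec1]
    set M₁ := ∑ ν ∈ (Icc 1 V).filter Squarefree, (μ ν : ℝ) * A.density (ν ^ 2) with hM₁
    set R₁ := ∑ ν ∈ (Icc 1 V).filter Squarefree, (μ ν : ℝ) * A.remainder (ν ^ 2) x with hR₁
    have hMG : |M₁ - G| ≤ (eKZ + 2 * K) / ℓ := by
      have h1 := abs_sum_sqfree_moebius_sq_sub_prod_le hg h24 hK V
      have h2 : 0 ≤ (∏ p ∈ Nat.primesLE V, (1 - A.density (p ^ 2))) - G := by linarith only [hGle V]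
      have h3 : (∏ p ∈ Nat.primesLE V, (1 - A.density (p ^ 2))) - G ≤ 2 * K / ((V : ℝ) + 1) := by
        linarith only [hGge V]
      have hℓV : ℓ ≤ (V : ℝ) + 1 := by
        have : ℓ ≤ x := by
          rw [hℓ]; linarith only [Real.log_le_sub_one_of_pos hx0]
        linarith only [this, hxV]
      have h14 : (ℓ ^ 14680064)⁻¹ ≤ ℓ⁻¹ := by
        refine inv_anti₀ hℓ0 ?_
        calc ℓ = ℓ ^ 1 := (pow_one ℓ).symm
          _ ≤ ℓ ^ 14680064 := pow_le_pow_right₀ hℓ1 (by norm_num)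
      calc |M₁ - G| = |(M₁ - ∏ p ∈ Nat.primesLE V, (1 - A.density (p ^ 2))) +
            ((∏ p ∈ Nat.primesLE V, (1 - A.density (p ^ 2))) - G)| := by ring_nf
        _ ≤ |M₁ - ∏ p ∈ Nat.primesLE V, (1 - A.density (p ^ 2))| +
            |(∏ p ∈ Nat.primesLE V, (1 - A.density (p ^ 2))) - G| := abs_add_le _ _
        _ ≤ ((V : ℝ) + 1) ^ (-(7 / 8 : ℝ)) * eKZ + 2 * K / ((V : ℝ) + 1) := by
            rw [abs_of_nonneg h2]; exact add_le_add h1 h3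
        _ ≤ ℓ⁻¹ * eKZ + 2 * K / ℓ := by
            refine add_le_add (mul_le_mul_of_nonneg_right (htailV.trans h14) heKZ0) ?_
            exact div_le_div_of_nonneg_left (by positivity) hℓ0 hℓV
        _ = (eKZ + 2 * K) / ℓ := by field_simp
    have hR₁b : |R₁| ≤ κR * A.size x / ℓ := by
      refine (hR1 x le_rfl).trans ?_
      exact div_le_div_of_nonneg_left (by positivity) (by positivity)
        (by calc ℓ = ℓ ^ 1 := (pow_one ℓ).symm
              _ ≤ ℓ ^ 8126464 := pow_le_pow_right₀ hℓ1 (by norm_num))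
    calc |M₁ * A.size x + R₁ - G * A.size x| = |(M₁ - G) * A.size x + R₁| := by ring_nf
      _ ≤ |(M₁ - G) * A.size x| + |R₁| := abs_add_le _ _
      _ ≤ (eKZ + 2 * K) / ℓ * A.size x + κR * A.size x / ℓ := by
          rw [abs_mul, abs_of_nonneg hA0]
          exact add_le_add (mul_le_mul_of_nonneg_right hMG hA0) hR₁b
      _ ≤ C * A.size x / ℓ := by
          rw [hCdef]
          have hrest : 0 ≤ (κA + Real.sqrt (κ₁ * 1) + Real.sqrt (Km' * κ₂) + Real.sqrt (1 * κ₃) + κg + κC) *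
              A.size x / ℓ := by
            have hκA0 : 0 ≤ κA := by rw [hκA]; positivity
            have hκg0 : 0 ≤ κg := by rw [hκg]; positivity
            have hκC0 : 0 ≤ κC := by rw [hκC]; positivity
            positivity
          have heq : (κA + Real.sqrt (κ₁ * 1) + Real.sqrt (Km' * κ₂) + Real.sqrt (1 * κ₃) + κg + κC +
              (eKZ + 2 * K) + κR) * A.size x / ℓ =
              (κA + Real.sqrt (κ₁ * 1) + Real.sqrt (Km' * κ₂) + Real.sqrt (1 * κ₃) + κg + κC) * A.size x / ℓ +
              ((eKZ + 2 * K) / ℓ * A.size x + κR * A.size x / ℓ) := by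
            field_simp; ring
          rw [heq]
          linarith only [hrest]

end Main

end Literature.NumberTheory.Sieve.ASPTheorem2
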